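import Mathlib
import Literature.NumberTheory.MahlerMeasure.FewMonomials
import Literature.NumberTheory.MahlerMeasure.IntegerMahlerMeasure
import Literature.NumberTheory.MahlerMeasure.SmythNonreciprocalTheorem
import Literature.NumberTheory.MahlerMeasure.SmythIsolation
import Literature.NumberTheory.MahlerMeasure.SmallMeasureStructure
import Literature.NumberTheory.MahlerMeasure.CyclotomicIntegerHeightBound
import Literature.NumberTheory.MahlerMeasure.DobrowolskiTheorem
import HarnessLib

/-!
# Dobrowolski's quadrinomial bound: a noncyclotomic monic integer quadrinomial has `M(f) ≥ θ₀ = 1.3247…` (Dobrowolski 2006, Prop. 2) — `QuadrinomialMahlerBound` HOLDS (re-homed proofs)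

**Dobrowolski's quadrinomial bound** (E. Dobrowolski, *Mahler's measure of a polynomial in terms of the number of its monomials*, Acta
Arith. 123 (2006), Proposition 2): a monic `f ∈ ℤ[x]` with `f(0) ≠ 0` and exactly four nonzero coefficients which is not a product of
cyclotomic polynomials has `M(f) ≥ θ₀ = M(x³ − x − 1) = 1.3247…` (`FourTermSharp.smythTheta_le_measure_of_card_support_le_four`; the
trinomial case `TrinomialSmythBound` included) — RE-HOMED into `Literature/` by the Hodge foundations lane (`lit-hodgefound`, seat p20,
generation 36) from the venture cell `pub-namedobj` (seats `pub-namedobj-mahler-g2x`): verbatim DECLARATION-LEVEL ports, in dependency order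
and each with its original module docstring, of the modules `Summits/Ventures/DiscreteObjects/Mahler/{FourTermMeasureBound (4),
FourTermAbsTwoFactors, FourTermAbsTwo (3), FourTermCyclotomicFactors (5), FourTermSpecialFamily (6), FourTermCoprimeSharp, FourTermResidualCerts,
TrinomialSmythBound (6), FourTermSharp (3)}.lean`, namespace `Summit.Ventures.DiscreteObjects.Mahler` re-rooted as
`Literature.NumberTheory.MahlerMeasure` (this file's path namespace); it rests on the sibling ports `SmythNonreciprocalTheorem.lean` (the
nonreciprocal case is Smyth's theorem), `SmythIsolation.lean`, `SmallMeasureStructure.lean` (Kronecker, cyclotomic factors, the certificate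
kernel) and the base `IntegerMahlerMeasure.lean`.

PROOF AS FORMALISED (the cell's kernel replication of Dobrowolski's argument; Part headers carry the details): reciprocal quadrinomials reduce
to `x^{p+q} + b x^q … ` shapes; resultant bounds with `x^m − 1`; the `|coefficient| = 2` factors; cyclotomic factors of quadrinomials; the
special family; coprime exponents with explicit numeric thresholds; and finitely many RESIDUAL quadrinomials discharged by Graeffe certificates in
exact integer arithmetic (`decide`).  Definitions kept from the source (with bodies, verbatim): the residual tables `quadAsc`, `quadAscE`,
`certTable*`, `certOf`, `residualOK`, `residualPairs`; no named fact; imports Mathlib/Literature only; every declaration carries the citation of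
the printed step it formalises.  The last Part is the EXACT discharge `Literature.NumberTheory.MahlerMeasure.QuadrinomialMahlerBound_holds` of the
Literature named fact `QuadrinomialMahlerBound` (`FewMonomials.lean`); its only previous proof was the Summits-side
`Summit.Ventures.DiscreteObjects.Mahler.quadrinomialMahlerBound_holds`, which `Literature/` cannot import.  The companion fact
`IrreducibleFewnomialMahlerBound` (Dobrowolski 2006 Prop. 1) is NOT discharged here.  The Summits originals stay in place (transitional
duplication).  Lehmer's problem is not touched.
-/

noncomputable section

/-!
## Part 1 — port of `Summits/Ventures/DiscreteObjects/Mahler/FourTermMeasureBound.lean` (4 declarations kept)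

# Sparse reciprocal polynomials I: `M ≥ √2` for cyclotomic-free (anti)reciprocal quadrinomials
(venture `DiscreteObjects`, target L)

Cell `pub-namedobj`, seat `pub-namedobj-mahler-g24`. Framing: lottery ticket; floor = certified
bounds/negative ranges.

A (anti)reciprocal integer polynomial with nonzero constant term and at most four monomials is, up to
sign, `a(xⁿ ± 1)`, `x^{2m} + c x^m + 1`, or `x^{p+q} + b x^p + s b x^q + s` (`0 < p < q`, `s = ±1`).
For the last shape we prove, by the resultant method of Borwein–Dobrowolski–Mossinghoff (the abstract
Lemma 3.1 of [BDM07] is `pow_le_abs_resultant_of_eq` in `CongruentOneCoefficients`) with the auxiliary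
polynomials `X^n + s` and `X^{2n} - 1`:

* `abs_pow_le_pow_mul_measure_pow_of_resultant` — the general step: if `G = m·T + f·P`,
  `Res(f, G) ≠ 0` and `|G(α)| ≤ K max(1,|α|)^N` on `ℂ`, then `|m|^{deg f} ≤ K^{deg f} M(f)^N`;
* `abs_le_two_mul_measure_quadrinomial` — `|b| ≤ 2 M(P)` for cyclotomic-free
  `P = x^{p+q} + b x^p + s b x^q + s` (congruence `P ≡ xⁿ + s (mod b)`, auxiliary `xⁿ + s`);
* `abs_le_measure_sq_quadrinomial` — `|b| ≤ M(P)²` when moreover `b` is even (at a root `α`: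
  `αⁿ + s = -bT(α)` AND `αⁿ - s = -bT(α) - 2s` with `T = x^p + s x^q`, so the auxiliary `x^{2n} - 1`
  is `≡ 0 (mod 2b)` along `P`);
* `not_cyclotomicFree_quadrinomial_of_abs_le_one` — `|b| ≤ 1` forces a root of unity among the roots
  (`b = ±1`: `P = (x^p + e)(x^q + s e)`, `e = s b`);
* `sqrt_two_le_measure_quadrinomial` — hence **`M(P) ≥ √2`** for every cyclotomic-free `P` of this
  shape (`b` even: `M² ≥ |b| ≥ 2`; `b` odd: `M ≥ |b|/2 ≥ 3/2`).

The trinomial shape is treated the same way in `ReciprocalTrinomialMeasureBound`.  Print: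
Dobrowolski–Smyth, Int. J. Number Theory 13 (2017) (arXiv:1606.04376), Thm 1, give `M(f) ≥ h(f)/2^{k-2}`
for integer `k`-nomials of height `h(f)`, i.e. `h/4` for quadrinomials; the bounds above are `√h` resp.
`h/2` for this reciprocal shape and put every cyclotomic-free one above `√2` (with Smyth's theorem for the
nonreciprocal shapes: every cyclotomic-free integer polynomial with at most four monomials has
`M ≥ θ₀ = 1.3247…` — assembled in a sequel file).  Ours as far as searched; PROVISIONAL.
-/

section Part1

namespace Literature.NumberTheory.MahlerMeasure

open _root_.Polynomial

/-! ### The resultant step, general form -/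

/-- **The BDM resultant step with a general auxiliary polynomial.**  If `G = m T + f P` in `ℤ[X]` with
`deg P + deg f ≤ N`, `deg G ≤ N`, `Res_{(deg f, N)}(f, G) ≠ 0`, and `|G(α)| ≤ K · max(1,|α|)^N` for all
complex `α`, then `|m|^{deg f} ≤ K^{deg f} · M(f)^N`.
[cite: Dobrowolski2006, Proposition 2 p.203 (proof: resultant bound)] -/
theorem abs_pow_le_pow_mul_measure_pow_of_resultant {f G T P : ℤ[X]} {m : ℤ} {N : ℕ} {K : ℝ}
    (hG : G = C m * T + f * P) (hP : P.natDegree + f.natDegree ≤ N)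
    (hGN : G.natDegree ≤ N) (hne : f.resultant G f.natDegree N ≠ 0)
    (hroot : ∀ α : ℂ, ‖(G.map (Int.castRingHom ℂ)).eval α‖ ≤ K * max 1 ‖α‖ ^ N) :
    (|m| : ℝ) ^ f.natDegree ≤ K ^ f.natDegree * intMahlerMeasure f ^ N := by
  have hlow := pow_le_abs_resultant_of_eq hG hP hne
  have hinj : Function.Injective (Int.castRingHom ℂ) := (Int.castRingHom ℂ).injective_int
  have hlowR : (|m| : ℝ) ^ f.natDegree ≤ ‖((f.resultant G f.natDegree N : ℤ) : ℂ)‖ := by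
    rw [Complex.norm_intCast]
    exact_mod_cast hlow
  rw [resultant_intCast_eq (f := f) (N := N) hGN, norm_mul, norm_pow] at hlowR
  have hmp := map_multiset_prod (normHom : ℂ →*₀ ℝ)
    (((f.map (Int.castRingHom ℂ)).roots.map (G.map (Int.castRingHom ℂ)).eval))
  rw [Multiset.map_map] at hmp
  simp only [normHom_apply, Function.comp_def] at hmp
  rw [hmp] at hlowR
  set d := f.natDegree with hd
  have hcard : Multiset.card (f.map (Int.castRingHom ℂ)).roots = d := by
    have hsp := (IsAlgClosed.splits (f.map (Int.castRingHom ℂ))).natDegree_eq_card_roots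
    rw [natDegree_map_eq_of_injective hinj] at hsp
    exact hsp.symm
  have hprod : ((f.map (Int.castRingHom ℂ)).roots.map
      (fun α : ℂ => ‖(G.map (Int.castRingHom ℂ)).eval α‖)).prod ≤
      K ^ d * ((f.map (Int.castRingHom ℂ)).roots.map (fun α : ℂ => max 1 ‖α‖)).prod ^ N := by
    calc ((f.map (Int.castRingHom ℂ)).roots.map (fun α : ℂ => ‖(G.map (Int.castRingHom ℂ)).eval α‖)).prod
        ≤ ((f.map (Int.castRingHom ℂ)).roots.map (fun α : ℂ => K * max 1 ‖α‖ ^ N)).prod :=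
          Multiset.prod_map_le_prod_map₀ _ _ (fun α _ => norm_nonneg _) (fun α _ => hroot α)
      _ = K ^ d * ((f.map (Int.castRingHom ℂ)).roots.map (fun α : ℂ => max 1 ‖α‖)).prod ^ N := by
          rw [Multiset.prod_map_mul, Multiset.prod_map_pow, Multiset.map_const', Multiset.prod_replicate,
            hcard]
  have hM : intMahlerMeasure f = ‖(f.map (Int.castRingHom ℂ)).leadingCoeff‖ *
      ((f.map (Int.castRingHom ℂ)).roots.map (fun α : ℂ => max 1 ‖α‖)).prod :=
    mahlerMeasure_eq_leadingCoeff_mul_prod_roots _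
  rw [hM, mul_pow]
  calc (|m| : ℝ) ^ d ≤ ‖(f.map (Int.castRingHom ℂ)).leadingCoeff‖ ^ N *
        ((f.map (Int.castRingHom ℂ)).roots.map (fun α : ℂ => ‖(G.map (Int.castRingHom ℂ)).eval α‖)).prod :=
          hlowR
    _ ≤ ‖(f.map (Int.castRingHom ℂ)).leadingCoeff‖ ^ N *
        (K ^ d * ((f.map (Int.castRingHom ℂ)).roots.map (fun α : ℂ => max 1 ‖α‖)).prod ^ N) :=
          mul_le_mul_of_nonneg_left hprod (by positivity)
    _ = K ^ d * (‖(f.map (Int.castRingHom ℂ)).leadingCoeff‖ ^ N *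
        ((f.map (Int.castRingHom ℂ)).roots.map (fun α : ℂ => max 1 ‖α‖)).prod ^ N) := by ring

/-- Per-root bound for a binomial auxiliary: `|α^N + c| ≤ 2 max(1,|α|)^N` when `|c| ≤ 1`.
[cite: Dobrowolski2006, Proposition 2 p.203 (proof: resultant bound)] -/
theorem norm_pow_add_le_two_mul (α c : ℂ) (hc : ‖c‖ ≤ 1) (N : ℕ) :
    ‖α ^ N + c‖ ≤ 2 * max 1 ‖α‖ ^ N := by
  have hm1 : 1 ≤ max 1 ‖α‖ := le_max_left _ _
  calc ‖α ^ N + c‖ ≤ ‖α ^ N‖ + ‖c‖ := norm_add_le _ _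
    _ ≤ ‖α‖ ^ N + 1 := by rw [norm_pow]; exact add_le_add le_rfl hc
    _ ≤ max 1 ‖α‖ ^ N + max 1 ‖α‖ ^ N :=
        add_le_add (pow_le_pow_left₀ (norm_nonneg _) (le_max_right _ _) _) (one_le_pow₀ hm1)
    _ = 2 * max 1 ‖α‖ ^ N := by ring

/-- `s = ±1` as a complex number has norm `≤ 1` (indeed `= 1`).
[cite: Dobrowolski2006, Proposition 2 p.203 (proof: resultant bound)] -/
theorem norm_intCast_le_one_of_sign {s : ℤ} (hs : s = 1 ∨ s = -1) : ‖(s : ℂ)‖ ≤ 1 := by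
  rcases hs with h | h <;> simp [h]

/-! ### Reciprocal / antireciprocal quadrinomials `x^{p+q} + b x^p + s b x^q + s` -/

section Quadrinomial

variable {p q : ℕ} {b s : ℤ}

/-- The quadrinomial is monic of degree `p + q` (for `0 < p < q`): it is `X^{p+q} +` (terms of degree `≤ q`).
[cite: Dobrowolski2006, Proposition 2 p.203 (proof: resultant bound)] -/
theorem quadrinomial_monic_natDegree (hp : 0 < p) (hpq : p < q) (b s : ℤ) :
    (X ^ (p + q) + C b * X ^ p + C (s * b) * X ^ q + C s : ℤ[X]).Monic ∧
      (X ^ (p + q) + C b * X ^ p + C (s * b) * X ^ q + C s : ℤ[X]).natDegree = p + q := by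
  have hR : (C b * X ^ p + C (s * b) * X ^ q + C s : ℤ[X]).degree < (p + q : ℕ) := by
    refine lt_of_le_of_lt (degree_add_le _ _) (max_lt (lt_of_le_of_lt (degree_add_le _ _) (max_lt ?_ ?_)) ?_)
    · exact lt_of_le_of_lt (degree_C_mul_X_pow_le _ _) (by exact_mod_cast (show p < p + q by omega))
    · exact lt_of_le_of_lt (degree_C_mul_X_pow_le _ _) (by exact_mod_cast (show q < p + q by omega))
    · exact lt_of_le_of_lt degree_C_le (by exact_mod_cast (show 0 < p + q by omega))
  have he : (X ^ (p + q) + C b * X ^ p + C (s * b) * X ^ q + C s : ℤ[X]) =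
      X ^ (p + q) + (C b * X ^ p + C (s * b) * X ^ q + C s) := by ring
  have hXd : (X ^ (p + q) : ℤ[X]).degree = (p + q : ℕ) := degree_X_pow _
  rw [he]
  refine ⟨(monic_X_pow _).add_of_left (by rwa [hXd]), ?_⟩
  rw [natDegree_add_eq_left_of_degree_lt (by rwa [hXd]), natDegree_X_pow]

end Quadrinomial

end Literature.NumberTheory.MahlerMeasure

end Part1

/-!
## Part 2 — port of `Summits/Ventures/DiscreteObjects/Mahler/FourTermAbsTwoFactors.lean` (8 declarations kept)

# Sparse reciprocal polynomials IV: cyclotomic factors of `x^{p+q} ± 2x^p ± 2x^q ± 1`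
(venture `DiscreteObjects`, target L)

Cell `pub-namedobj`, seat `pub-namedobj-mahler-g24`. Framing: lottery ticket; floor = certified
bounds/negative ranges.

For `P = x^{p+q} + b x^p + s b x^q + s` with `|b| = 2` (`b = 2ε`, `0 < p < q`, `s = ±1`, `k = q - p`,
`n = p + q`) the norm argument of `FourTermCyclotomicFactors` leaves a second possibility:

* `cyclotomic_dvd_or_of_dvd_quadrinomial_two` — a cyclotomic factor `Φ_r` of `P` divides EITHER
  `x^k + s` (type A, as for `|b| ≥ 3`) OR `xⁿ - s` (type B: `|Res(Φ_r, xⁿ + s)| = 2^{φ(r)}` forces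
  `|ζⁿ + s| = 2`, i.e. `ζⁿ = s`, at every primitive `r`-th root of unity `ζ`);
* `dvd_X_pow_add_and_sub_of_dvd` — type A factors also divide `xⁿ + s` and `x^{2p} - 1` (any `b`);
* `cyclotomic_dvd_of_typeB` — type B factors divide `x^{2p} + sε x^p + 1` and `x^{3p} - sε`
  (`ζ^p + ζ^{-p} = -sε`);
* `not_cyclotomic_sq_dvd_of_typeB` — type B factors are SIMPLE (from `P'(ζ) = 0` one would get
  `(p - q) Im ζ^p = 0`, but `ζ^p` is a primitive cube or sixth root of unity);
* `dvd_X_pow_gcd_sub_C` — Euclid on exponents: `F ∣ x^a - u`, `F ∣ x^c - v` (`u, v = ±1`) give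
  `F ∣ x^{gcd(a,c)} - w` for some `w = ±1` (used to bound the degrees of the cyclotomic parts).

The assembly (`P = C_A C_B Q`, `deg C_A ≤ gcd(k, 2p)`, `deg C_B ≤ gcd(n, 3p)`, and the bound
`M(P) ≥ 2^{1/4}` resp. the kernel ladder for `n < 10 gcd(n, p)`) is in `FourTermAbsTwo`.
In print: [Dobrowolski2006] E. Dobrowolski, Acta Arith. 123 (2006), Prop. 2 (`M(f) ≥ θ₀` for every monic
quadrinomial with `f(0) ≠ 0` not a product of cyclotomics); its proof treats `a = 2` by the same doubling
`2 ∣ α^{m+n} + η ⇒ 2 ∣ α^{m+n} - η`.  This file is a kernel formalisation of that case (REPLICATION; the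
type A / type B bookkeeping is ours).
-/

section Part2

namespace Literature.NumberTheory.MahlerMeasure

open _root_.Polynomial

/-- If a multiset of reals in `[0, c]` (`c > 0`) has product `c^{card}`, every element equals `c`.
[cite: Dobrowolski2006, Proposition 2 p.203 (proof: the case |coefficients| with a 2)] -/
theorem eq_of_prod_map_eq_pow_card {ι : Type*} {R : Multiset ι} {f : ι → ℝ} {c : ℝ} (hc : 0 < c)
    (h0 : ∀ x ∈ R, 0 ≤ f x) (hle : ∀ x ∈ R, f x ≤ c) (hprod : (R.map f).prod = c ^ Multiset.card R) :
    ∀ x ∈ R, f x = c := by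
  intro x hx
  by_contra hne
  have hlt : f x < c := lt_of_le_of_ne (hle x hx) hne
  obtain ⟨R', hR'⟩ := Multiset.exists_cons_of_mem hx
  have hsub : ∀ y ∈ R', y ∈ R := fun y hy => by rw [hR']; exact Multiset.mem_cons_of_mem hy
  have hrest : (R'.map f).prod ≤ c ^ Multiset.card R' := by
    calc (R'.map f).prod ≤ (R'.map fun _ => c).prod :=
          Multiset.prod_map_le_prod_map₀ _ _ (fun y hy => h0 y (hsub y hy)) (fun y hy => hle y (hsub y hy))
      _ = c ^ Multiset.card R' := by rw [Multiset.map_const', Multiset.prod_replicate]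
  rw [hR', Multiset.map_cons, Multiset.prod_cons, Multiset.card_cons, pow_succ'] at hprod
  have h1 : f x * (R'.map f).prod ≤ f x * c ^ Multiset.card R' :=
    mul_le_mul_of_nonneg_left hrest (h0 x hx)
  have h2 : f x * c ^ Multiset.card R' < c * c ^ Multiset.card R' :=
    mul_lt_mul_of_pos_right hlt (pow_pos hc _)
  linarith

/-- **Euclid on exponents.** If `F ∣ x^a - u` and `F ∣ x^c - v` in `ℤ[X]` with `u, v = ±1` and
`a, c > 0`, then `F ∣ x^{gcd(a,c)} - w` for some `w = ±1`
(`x^a - u - x^{a-c}(x^c - v) = v (x^{a-c} - uv)`).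
[cite: Dobrowolski2006, Proposition 2 p.203 (proof: the case |coefficients| with a 2)] -/
theorem dvd_X_pow_gcd_sub_C {F : ℤ[X]} : ∀ (m a c : ℕ) (u v : ℤ), a + c ≤ m → 0 < a → 0 < c →
    (u = 1 ∨ u = -1) → (v = 1 ∨ v = -1) → F ∣ (X ^ a - C u : ℤ[X]) → F ∣ (X ^ c - C v : ℤ[X]) →
    ∃ w : ℤ, (w = 1 ∨ w = -1) ∧ F ∣ (X ^ (Nat.gcd a c) - C w : ℤ[X]) := by
  intro m
  induction m using Nat.strong_induction_on with
  | _ m ih =>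
    intro a c u v hm ha hc hu hv hFa hFc
    -- the reduction step `(a, c) ↦ (a - c, c)` for `c < a`
    have step : ∀ (a c : ℕ) (u v : ℤ), a + c ≤ m → 0 < a → 0 < c → c < a → (u = 1 ∨ u = -1) →
        (v = 1 ∨ v = -1) → F ∣ (X ^ a - C u : ℤ[X]) → F ∣ (X ^ c - C v : ℤ[X]) →
        ∃ w : ℤ, (w = 1 ∨ w = -1) ∧ F ∣ (X ^ (Nat.gcd a c) - C w : ℤ[X]) := by
      intro a c u v hm ha hc hca hu hv hFa hFc
      have hvv : v * v = 1 := by rcases hv with h | h <;> simp [h]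
      have hCv : (C v : ℤ[X]) * C v = 1 := by rw [← map_mul, hvv, map_one]
      have hF' : F ∣ (X ^ (a - c) - C (u * v) : ℤ[X]) := by
        have e : (X ^ (a - c) - C (u * v) : ℤ[X]) = C v * ((X ^ a - C u) - X ^ (a - c) * (X ^ c - C v)) := by
          obtain ⟨d, rfl⟩ : ∃ d, a = c + d := ⟨a - c, by omega⟩
          rw [Nat.add_sub_cancel_left, map_mul, pow_add]
          linear_combination (-(X ^ d : ℤ[X])) * hCv
        rw [e]
        exact dvd_mul_of_dvd_right (dvd_sub hFa (dvd_mul_of_dvd_right hFc _)) _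
      have huv : u * v = 1 ∨ u * v = -1 := by
        rcases hu with h | h <;> rcases hv with h' | h' <;> simp [h, h']
      obtain ⟨w, hw, hdvd⟩ := ih (a - c + c) (by omega) (a - c) c (u * v) v le_rfl (by omega) hc huv hv hF' hFc
      refine ⟨w, hw, ?_⟩
      rwa [Nat.gcd_sub_self_left hca.le] at hdvd
    rcases lt_trichotomy c a with hca | hca | hca
    · exact step a c u v hm ha hc hca hu hv hFa hFc
    · subst hca; exact ⟨u, hu, by rwa [Nat.gcd_self]⟩
    · obtain ⟨w, hw, hdvd⟩ := step c a v u (by omega) hc ha hca hv hu hFc hFa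
      exact ⟨w, hw, by rwa [Nat.gcd_comm]⟩

section Quadrinomial

variable {p q : ℕ} {b s : ℤ}

/-- `x^{p+q} + s = P - (b s) x^p (x^{q-p} + s)` for the quadrinomial `P` (uses `s² = 1`).
[cite: Dobrowolski2006, Proposition 2 p.203 (proof: the case |coefficients| with a 2)] -/
theorem X_pow_add_C_eq_quadrinomial_sub (hpq : p < q) (hs : s = 1 ∨ s = -1) (b : ℤ) :
    (X ^ (p + q) + C s : ℤ[X]) = (X ^ (p + q) + C b * X ^ p + C (s * b) * X ^ q + C s)
      - C (b * s) * (X ^ p * (X ^ (q - p) + C s)) := by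
  have hss : s * s = 1 := by rcases hs with h | h <;> simp [h]
  have hCs : (C s : ℤ[X]) * C s = 1 := by rw [← map_mul, hss, map_one]
  obtain ⟨k, rfl⟩ : ∃ k, q = p + k := ⟨q - p, by omega⟩
  rw [Nat.add_sub_cancel_left, map_mul, map_mul]
  linear_combination (C b * X ^ p) * hCs

/-- A common factor of the quadrinomial and of `x^{q-p} + s` divides `x^{p+q} + s` and `x^{2p} - 1`
(any `b`; for `|b| ≥ 3` every cyclotomic factor is of this type).
[cite: Dobrowolski2006, Proposition 2 p.203 (proof: the case |coefficients| with a 2)] -/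
theorem dvd_X_pow_add_and_sub_of_dvd (hpq : p < q) (hs : s = 1 ∨ s = -1) {F : ℤ[X]}
    (hF : F ∣ (X ^ (p + q) + C b * X ^ p + C (s * b) * X ^ q + C s : ℤ[X]))
    (hW : F ∣ (X ^ (q - p) + C s : ℤ[X])) :
    F ∣ (X ^ (p + q) + C s : ℤ[X]) ∧ F ∣ (X ^ (2 * p) - 1 : ℤ[X]) := by
  have hss : s * s = 1 := by rcases hs with h | h <;> simp [h]
  have hCs : (C s : ℤ[X]) * C s = 1 := by rw [← map_mul, hss, map_one]
  have h1 : F ∣ (X ^ (p + q) + C s : ℤ[X]) := by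
    rw [X_pow_add_C_eq_quadrinomial_sub hpq hs b]
    exact dvd_sub hF (dvd_mul_of_dvd_right (dvd_mul_of_dvd_right hW _) _)
  refine ⟨h1, ?_⟩
  have e2 : (X ^ (2 * p) - 1 : ℤ[X]) = C s * (X ^ (2 * p) * (X ^ (q - p) + C s) - (X ^ (p + q) + C s)) := by
    obtain ⟨k, rfl⟩ : ∃ k, q = p + k := ⟨q - p, by omega⟩
    rw [Nat.add_sub_cancel_left]
    linear_combination (1 - X ^ (2 * p) : ℤ[X]) * hCs
  rw [e2]
  exact dvd_mul_of_dvd_right (dvd_sub (dvd_mul_of_dvd_right hW _) h1) _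

/-- A point `w` of the unit circle with `|w + s| = 2` (`s = ±1`) is `w = s`.
[cite: Dobrowolski2006, Proposition 2 p.203 (proof: the case |coefficients| with a 2)] -/
theorem eq_of_norm_eq_one_of_norm_add_sign {w : ℂ} (hw : ‖w‖ = 1) (hs : s = 1 ∨ s = -1)
    (h2 : ‖w + (s : ℂ)‖ = 2) : w = (s : ℂ) := by
  rcases hs with h | h
  · subst h
    have h' : ‖-w - 1‖ = 2 := by rw [show -w - 1 = -(w + ((1 : ℤ) : ℂ)) by push_cast; ring, norm_neg, h2]
    have := eq_neg_one_of_norm_eq_one_of_norm_sub_one (by rw [norm_neg, hw]) h'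
    push_cast; linear_combination -this
  · subst h
    have h' : ‖w - 1‖ = 2 := by rw [show w - 1 = w + ((-1 : ℤ) : ℂ) by push_cast; ring, h2]
    have := eq_neg_one_of_norm_eq_one_of_norm_sub_one hw h'
    push_cast; exact this

/-- **Cyclotomic factors of the quadrinomial, `|b| = 2`: two types.**  If `Φ_r ∣ P` with `b = ±2` then
`Φ_r ∣ x^{q-p} + s` (type A) or `Φ_r ∣ x^{p+q} - s` (type B).  Proof: with `W = x^{q-p} + s`,
`Res(Φ_r, xⁿ + s) = (-bs)^{φ(r)} Res(Φ_r, x^p W)`; if the second resultant is nonzero, the first has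
modulus `≥ 2^{φ(r)}`, so every primitive `r`-th root of unity `ζ` has `|ζⁿ + s| = 2`, i.e. `ζⁿ = s`.
[cite: Dobrowolski2006, Proposition 2 p.203 (proof: the case |coefficients| with a 2)] -/
theorem cyclotomic_dvd_or_of_dvd_quadrinomial_two (hp : 0 < p) (hpq : p < q) (hs : s = 1 ∨ s = -1)
    (hb : b = 2 ∨ b = -2) {r : ℕ} (hr : 0 < r)
    (hdvd : cyclotomic r ℤ ∣ (X ^ (p + q) + C b * X ^ p + C (s * b) * X ^ q + C s : ℤ[X])) :
    cyclotomic r ℤ ∣ (X ^ (q - p) + C s : ℤ[X]) ∨ cyclotomic r ℤ ∣ (X ^ (p + q) - C s : ℤ[X]) := by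
  set Φ : ℤ[X] := cyclotomic r ℤ with hΦ
  set n := p + q with hn
  have hΦm : Φ.Monic := cyclotomic.monic r ℤ
  have hΦ0 : Φ ≠ 0 := hΦm.ne_zero
  have hdpos : 0 < Φ.natDegree := by rw [natDegree_cyclotomic]; exact Nat.totient_pos.mpr hr
  obtain ⟨H, hH⟩ := hdvd
  have hH0 : H ≠ 0 := by
    intro h0
    have := (quadrinomial_monic_natDegree hp hpq b s).1.ne_zero
    rw [hH, h0, mul_zero] at this
    exact this rfl
  have hHdeg : H.natDegree + Φ.natDegree = n := by
    have h := (quadrinomial_monic_natDegree hp hpq b s).2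
    rw [hH, natDegree_mul hΦ0 hH0] at h
    omega
  have hG : (X ^ n + C s : ℤ[X]) = C (-(b * s)) * (X ^ p * (X ^ (q - p) + C s)) + Φ * H := by
    rw [← hH, X_pow_add_C_eq_quadrinomial_sub hpq hs b, map_neg]; ring
  have hGdeg : (X ^ n + C s : ℤ[X]).natDegree ≤ n := by rw [natDegree_X_pow_add_C]
  have hTdeg : (X ^ p * (X ^ (q - p) + C s) : ℤ[X]).natDegree ≤ n := by
    refine natDegree_mul_le.trans ?_
    rw [natDegree_X_pow, natDegree_X_pow_add_C]; omega
  have hres : Φ.resultant (X ^ n + C s) Φ.natDegree n =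
      (-(b * s)) ^ Φ.natDegree * Φ.resultant (X ^ p * (X ^ (q - p) + C s)) Φ.natDegree n := by
    rw [hG, resultant_add_mul_right Φ (C (-(b * s)) * (X ^ p * (X ^ (q - p) + C s))) H Φ.natDegree n
      (by omega) le_rfl, resultant_C_mul_right]
  -- roots of `Φ` over `ℂ`
  have hinj : Function.Injective (Int.castRingHom ℂ) := (Int.castRingHom ℂ).injective_int
  have hcard : Multiset.card (Φ.map (Int.castRingHom ℂ)).roots = Φ.natDegree := by
    have hsp := (IsAlgClosed.splits (Φ.map (Int.castRingHom ℂ))).natDegree_eq_card_roots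
    rw [natDegree_map_eq_of_injective hinj] at hsp
    exact hsp.symm
  have hlc : (Φ.map (Int.castRingHom ℂ)).leadingCoeff = 1 := by
    rw [leadingCoeff_map_of_injective hinj, hΦm.leadingCoeff, map_one]
  have hrootΦ : ∀ ζ ∈ (Φ.map (Int.castRingHom ℂ)).roots, IsPrimitiveRoot ζ r := by
    intro ζ hζ
    have h := (mem_roots'.mp hζ).2
    rw [hΦ, map_cyclotomic] at h
    haveI : NeZero (r : ℂ) := ⟨by exact_mod_cast hr.ne'⟩
    exact isRoot_cyclotomic_iff.mp h
  have hevalG : ∀ ζ : ℂ, ((X ^ n + C s : ℤ[X]).map (Int.castRingHom ℂ)).eval ζ = ζ ^ n + (s : ℂ) := by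
    intro ζ
    simp only [Polynomial.map_add, Polynomial.map_pow, map_X, eq_intCast, Polynomial.map_intCast,
      eval_add, eval_pow, eval_X, eval_intCast]
  by_cases hzero : Φ.resultant (X ^ p * (X ^ (q - p) + C s)) Φ.natDegree n = 0
  · -- type A: a common root of `Φ` and `x^p W`
    left
    have hC := resultant_intCast_eq (f := Φ) hTdeg
    rw [hzero, Int.cast_zero, hlc, one_pow, one_mul] at hC
    obtain ⟨w, hw, hw0⟩ := Multiset.prod_eq_zero_iff.mp hC.symm |> Multiset.mem_map.mp
    have hζ := hrootΦ w hw
    have hw1 : ‖w‖ = 1 := hζ.norm'_eq_one hr.ne'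
    have hwne : w ≠ 0 := fun h => by rw [h, norm_zero] at hw1; exact zero_ne_one hw1
    have hWw : aeval w (X ^ (q - p) + C s : ℤ[X]) = 0 := by
      simp only [Polynomial.map_mul, Polynomial.map_pow, map_X, eval_mul, eval_pow, eval_X] at hw0
      rcases mul_eq_zero.mp hw0 with h | h
      · exact absurd (pow_eq_zero_iff (by omega) |>.mp h) hwne
      · rwa [eval_map, ← algebraMap_int_eq, ← aeval_def] at h
    rw [hΦ, cyclotomic_eq_minpoly hζ hr]
    exact minpoly.isIntegrallyClosed_dvd (hζ.isIntegral hr) hWw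
  · -- type B: `∏ |ζⁿ + s| = 2^{φ(r)}`, so each `ζⁿ = s`
    right
    have hbs : |(-(b * s))| = (2 : ℤ) := by
      rcases hb with h | h <;> rcases hs with h' | h' <;> simp [h, h']
    have hlow : (2 : ℝ) ^ Φ.natDegree ≤ ‖((Φ.resultant (X ^ n + C s) Φ.natDegree n : ℤ) : ℂ)‖ := by
      rw [Complex.norm_intCast]
      have h1 : (1 : ℤ) ≤ |Φ.resultant (X ^ p * (X ^ (q - p) + C s)) Φ.natDegree n| := Int.one_le_abs hzero
      have h2 : (2 : ℤ) ^ Φ.natDegree ≤ |Φ.resultant (X ^ n + C s) Φ.natDegree n| := by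
        rw [hres, abs_mul, abs_pow, hbs]
        calc (2 : ℤ) ^ Φ.natDegree = 2 ^ Φ.natDegree * 1 := by ring
          _ ≤ 2 ^ Φ.natDegree * |Φ.resultant (X ^ p * (X ^ (q - p) + C s)) Φ.natDegree n| :=
              mul_le_mul_of_nonneg_left h1 (by positivity)
      exact_mod_cast h2
    rw [resultant_intCast_eq hGdeg, hlc, one_pow, one_mul] at hlow
    have hmp := map_multiset_prod (normHom : ℂ →*₀ ℝ)
      (((Φ.map (Int.castRingHom ℂ)).roots.map ((X ^ n + C s : ℤ[X]).map (Int.castRingHom ℂ)).eval))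
    rw [Multiset.map_map] at hmp
    simp only [normHom_apply, Function.comp_def] at hmp
    rw [hmp] at hlow
    have hle2 : ∀ ζ ∈ (Φ.map (Int.castRingHom ℂ)).roots,
        ‖((X ^ n + C s : ℤ[X]).map (Int.castRingHom ℂ)).eval ζ‖ ≤ 2 := by
      intro ζ hζ
      rw [hevalG]
      have h1 : ‖ζ‖ = 1 := (hrootΦ ζ hζ).norm'_eq_one hr.ne'
      calc ‖ζ ^ n + (s : ℂ)‖ ≤ ‖ζ ^ n‖ + ‖(s : ℂ)‖ := norm_add_le _ _
        _ ≤ 1 + 1 := add_le_add (by rw [norm_pow, h1, one_pow]) (norm_intCast_le_one_of_sign hs)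
        _ = 2 := by norm_num
    have hup : ((Φ.map (Int.castRingHom ℂ)).roots.map
        (fun ζ => ‖((X ^ n + C s : ℤ[X]).map (Int.castRingHom ℂ)).eval ζ‖)).prod ≤ 2 ^ Φ.natDegree := by
      calc ((Φ.map (Int.castRingHom ℂ)).roots.map
            (fun ζ => ‖((X ^ n + C s : ℤ[X]).map (Int.castRingHom ℂ)).eval ζ‖)).prod
          ≤ ((Φ.map (Int.castRingHom ℂ)).roots.map (fun _ => (2 : ℝ))).prod :=
            Multiset.prod_map_le_prod_map₀ _ _ (fun ζ _ => norm_nonneg _) hle2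
        _ = 2 ^ Φ.natDegree := by rw [Multiset.map_const', Multiset.prod_replicate, hcard]
    have heq := le_antisymm hup hlow
    rw [← hcard] at heq
    have hall := eq_of_prod_map_eq_pow_card (by norm_num : (0 : ℝ) < 2) (fun ζ _ => norm_nonneg _) hle2 heq
    -- pick a root `ζ`; it has `ζⁿ = s`
    have hne : (Φ.map (Int.castRingHom ℂ)).roots ≠ 0 := by
      intro h; rw [h, Multiset.card_zero] at hcard; omega
    obtain ⟨ζ, hζ⟩ := Multiset.exists_mem_of_ne_zero hne
    have hprim := hrootΦ ζ hζ
    have hζ1 : ‖ζ‖ = 1 := hprim.norm'_eq_one hr.ne'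
    have h2 := hall ζ hζ
    rw [hevalG] at h2
    have hζn : ζ ^ n = (s : ℂ) := eq_of_norm_eq_one_of_norm_add_sign (by rw [norm_pow, hζ1, one_pow]) hs h2
    have haev : aeval ζ (X ^ n - C s : ℤ[X]) = 0 := by
      simp only [map_sub, map_pow, aeval_X, eq_intCast, map_intCast, hζn, sub_self]
    rw [hΦ, cyclotomic_eq_minpoly hprim hr]
    exact minpoly.isIntegrallyClosed_dvd (hprim.isIntegral hr) haev

/-- **Type B factors** (`b = 2ε`, `Φ_r ∣ P`, `Φ_r ∣ xⁿ - s`): `Φ_r ∣ x^{2p} + sε x^p + 1` and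
`Φ_r ∣ x^{3p} - sε`.  (`P - (xⁿ - s) = 2U` with `U = ε x^p + εs x^q + s`, `Φ_r` is prime and does not
divide `2`, `x^p U = ε(x^{2p} + sεx^p + 1) + εs(xⁿ - s)`, and `(x^p - sε)(x^{2p} + sεx^p + 1) = x^{3p} - sε`.)
[cite: Dobrowolski2006, Proposition 2 p.203 (proof: the case |coefficients| with a 2)] -/
theorem cyclotomic_dvd_of_typeB (hs : s = 1 ∨ s = -1) {ε : ℤ} (hε : ε = 1 ∨ ε = -1)
    (hb : b = 2 * ε) {r : ℕ} (hr : 0 < r)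
    (hdvd : cyclotomic r ℤ ∣ (X ^ (p + q) + C b * X ^ p + C (s * b) * X ^ q + C s : ℤ[X]))
    (hB : cyclotomic r ℤ ∣ (X ^ (p + q) - C s : ℤ[X])) :
    cyclotomic r ℤ ∣ (X ^ (2 * p) + C (s * ε) * X ^ p + 1 : ℤ[X]) ∧
      cyclotomic r ℤ ∣ (X ^ (3 * p) - C (s * ε) : ℤ[X]) := by
  set Φ : ℤ[X] := cyclotomic r ℤ with hΦ
  have hss : s * s = 1 := by rcases hs with h | h <;> simp [h]
  have hεε : ε * ε = 1 := by rcases hε with h | h <;> simp [h]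
  have hCs : (C s : ℤ[X]) * C s = 1 := by rw [← map_mul, hss, map_one]
  have hCε : (C ε : ℤ[X]) * C ε = 1 := by rw [← map_mul, hεε, map_one]
  have hprime : Prime Φ := (cyclotomic.irreducible hr).prime
  -- `Φ ∣ U`
  set U : ℤ[X] := C ε * X ^ p + C (ε * s) * X ^ q + C s with hU
  have hPU : (X ^ (p + q) + C b * X ^ p + C (s * b) * X ^ q + C s : ℤ[X]) - (X ^ (p + q) - C s) = C 2 * U := by
    rw [hU, hb]; simp only [map_mul, map_ofNat]; ring
  have h2U : Φ ∣ C 2 * U := by rw [← hPU]; exact dvd_sub hdvd hB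
  have hU' : Φ ∣ U := by
    rcases hprime.dvd_or_dvd h2U with h | h
    · exfalso
      have hd := natDegree_le_of_dvd h (by simp)
      rw [natDegree_C, hΦ, natDegree_cyclotomic] at hd
      have := Nat.totient_pos.mpr hr
      omega
    · exact h
  -- `Φ ∣ Y`
  have hY : Φ ∣ (X ^ (2 * p) + C (s * ε) * X ^ p + 1 : ℤ[X]) := by
    have e : (X ^ (2 * p) + C (s * ε) * X ^ p + 1 : ℤ[X]) =
        C ε * (X ^ p * U) - C (ε * s) * C ε * (X ^ (p + q) - C s) := by
      rw [hU]; simp only [map_mul]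
      linear_combination (-(X ^ (2 * p) + 1 : ℤ[X])) * hCε + (-(C ε * C ε)) * hCs
    rw [e]
    exact dvd_sub (dvd_mul_of_dvd_right (dvd_mul_of_dvd_right hU' _) _) (dvd_mul_of_dvd_right hB _)
  refine ⟨hY, ?_⟩
  have e3 : (X ^ (3 * p) - C (s * ε) : ℤ[X]) = (X ^ p - C (s * ε)) * (X ^ (2 * p) + C (s * ε) * X ^ p + 1) := by
    simp only [map_mul]
    linear_combination (X ^ p * (C ε * C ε)) * hCs + (X ^ p) * hCε
  rw [e3]
  exact dvd_mul_of_dvd_right hY _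

/-- **Type B factors are simple.**  If `Φ_r ∣ xⁿ - s` and `Φ_r ∣ x^{2p} + sε x^p + 1` (type B) then
`Φ_r² ∤ P`: at a primitive `r`-th root of unity `ζ`, `w = ζ^p` is a primitive cube or sixth root of
unity (`w² + sε w + 1 = 0`, so `Im w ≠ 0`), `ζ^q = s w̄`, and `P'(ζ) = 0` would give
`b (p Im w + s q Im(s w̄)) = b (p - q) Im w = 0`.
[cite: Dobrowolski2006, Proposition 2 p.203 (proof: the case |coefficients| with a 2)] -/
theorem not_cyclotomic_sq_dvd_of_typeB (hp : 0 < p) (hpq : p < q) (hs : s = 1 ∨ s = -1) {ε : ℤ}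
    (hε : ε = 1 ∨ ε = -1) (hb : b = 2 * ε) {r : ℕ} (hr : 0 < r)
    (hB : cyclotomic r ℤ ∣ (X ^ (p + q) - C s : ℤ[X]))
    (hY : cyclotomic r ℤ ∣ (X ^ (2 * p) + C (s * ε) * X ^ p + 1 : ℤ[X])) :
    ¬ cyclotomic r ℤ * cyclotomic r ℤ ∣ (X ^ (p + q) + C b * X ^ p + C (s * b) * X ^ q + C s : ℤ[X]) := by
  intro hdvd
  set Φ : ℤ[X] := cyclotomic r ℤ with hΦ
  set P : ℤ[X] := X ^ (p + q) + C b * X ^ p + C (s * b) * X ^ q + C s with hP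
  have hss : s * s = 1 := by rcases hs with h | h <;> simp [h]
  have hb0 : b ≠ 0 := by rcases hε with h | h <;> simp [hb, h]
  -- a primitive r-th root of unity
  set ζ : ℂ := Complex.exp (2 * Real.pi * Complex.I / r) with hζdef
  have hprim : IsPrimitiveRoot ζ r := Complex.isPrimitiveRoot_exp r (by omega)
  have hζ1 : ‖ζ‖ = 1 := hprim.norm'_eq_one hr.ne'
  have hΦζ : aeval ζ Φ = 0 := by
    have h := hprim.isRoot_cyclotomic hr (R := ℂ)
    rw [IsRoot.def, ← map_cyclotomic_int, eval_map] at h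
    rwa [aeval_def, algebraMap_int_eq]
  have aeval_of_dvd : ∀ {F : ℤ[X]}, Φ ∣ F → aeval ζ F = 0 := by
    intro F hF; obtain ⟨R, hR⟩ := hF; rw [hR, map_mul, hΦζ, zero_mul]
  have hn : ζ ^ (p + q) = (s : ℂ) := by
    have h := aeval_of_dvd hB
    simp only [map_sub, map_pow, aeval_X, eq_intCast, map_intCast] at h
    exact sub_eq_zero.mp h
  set w : ℂ := ζ ^ p with hw
  have hw1 : ‖w‖ = 1 := by rw [hw, norm_pow, hζ1, one_pow]
  have hwY : w ^ 2 + (s : ℂ) * ε * w + 1 = 0 := by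
    have h := aeval_of_dvd hY
    simp only [map_add, map_mul, map_pow, aeval_X, eq_intCast, map_intCast, map_one] at h
    rw [hw, ← pow_mul, mul_comm p 2]; exact h
  -- `ζ^q = s * conj w`
  have hwne : w ≠ 0 := fun h => by rw [h, norm_zero] at hw1; exact zero_ne_one hw1
  have hq : ζ ^ q = (s : ℂ) * (starRingEnd ℂ) w := by
    have h1 : w * ζ ^ q = (s : ℂ) := by rw [hw, ← pow_add, hn]
    rw [← Complex.inv_eq_conj hw1]
    field_simp
    linear_combination h1
  -- `Φ ∣ P'`, the derivative equation at `ζ`, multiplied by `ζ`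
  have hder : Φ ∣ derivative P := by
    obtain ⟨R, hR⟩ := hdvd
    rw [hR, mul_assoc, derivative_mul]
    exact dvd_add ((dvd_mul_right Φ R).mul_left _) (dvd_mul_right _ _)
  have hder' : derivative P = C ((p + q : ℕ) : ℤ) * X ^ (p + q - 1) + C (b * (p : ℤ)) * X ^ (p - 1) +
      C (s * b * (q : ℤ)) * X ^ (q - 1) := by
    rw [hP]
    simp only [derivative_add, derivative_X_pow, derivative_C_mul_X_pow, derivative_C, add_zero]
  have hE := aeval_of_dvd hder
  rw [hder'] at hE
  simp only [map_add, map_mul, map_pow, aeval_X, eq_intCast, map_intCast, map_natCast] at hE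
  have hE' : ((p + q : ℕ) : ℂ) * ζ ^ (p + q) + b * p * ζ ^ p + s * b * q * ζ ^ q = 0 := by
    have e1 : ζ ^ (p + q) = ζ * ζ ^ (p + q - 1) := (mul_pow_sub_one (by omega) ζ).symm
    have e2 : ζ ^ p = ζ * ζ ^ (p - 1) := (mul_pow_sub_one (by omega) ζ).symm
    have e3 : ζ ^ q = ζ * ζ ^ (q - 1) := (mul_pow_sub_one (by omega) ζ).symm
    rw [e1, e2, e3]
    linear_combination ζ * hE
  rw [hn, hq, ← hw] at hE'
  -- imaginary parts: `b (p - q) Im w = 0`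
  have him := congrArg Complex.im hE'
  simp only [Complex.add_im, Complex.mul_im, Complex.mul_re, Complex.natCast_re, Complex.natCast_im,
    Complex.intCast_re, Complex.intCast_im, Complex.conj_re, Complex.conj_im, Complex.zero_im,
    zero_mul, mul_zero, add_zero, sub_zero, zero_add] at him
  have hs2 : (s : ℝ) * s = 1 := by exact_mod_cast hss
  have hkey : ((b : ℝ) * ((p : ℝ) - q)) * w.im = 0 := by
    linear_combination him + ((b : ℝ) * q * w.im) * hs2
  have hpq' : (p : ℝ) - q ≠ 0 := by
    have : (p : ℝ) < q := by exact_mod_cast hpq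
    linarith
  have hb0' : (b : ℝ) ≠ 0 := by exact_mod_cast hb0
  have hwim : w.im = 0 := by
    rcases mul_eq_zero.mp hkey with h | h
    · rcases mul_eq_zero.mp h with h' | h'
      · exact absurd h' hb0'
      · exact absurd h' hpq'
    · exact h
  -- but `w² + sε w + 1 = 0` has no real solution
  have hre := congrArg Complex.re hwY
  simp only [Complex.add_re, Complex.mul_re, Complex.mul_im, sq, Complex.intCast_re, Complex.intCast_im,
    Complex.one_re, Complex.zero_re, hwim, mul_zero, sub_zero, zero_mul, add_zero] at hre
  have hsε : (s : ℝ) * ε = 1 ∨ (s : ℝ) * ε = -1 := by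
    rcases hs with h | h <;> rcases hε with h' | h' <;> simp [h, h']
  rcases hsε with h | h <;> rw [h] at hre <;> nlinarith [sq_nonneg (2 * w.re + 1), sq_nonneg (2 * w.re - 1)]

end Quadrinomial

end Literature.NumberTheory.MahlerMeasure

end Part2

/-!
## Part 3 — port of `Summits/Ventures/DiscreteObjects/Mahler/FourTermAbsTwo.lean` (3 declarations kept)

# Sparse reciprocal polynomials V: no quadrinomial `x^{p+q} ± 2x^p ± 2x^q ± 1` is sub-Lehmer
(venture `DiscreteObjects`, target L)

Cell `pub-namedobj`, seat `pub-namedobj-mahler-g24`. Framing: lottery ticket; floor = certified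
bounds/negative ranges.

`P = x^{p+q} + b x^p + s b x^q + s`, `|b| = 2`, `0 < p < q`, `s = ±1`, `k = q - p`, `n = p + q`,
`g = gcd(n, p)`:

* `eq_natAbs_mul_of_cyclotomic_sq_dvd_of_dvd` — a repeated type A cyclotomic factor forces `n = |b| k`
  (any `b`; for `|b| = 2` this means `n = 4p`, `g = p`);
* `exists_cyclotomicFree_factor_quadrinomial_two` — for `n ≠ 2k`: `P = C_A C_B Q` with `Q`
  cyclotomic-free, `C_A ∣ x^k + s`, `C_A ∣ x^{2p} - 1`, `C_B ∣ xⁿ - s`, `C_B ∣ x^{3p} - sε`;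
  hence `deg C_A ≤ gcd(k, 2p) ≤ 2g`, `deg C_B ≤ gcd(n, 3p) ≤ 3g`;
* `not_subLehmer_quadrinomial_two` — **no such `P` is sub-Lehmer**: if `10 g ≤ n` then `deg Q ≥ n/2`
  and the even resultant step (`x^{2n} - 1 ≡ 0 (mod 4, Q)`) gives `M(P)⁴ ≥ 2`; if `10 g > n` then
  `P = R(x^g)` with `deg R = n/g ≤ 9` and the kernel ladder (`twentyfour_le_natDegree_of_subLehmer`,
  the cell's degree-`≤ 23` census) applies to `R`, `M(P) = M(R)`.

In print: [Dobrowolski2006] E. Dobrowolski, Acta Arith. 123 (2006), Prop. 2, gives the sharp `M(f) ≥ θ₀` for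
every monic quadrinomial with `f(0) ≠ 0` that is not a product of cyclotomics (finitely many cases there
"checked by direct computation of `M(f)`"); here the residual finite set is discharged by the cell's kernel
census instead, whence the weaker but kernel-certified conclusion "not sub-Lehmer" (REPLICATION).
-/

section Part3

namespace Literature.NumberTheory.MahlerMeasure

open _root_.Polynomial

section Quadrinomial

variable {p q : ℕ} {b s : ℤ}

/-- **A repeated type A cyclotomic factor forces `p + q = |b| (q - p)`** (any `b`): if `Φ_r ∣ x^{q-p} + s`
and `Φ_r² ∣ P`, then at a primitive `r`-th root of unity `ζ`: `ζ^{q-p} = -s`, `ζⁿ = -s`, and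
`ζ P'(ζ) = 0` reads `b (q - p) ζ^p = -s n`. [cite: Dobrowolski2006, Proposition 2 p.203 (proof)] -/
theorem eq_natAbs_mul_of_cyclotomic_sq_dvd_of_dvd (hp : 0 < p) (hpq : p < q) (hs : s = 1 ∨ s = -1)
    {r : ℕ} (hr : 0 < r) (hW : cyclotomic r ℤ ∣ (X ^ (q - p) + C s : ℤ[X]))
    (hdvd : cyclotomic r ℤ * cyclotomic r ℤ ∣ (X ^ (p + q) + C b * X ^ p + C (s * b) * X ^ q + C s : ℤ[X])) :
    p + q = b.natAbs * (q - p) := by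
  set Φ : ℤ[X] := cyclotomic r ℤ with hΦ
  set P : ℤ[X] := X ^ (p + q) + C b * X ^ p + C (s * b) * X ^ q + C s with hP
  have hss : s * s = 1 := by rcases hs with h | h <;> simp [h]
  have hs2 : (s : ℂ) * s = 1 := by exact_mod_cast hss
  have hdvd1 : Φ ∣ P := dvd_trans (dvd_mul_right Φ Φ) hdvd
  have hV := (dvd_X_pow_add_and_sub_of_dvd hpq hs hdvd1 hW).1
  set ζ : ℂ := Complex.exp (2 * Real.pi * Complex.I / r) with hζdef
  have hprim : IsPrimitiveRoot ζ r := Complex.isPrimitiveRoot_exp r (by omega)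
  have hζ1 : ‖ζ‖ = 1 := hprim.norm'_eq_one hr.ne'
  have hΦζ : aeval ζ Φ = 0 := by
    have h := hprim.isRoot_cyclotomic hr (R := ℂ)
    rw [IsRoot.def, ← map_cyclotomic_int, eval_map] at h
    rwa [aeval_def, algebraMap_int_eq]
  have aeval_of_dvd : ∀ {F : ℤ[X]}, Φ ∣ F → aeval ζ F = 0 := by
    intro F hF; obtain ⟨R, hR⟩ := hF; rw [hR, map_mul, hΦζ, zero_mul]
  have hk : ζ ^ (q - p) = -(s : ℂ) := by
    have h := aeval_of_dvd hW
    simp only [map_add, map_pow, aeval_X, eq_intCast, map_intCast] at h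
    exact eq_neg_of_add_eq_zero_left h
  have hnn : ζ ^ (p + q) = -(s : ℂ) := by
    have h := aeval_of_dvd hV
    simp only [map_add, map_pow, aeval_X, eq_intCast, map_intCast] at h
    exact eq_neg_of_add_eq_zero_left h
  have hq : ζ ^ q = -(s : ℂ) * ζ ^ p := by
    rw [show q = p + (q - p) by omega, pow_add, hk]; ring
  have hder : Φ ∣ derivative P := by
    obtain ⟨R, hR⟩ := hdvd
    rw [hR, mul_assoc, derivative_mul]
    exact dvd_add ((dvd_mul_right Φ R).mul_left _) (dvd_mul_right _ _)
  have hder' : derivative P = C ((p + q : ℕ) : ℤ) * X ^ (p + q - 1) + C (b * (p : ℤ)) * X ^ (p - 1) +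
      C (s * b * (q : ℤ)) * X ^ (q - 1) := by
    rw [hP]
    simp only [derivative_add, derivative_X_pow, derivative_C_mul_X_pow, derivative_C, add_zero]
  have hE := aeval_of_dvd hder
  rw [hder'] at hE
  simp only [map_add, map_mul, map_pow, aeval_X, eq_intCast, map_intCast, map_natCast] at hE
  have hE' : ((p + q : ℕ) : ℂ) * ζ ^ (p + q) + b * p * ζ ^ p + s * b * q * ζ ^ q = 0 := by
    have e1 : ζ ^ (p + q) = ζ * ζ ^ (p + q - 1) := (mul_pow_sub_one (by omega) ζ).symm
    have e2 : ζ ^ p = ζ * ζ ^ (p - 1) := (mul_pow_sub_one (by omega) ζ).symm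
    have e3 : ζ ^ q = ζ * ζ ^ (q - 1) := (mul_pow_sub_one (by omega) ζ).symm
    rw [e1, e2, e3]
    linear_combination ζ * hE
  rw [hnn, hq] at hE'
  have hkey : (b : ℂ) * ((q : ℂ) - p) * ζ ^ p = -((s : ℂ) * ((p + q : ℕ) : ℂ)) := by
    linear_combination (-1 : ℂ) * hE' + (-(b : ℂ) * q * ζ ^ p) * hs2
  have hnorm := congrArg (fun z : ℂ => ‖z‖) hkey
  simp only [norm_mul, norm_neg, norm_pow, hζ1, one_pow, mul_one, Complex.norm_intCast,
    Complex.norm_natCast] at hnorm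
  have hqp : ‖((q : ℂ) - p)‖ = ((q - p : ℕ) : ℝ) := by
    rw [show ((q : ℂ) - p) = ((q - p : ℕ) : ℂ) by rw [Nat.cast_sub hpq.le], Complex.norm_natCast]
  have hs1 : |(s : ℝ)| = 1 := by rcases hs with h | h <;> simp [h]
  have hb' : (b.natAbs : ℝ) = |(b : ℝ)| := by rw [Nat.cast_natAbs, Int.cast_abs]
  rw [hqp, hs1, one_mul, ← hb'] at hnorm
  exact_mod_cast hnorm.symm

/-- **Cyclotomic part vs. cyclotomic-free part, `|b| = 2`** (outside `n = 2k`, i.e. `n ≠ 4p`):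
`P = C_A · C_B · Q` with `Q` cyclotomic-free, `C_A ∣ x^{q-p} + s`, `C_A ∣ x^{2p} - 1` (type A factors,
each simple), `C_B ∣ xⁿ - s`, `C_B ∣ x^{3p} - sε` (type B factors, each simple).
[cite: Dobrowolski2006, Proposition 2 p.203 (proof)] -/
theorem exists_cyclotomicFree_factor_quadrinomial_two (hp : 0 < p) (hpq : p < q) (hs : s = 1 ∨ s = -1)
    {ε : ℤ} (hε : ε = 1 ∨ ε = -1) (hb : b = 2 * ε) (hgen : p + q ≠ 2 * (q - p)) :
    ∃ CA CB Q : ℤ[X], (X ^ (p + q) + C b * X ^ p + C (s * b) * X ^ q + C s : ℤ[X]) = CA * CB * Q ∧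
      CA ∣ (X ^ (q - p) + C s : ℤ[X]) ∧ CA ∣ (X ^ (2 * p) - 1 : ℤ[X]) ∧
      CB ∣ (X ^ (p + q) - C s : ℤ[X]) ∧ CB ∣ (X ^ (3 * p) - C (s * ε) : ℤ[X]) ∧
      (∀ k : ℕ, 0 < k → ¬ cyclotomic k ℤ ∣ Q) := by
  set P : ℤ[X] := X ^ (p + q) + C b * X ^ p + C (s * b) * X ^ q + C s with hP
  have hP0 : P ≠ 0 := (quadrinomial_monic_natDegree hp hpq b s).1.ne_zero
  have hb2 : b = 2 ∨ b = -2 := by rcases hε with h | h <;> simp [hb, h]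
  have hbabs : b.natAbs = 2 := by rcases hb2 with h | h <;> simp [h]
  have key : ∀ d : ℕ, ∀ CA CB Q : ℤ[X], Q.natDegree = d → P = CA * CB * Q →
      CA ∣ (X ^ (q - p) + C s : ℤ[X]) → CA ∣ (X ^ (2 * p) - 1 : ℤ[X]) →
      CB ∣ (X ^ (p + q) - C s : ℤ[X]) → CB ∣ (X ^ (3 * p) - C (s * ε) : ℤ[X]) →
      ∃ CA' CB' Q' : ℤ[X], P = CA' * CB' * Q' ∧
        CA' ∣ (X ^ (q - p) + C s : ℤ[X]) ∧ CA' ∣ (X ^ (2 * p) - 1 : ℤ[X]) ∧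
        CB' ∣ (X ^ (p + q) - C s : ℤ[X]) ∧ CB' ∣ (X ^ (3 * p) - C (s * ε) : ℤ[X]) ∧
        (∀ k : ℕ, 0 < k → ¬ cyclotomic k ℤ ∣ Q') := by
    intro d
    induction d using Nat.strong_induction_on with
    | _ d ih =>
      intro CA CB Q hd hPQ hAW hAV hBn hB3
      by_cases hcf : ∀ k : ℕ, 0 < k → ¬ cyclotomic k ℤ ∣ Q
      · exact ⟨CA, CB, Q, hPQ, hAW, hAV, hBn, hB3, hcf⟩
      push Not at hcf
      obtain ⟨m, hm, hmQ⟩ := hcf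
      obtain ⟨R, hR⟩ := hmQ
      have hQ0 : Q ≠ 0 := by rintro rfl; rw [mul_zero] at hPQ; exact hP0 hPQ
      have hR0 : R ≠ 0 := by rintro rfl; rw [mul_zero] at hR; exact hQ0 hR
      have hΦ0 : cyclotomic m ℤ ≠ 0 := cyclotomic_ne_zero m ℤ
      have hmP : cyclotomic m ℤ ∣ P := ⟨CA * CB * R, by rw [hPQ, hR]; ring⟩
      have hprime : Prime (cyclotomic m ℤ) := (cyclotomic.irreducible hm).prime
      have hdR : R.natDegree < d := by
        rw [← hd, hR, natDegree_mul hΦ0 hR0, natDegree_cyclotomic]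
        have := Nat.totient_pos.mpr hm
        omega
      rcases cyclotomic_dvd_or_of_dvd_quadrinomial_two hp hpq hs hb2 hm hmP with hA | hB
      · -- type A: goes into `CA`
        have hmV := (dvd_X_pow_add_and_sub_of_dvd hpq hs hmP hA).2
        have hnA : ¬ cyclotomic m ℤ ∣ CA := by
          rintro ⟨CA', hCA'⟩
          have h2 : cyclotomic m ℤ * cyclotomic m ℤ ∣ P := ⟨CA' * CB * R, by rw [hPQ, hR, hCA']; ring⟩
          have := eq_natAbs_mul_of_cyclotomic_sq_dvd_of_dvd hp hpq hs hm hA h2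
          rw [hbabs] at this
          exact hgen this
        have hW' : CA * cyclotomic m ℤ ∣ (X ^ (q - p) + C s : ℤ[X]) := by
          obtain ⟨W', hW'⟩ := hAW
          have : cyclotomic m ℤ ∣ W' := by
            rcases hprime.dvd_or_dvd (hW' ▸ hA) with h | h
            · exact absurd h hnA
            · exact h
          rw [hW']; exact mul_dvd_mul_left CA this
        have hV' : CA * cyclotomic m ℤ ∣ (X ^ (2 * p) - 1 : ℤ[X]) := by
          obtain ⟨V', hV'⟩ := hAV
          have : cyclotomic m ℤ ∣ V' := by
            rcases hprime.dvd_or_dvd (hV' ▸ hmV) with h | h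
            · exact absurd h hnA
            · exact h
          rw [hV']; exact mul_dvd_mul_left CA this
        exact ih R.natDegree hdR (CA * cyclotomic m ℤ) CB R rfl (by rw [hPQ, hR]; ring) hW' hV' hBn hB3
      · -- type B: goes into `CB`
        obtain ⟨hY, h3⟩ := cyclotomic_dvd_of_typeB hs hε hb hm hmP hB
        have hnB : ¬ cyclotomic m ℤ ∣ CB := by
          rintro ⟨CB', hCB'⟩
          have h2 : cyclotomic m ℤ * cyclotomic m ℤ ∣ P := ⟨CA * CB' * R, by rw [hPQ, hR, hCB']; ring⟩
          exact not_cyclotomic_sq_dvd_of_typeB hp hpq hs hε hb hm hB hY h2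
        have hn' : CB * cyclotomic m ℤ ∣ (X ^ (p + q) - C s : ℤ[X]) := by
          obtain ⟨W', hW'⟩ := hBn
          have : cyclotomic m ℤ ∣ W' := by
            rcases hprime.dvd_or_dvd (hW' ▸ hB) with h | h
            · exact absurd h hnB
            · exact h
          rw [hW']; exact mul_dvd_mul_left CB this
        have h3' : CB * cyclotomic m ℤ ∣ (X ^ (3 * p) - C (s * ε) : ℤ[X]) := by
          obtain ⟨V', hV'⟩ := hB3
          have : cyclotomic m ℤ ∣ V' := by
            rcases hprime.dvd_or_dvd (hV' ▸ h3) with h | h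
            · exact absurd h hnB
            · exact h
          rw [hV']; exact mul_dvd_mul_left CB this
        exact ih R.natDegree hdR CA (CB * cyclotomic m ℤ) R rfl (by rw [hPQ, hR]; ring) hAW hAV hn' h3'
  exact key P.natDegree 1 1 P rfl (by ring) (one_dvd _) (one_dvd _) (one_dvd _) (one_dvd _)

/-- The quadrinomial is `R(x^g)` for every common divisor `g` of `p` and `q`.
[cite: Dobrowolski2006, Proposition 2 p.203 (proof)] -/
theorem quadrinomial_eq_comp_X_pow {g p' q' : ℕ} (b s : ℤ) :
    (X ^ (p' * g + q' * g) + C b * X ^ (p' * g) + C (s * b) * X ^ (q' * g) + C s : ℤ[X]) =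
      (X ^ (p' + q') + C b * X ^ p' + C (s * b) * X ^ q' + C s : ℤ[X]).comp (X ^ g) := by
  simp only [add_comp, mul_comp, pow_comp, X_comp, C_comp]
  ring

end Quadrinomial

end Literature.NumberTheory.MahlerMeasure

end Part3

/-!
## Part 4 — port of `Summits/Ventures/DiscreteObjects/Mahler/FourTermCyclotomicFactors.lean` (5 declarations kept)

# Sparse reciprocal polynomials III: cyclotomic factors of `x^{p+q} + b x^p + s b x^q + s`, `|b| ≥ 3`,
and the UNCONDITIONAL bound `M² ≥ |b|/2` (venture `DiscreteObjects`, target L)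

Cell `pub-namedobj`, seat `pub-namedobj-mahler-g24`. Framing: lottery ticket; floor = certified
bounds/negative ranges.

For `P = x^{p+q} + b x^p + s b x^q + s` (`0 < p < q`, `s = ±1`, `k = q - p`, `n = p + q`) WITH cyclotomic
factors allowed:

* `cyclotomic_dvd_X_pow_add_of_dvd_quadrinomial` — if `|b| ≥ 3` and `Φ_r ∣ P` then `Φ_r ∣ x^k + s`
  (norm argument: `Res(Φ_r, xⁿ + s) = (-bs)^{φ(r)} Res(Φ_r, x^p(x^k + s))` has modulus `≤ 2^{φ(r)}`, so the
  second resultant vanishes); hence also `Φ_r ∣ xⁿ + s` and `Φ_r ∣ x^{2p} - 1`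
  (`cyclotomic_dvd_X_pow_sub_one_of_dvd_quadrinomial`);
* `eq_natAbs_mul_of_cyclotomic_sq_dvd_quadrinomial` — a REPEATED cyclotomic factor forces `n = |b|·k`
  (differentiate: at a common root `ζ`, `b k ζ^p = -s n`);
* `exists_cyclotomicFree_factor_quadrinomial` — outside that thin family, `P = C · Q` with `Q`
  cyclotomic-free, `C ∣ x^k + s`, `C ∣ x^{2p} - 1` (so `deg C ≤ min(k, 2p) ≤ n/2`, `M(C) = 1`);
* `abs_le_two_mul_measure_sq_quadrinomial` — **`|b| ≤ 2 M(P)²`**, unconditionally, for `|b| ≥ 3` and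
  `n ≠ |b| k`: the resultant step of `FourTermMeasureBound` applied to `Q` (`|b|^{deg Q} ≤ 2^{deg Q} Mⁿ`
  with `2 deg Q ≥ n`).  In particular `M(P) ≥ √(3/2) > 1.2247 > M(ℓ)`: such a quadrinomial is never
  cyclotomic and never sub-Lehmer (`not_subLehmer_quadrinomial_of_three_le_abs`).

In print: [Dobrowolski2006] E. Dobrowolski, Acta Arith. 123 (2006) 201–231, Prop. 2 — "a monic quadrinomial
`f ∈ ℤ[x]`, `f(0) ≠ 0`, that is not a product of cyclotomic factors has `M(f) ≥ θ₀`" — whose proof (§5 there)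
uses the same congruence `a ∣ α^{n+m} + η`, the same determination of the roots of unity among the zeros for
`a ≥ 3`, and the multiplicity bound `3`; this file is a kernel formalisation of that case (REPLICATION, the
statement here with the weaker conclusion `M² ≥ |b|/2`).  The cases `|b| = 2` and `n = |b| k` follow in
`FourTermAbsTwoFactors` / `FourTermAbsTwo` / `FourTermSpecialFamily`.
-/

section Part4

namespace Literature.NumberTheory.MahlerMeasure

open _root_.Polynomial

section Quadrinomial

variable {p q : ℕ} {b s : ℤ}

/-- The quadrinomial rewritten around its "binomial core": with `W = x^{q-p} + s`,
`x^{p+q} + b x^p + s b x^q + s = (x^{p+q} + s) + (b s) · x^p · W` (uses `s² = 1`).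
[cite: Dobrowolski2006, Proposition 2 p.203 (proof: cyclotomic factors of quadrinomials)] -/
theorem quadrinomial_eq_core (hpq : p < q) (hs : s = 1 ∨ s = -1) (b : ℤ) :
    (X ^ (p + q) + C b * X ^ p + C (s * b) * X ^ q + C s : ℤ[X]) =
      (X ^ (p + q) + C s) + C (b * s) * (X ^ p * (X ^ (q - p) + C s)) := by
  have hss : s * s = 1 := by rcases hs with h | h <;> simp [h]
  have hCs : (C s : ℤ[X]) * C s = 1 := by rw [← map_mul, hss, map_one]
  obtain ⟨k, rfl⟩ : ∃ k, q = p + k := ⟨q - p, by omega⟩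
  rw [Nat.add_sub_cancel_left, map_mul, map_mul]
  linear_combination (-(C b * X ^ p)) * hCs

/-- **Cyclotomic factors of the quadrinomial, `|b| ≥ 3`.**  If `Φ_r ∣ P = x^{p+q} + b x^p + s b x^q + s`
with `|b| ≥ 3` (`0 < p < q`, `s = ±1`), then `Φ_r ∣ x^{q-p} + s`.  Proof: `P = Φ_r H`, so
`xⁿ + s = (-bs) x^p W + Φ_r H` and `Res(Φ_r, xⁿ + s) = (-bs)^{φ(r)} Res(Φ_r, x^p W)`; the left side is
`∏_ζ (ζⁿ + s)` over the primitive `r`-th roots of unity, of modulus `≤ 2^{φ(r)} < 3^{φ(r)}`, so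
`Res(Φ_r, x^p W) = 0`: some `ζ` is a root of `W`, and `Φ_r = minpoly(ζ) ∣ W`.
[cite: Dobrowolski2006, Proposition 2 p.203 (proof: cyclotomic factors of quadrinomials)] -/
theorem cyclotomic_dvd_X_pow_add_of_dvd_quadrinomial (hp : 0 < p) (hpq : p < q) (hs : s = 1 ∨ s = -1)
    (hb : 3 ≤ |b|) {r : ℕ} (hr : 0 < r)
    (hdvd : cyclotomic r ℤ ∣ (X ^ (p + q) + C b * X ^ p + C (s * b) * X ^ q + C s : ℤ[X])) :
    cyclotomic r ℤ ∣ (X ^ (q - p) + C s : ℤ[X]) := by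
  set Φ : ℤ[X] := cyclotomic r ℤ with hΦ
  set n := p + q with hn
  have hΦm : Φ.Monic := cyclotomic.monic r ℤ
  have hΦ0 : Φ ≠ 0 := hΦm.ne_zero
  have hd : Φ.natDegree = r.totient := natDegree_cyclotomic r ℤ
  have hdpos : 0 < Φ.natDegree := by rw [hd]; exact Nat.totient_pos.mpr hr
  obtain ⟨H, hH⟩ := hdvd
  have hH0 : H ≠ 0 := by
    intro h0
    have := (quadrinomial_monic_natDegree hp hpq b s).1.ne_zero
    rw [hH, h0, mul_zero] at this
    exact this rfl
  have hHdeg : H.natDegree + Φ.natDegree = n := by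
    have h := (quadrinomial_monic_natDegree hp hpq b s).2
    rw [hH, natDegree_mul hΦ0 hH0] at h
    omega
  -- `xⁿ + s = C (-(b s)) * (X^p * W) + Φ * H`, `W = X^{q-p} + s`
  have hG : (X ^ n + C s : ℤ[X]) = C (-(b * s)) * (X ^ p * (X ^ (q - p) + C s)) + Φ * H := by
    rw [← hH, quadrinomial_eq_core hpq hs b, map_neg]; ring
  have hGdeg : (X ^ n + C s : ℤ[X]).natDegree ≤ n := by rw [natDegree_X_pow_add_C]
  have hTdeg : (X ^ p * (X ^ (q - p) + C s) : ℤ[X]).natDegree ≤ n := by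
    refine natDegree_mul_le.trans ?_
    rw [natDegree_X_pow, natDegree_X_pow_add_C]; omega
  -- the resultant identity
  have hres : Φ.resultant (X ^ n + C s) Φ.natDegree n =
      (-(b * s)) ^ Φ.natDegree * Φ.resultant (X ^ p * (X ^ (q - p) + C s)) Φ.natDegree n := by
    rw [hG, resultant_add_mul_right Φ (C (-(b * s)) * (X ^ p * (X ^ (q - p) + C s))) H Φ.natDegree n
      (by omega) le_rfl, resultant_C_mul_right]
  -- upper bound `|Res(Φ, xⁿ + s)| ≤ 2^{φ(r)}` over `ℂ`
  have hinj : Function.Injective (Int.castRingHom ℂ) := (Int.castRingHom ℂ).injective_int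
  have hcard : Multiset.card (Φ.map (Int.castRingHom ℂ)).roots = Φ.natDegree := by
    have hsp := (IsAlgClosed.splits (Φ.map (Int.castRingHom ℂ))).natDegree_eq_card_roots
    rw [natDegree_map_eq_of_injective hinj] at hsp
    exact hsp.symm
  have hlc : (Φ.map (Int.castRingHom ℂ)).leadingCoeff = 1 := by
    rw [leadingCoeff_map_of_injective hinj, hΦm.leadingCoeff, map_one]
  have hrootΦ : ∀ ζ ∈ (Φ.map (Int.castRingHom ℂ)).roots, IsPrimitiveRoot ζ r := by
    intro ζ hζ
    have h := (mem_roots'.mp hζ).2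
    rw [hΦ, map_cyclotomic] at h
    haveI : NeZero (r : ℂ) := ⟨by exact_mod_cast hr.ne'⟩
    exact isRoot_cyclotomic_iff.mp h
  have hup : ‖((Φ.resultant (X ^ n + C s) Φ.natDegree n : ℤ) : ℂ)‖ ≤ 2 ^ Φ.natDegree := by
    rw [resultant_intCast_eq hGdeg, hlc, one_pow, one_mul]
    have hmp := map_multiset_prod (normHom : ℂ →*₀ ℝ)
      (((Φ.map (Int.castRingHom ℂ)).roots.map ((X ^ n + C s : ℤ[X]).map (Int.castRingHom ℂ)).eval))
    rw [Multiset.map_map] at hmp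
    simp only [normHom_apply, Function.comp_def] at hmp
    rw [hmp]
    calc ((Φ.map (Int.castRingHom ℂ)).roots.map
          (fun ζ => ‖((X ^ n + C s : ℤ[X]).map (Int.castRingHom ℂ)).eval ζ‖)).prod
        ≤ ((Φ.map (Int.castRingHom ℂ)).roots.map (fun _ => (2 : ℝ))).prod := by
          refine Multiset.prod_map_le_prod_map₀ _ _ (fun ζ _ => norm_nonneg _) (fun ζ hζ => ?_)
          simp only [Polynomial.map_add, Polynomial.map_pow, map_X, eq_intCast, Polynomial.map_intCast,
            eval_add, eval_pow, eval_X, eval_intCast]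
          have h1 : ‖ζ‖ = 1 := (hrootΦ ζ hζ).norm'_eq_one hr.ne'
          calc ‖ζ ^ n + (s : ℂ)‖ ≤ ‖ζ ^ n‖ + ‖(s : ℂ)‖ := norm_add_le _ _
            _ ≤ 1 + 1 := add_le_add (by rw [norm_pow, h1, one_pow]) (norm_intCast_le_one_of_sign hs)
            _ = 2 := by norm_num
      _ = 2 ^ Φ.natDegree := by rw [Multiset.map_const', Multiset.prod_replicate, hcard]
  -- hence `Res(Φ, x^p W) = 0`
  have hzero : Φ.resultant (X ^ p * (X ^ (q - p) + C s)) Φ.natDegree n = 0 := by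
    by_contra hne
    have h1 : (1 : ℤ) ≤ |Φ.resultant (X ^ p * (X ^ (q - p) + C s)) Φ.natDegree n| := Int.one_le_abs hne
    have h3 : (3 : ℤ) ^ Φ.natDegree ≤ |Φ.resultant (X ^ n + C s) Φ.natDegree n| := by
      rw [hres, abs_mul, abs_pow, abs_neg, abs_mul]
      have hbs : (3 : ℤ) ≤ |b| * |s| := by rcases hs with h | h <;> simp [h, hb]
      calc (3 : ℤ) ^ Φ.natDegree = 3 ^ Φ.natDegree * 1 := by ring
        _ ≤ (|b| * |s|) ^ Φ.natDegree * |Φ.resultant (X ^ p * (X ^ (q - p) + C s)) Φ.natDegree n| :=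
            mul_le_mul (pow_le_pow_left₀ (by norm_num) hbs _) h1 (by norm_num) (by positivity)
    have h3R : (3 : ℝ) ^ Φ.natDegree ≤ ‖((Φ.resultant (X ^ n + C s) Φ.natDegree n : ℤ) : ℂ)‖ := by
      rw [Complex.norm_intCast]; exact_mod_cast h3
    have h23 : (2 : ℝ) ^ Φ.natDegree < 3 ^ Φ.natDegree := pow_lt_pow_left₀ (by norm_num) (by norm_num) hdpos.ne'
    linarith
  -- a common root: some primitive `r`-th root of unity `ζ` with `ζ^p W(ζ) = 0`
  have hC := resultant_intCast_eq (f := Φ) hTdeg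
  rw [hzero, Int.cast_zero, hlc, one_pow, one_mul] at hC
  obtain ⟨w, hw, hw0⟩ := Multiset.prod_eq_zero_iff.mp hC.symm |> Multiset.mem_map.mp
  have hζ := hrootΦ w hw
  have hw1 : ‖w‖ = 1 := hζ.norm'_eq_one hr.ne'
  have hwne : w ≠ 0 := fun h => by rw [h, norm_zero] at hw1; exact zero_ne_one hw1
  have hWw : aeval w (X ^ (q - p) + C s : ℤ[X]) = 0 := by
    simp only [Polynomial.map_mul, Polynomial.map_pow, map_X, eval_mul, eval_pow, eval_X] at hw0
    rcases mul_eq_zero.mp hw0 with h | h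
    · exact absurd (pow_eq_zero_iff (by omega) |>.mp h) hwne
    · rwa [eval_map, ← algebraMap_int_eq, ← aeval_def] at h
  rw [hΦ, cyclotomic_eq_minpoly hζ hr]
  exact minpoly.isIntegrallyClosed_dvd (hζ.isIntegral hr) hWw

/-- With `|b| ≥ 3`, a cyclotomic factor `Φ_r` of the quadrinomial also divides `x^{p+q} + s` and
`x^{2p} - 1` (from `Φ_r ∣ x^{q-p} + s` and `xⁿ + s - x^{2p}(x^{q-p} + s) = s(1 - x^{2p})`).
[cite: Dobrowolski2006, Proposition 2 p.203 (proof: cyclotomic factors of quadrinomials)] -/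
theorem cyclotomic_dvd_X_pow_sub_one_of_dvd_quadrinomial (hp : 0 < p) (hpq : p < q) (hs : s = 1 ∨ s = -1)
    (hb : 3 ≤ |b|) {r : ℕ} (hr : 0 < r)
    (hdvd : cyclotomic r ℤ ∣ (X ^ (p + q) + C b * X ^ p + C (s * b) * X ^ q + C s : ℤ[X])) :
    cyclotomic r ℤ ∣ (X ^ (p + q) + C s : ℤ[X]) ∧ cyclotomic r ℤ ∣ (X ^ (2 * p) - 1 : ℤ[X]) := by
  have hW := cyclotomic_dvd_X_pow_add_of_dvd_quadrinomial hp hpq hs hb hr hdvd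
  have hss : s * s = 1 := by rcases hs with h | h <;> simp [h]
  have hCs : (C s : ℤ[X]) * C s = 1 := by rw [← map_mul, hss, map_one]
  have h1 : cyclotomic r ℤ ∣ (X ^ (p + q) + C s : ℤ[X]) := by
    have e : (X ^ (p + q) + C s : ℤ[X]) =
        (X ^ (p + q) + C b * X ^ p + C (s * b) * X ^ q + C s) - C (b * s) * X ^ p * (X ^ (q - p) + C s) := by
      rw [quadrinomial_eq_core hpq hs b]; ring
    rw [e]
    exact dvd_sub hdvd (dvd_mul_of_dvd_right hW _)
  refine ⟨h1, ?_⟩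
  have e2 : (X ^ (2 * p) - 1 : ℤ[X]) = C s * (X ^ (2 * p) * (X ^ (q - p) + C s) - (X ^ (p + q) + C s)) := by
    obtain ⟨k, rfl⟩ : ∃ k, q = p + k := ⟨q - p, by omega⟩
    rw [Nat.add_sub_cancel_left]
    linear_combination (1 - X ^ (2 * p) : ℤ[X]) * hCs
  rw [e2]
  exact dvd_mul_of_dvd_right (dvd_sub (dvd_mul_of_dvd_right hW _) h1) _

/-- **Repeated cyclotomic factors only in the family `n = |b| k`.**  If `Φ_r² ∣ P` (`|b| ≥ 3`) then
`p + q = |b| (q - p)`: at a primitive `r`-th root of unity `ζ` one has `ζ^{q-p} = -s`, `ζⁿ = -s`,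
`P'(ζ) = 0`, and `ζ P'(ζ) = n ζⁿ + b p ζ^p + s b q ζ^q = -s n - b (q - p) ζ^p`, so `|b| (q-p) = n`.
[cite: Dobrowolski2006, Proposition 2 p.203 (proof: cyclotomic factors of quadrinomials)] -/
theorem eq_natAbs_mul_of_cyclotomic_sq_dvd_quadrinomial (hp : 0 < p) (hpq : p < q) (hs : s = 1 ∨ s = -1)
    (hb : 3 ≤ |b|) {r : ℕ} (hr : 0 < r)
    (hdvd : cyclotomic r ℤ * cyclotomic r ℤ ∣ (X ^ (p + q) + C b * X ^ p + C (s * b) * X ^ q + C s : ℤ[X])) :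
    p + q = b.natAbs * (q - p) := by
  set Φ : ℤ[X] := cyclotomic r ℤ with hΦ
  set P : ℤ[X] := X ^ (p + q) + C b * X ^ p + C (s * b) * X ^ q + C s with hP
  have hss : s * s = 1 := by rcases hs with h | h <;> simp [h]
  have hs2 : (s : ℂ) * s = 1 := by exact_mod_cast hss
  have hdvd1 : Φ ∣ P := dvd_trans (dvd_mul_right Φ Φ) hdvd
  have hW := cyclotomic_dvd_X_pow_add_of_dvd_quadrinomial hp hpq hs hb hr hdvd1
  have hV := (cyclotomic_dvd_X_pow_sub_one_of_dvd_quadrinomial hp hpq hs hb hr hdvd1).1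
  -- a primitive r-th root of unity and the three vanishing statements
  set ζ : ℂ := Complex.exp (2 * Real.pi * Complex.I / r) with hζdef
  have hprim : IsPrimitiveRoot ζ r := Complex.isPrimitiveRoot_exp r (by omega)
  have hζ1 : ‖ζ‖ = 1 := hprim.norm'_eq_one hr.ne'
  have hΦζ : aeval ζ Φ = 0 := by
    have h := hprim.isRoot_cyclotomic hr (R := ℂ)
    rw [IsRoot.def, ← map_cyclotomic_int, eval_map] at h
    rwa [aeval_def, algebraMap_int_eq]
  have aeval_of_dvd : ∀ {F : ℤ[X]}, Φ ∣ F → aeval ζ F = 0 := by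
    intro F hF; obtain ⟨R, hR⟩ := hF; rw [hR, map_mul, hΦζ, zero_mul]
  have hk : ζ ^ (q - p) = -(s : ℂ) := by
    have h := aeval_of_dvd hW
    simp only [map_add, map_pow, aeval_X, eq_intCast, map_intCast] at h
    exact eq_neg_of_add_eq_zero_left h
  have hnn : ζ ^ (p + q) = -(s : ℂ) := by
    have h := aeval_of_dvd hV
    simp only [map_add, map_pow, aeval_X, eq_intCast, map_intCast] at h
    exact eq_neg_of_add_eq_zero_left h
  have hq : ζ ^ q = -(s : ℂ) * ζ ^ p := by
    rw [show q = p + (q - p) by omega, pow_add, hk]; ring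
  -- `Φ ∣ P'`
  have hder : Φ ∣ derivative P := by
    obtain ⟨R, hR⟩ := hdvd
    rw [hR, mul_assoc, derivative_mul]
    exact dvd_add ((dvd_mul_right Φ R).mul_left _) (dvd_mul_right _ _)
  have hder' : derivative P = C ((p + q : ℕ) : ℤ) * X ^ (p + q - 1) + C (b * (p : ℤ)) * X ^ (p - 1) +
      C (s * b * (q : ℤ)) * X ^ (q - 1) := by
    rw [hP]
    simp only [derivative_add, derivative_X_pow, derivative_C_mul_X_pow, derivative_C, add_zero]
  have hE := aeval_of_dvd hder
  rw [hder'] at hE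
  simp only [map_add, map_mul, map_pow, aeval_X, eq_intCast, map_intCast, map_natCast] at hE
  -- multiply by ζ
  have hE' : ((p + q : ℕ) : ℂ) * ζ ^ (p + q) + b * p * ζ ^ p + s * b * q * ζ ^ q = 0 := by
    have e1 : ζ ^ (p + q) = ζ * ζ ^ (p + q - 1) := (mul_pow_sub_one (by omega) ζ).symm
    have e2 : ζ ^ p = ζ * ζ ^ (p - 1) := (mul_pow_sub_one (by omega) ζ).symm
    have e3 : ζ ^ q = ζ * ζ ^ (q - 1) := (mul_pow_sub_one (by omega) ζ).symm
    rw [e1, e2, e3]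
    linear_combination ζ * hE
  rw [hnn, hq] at hE'
  have hkey : (b : ℂ) * ((q : ℂ) - p) * ζ ^ p = -((s : ℂ) * ((p + q : ℕ) : ℂ)) := by
    linear_combination (-1 : ℂ) * hE' + (-(b : ℂ) * q * ζ ^ p) * hs2
  -- take norms: `|b| (q - p) = p + q`
  have hnorm := congrArg (fun z : ℂ => ‖z‖) hkey
  simp only [norm_mul, norm_neg, norm_pow, hζ1, one_pow, mul_one, Complex.norm_intCast,
    Complex.norm_natCast] at hnorm
  have hqp : ‖((q : ℂ) - p)‖ = ((q - p : ℕ) : ℝ) := by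
    rw [show ((q : ℂ) - p) = ((q - p : ℕ) : ℂ) by rw [Nat.cast_sub hpq.le], Complex.norm_natCast]
  have hs1 : |(s : ℝ)| = 1 := by rcases hs with h | h <;> simp [h]
  have hb' : (b.natAbs : ℝ) = |(b : ℝ)| := by
    rw [Nat.cast_natAbs, Int.cast_abs]
  rw [hqp, hs1, one_mul, ← hb'] at hnorm
  exact_mod_cast hnorm.symm

/-- **Cyclotomic part vs. cyclotomic-free part** (`|b| ≥ 3`, outside the family `n = |b| k`): the
quadrinomial factors as `P = C · Q` with `Q` cyclotomic-free and `C ∣ x^{q-p} + s`, `C ∣ x^{2p} - 1`.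
(Peel cyclotomic factors one at a time; each new `Φ_r` divides `x^{q-p} + s` and `x^{2p} - 1`, is prime,
and does not divide the part already peeled — else `Φ_r² ∣ P`.)
[cite: Dobrowolski2006, Proposition 2 p.203 (proof: cyclotomic factors of quadrinomials)] -/
theorem exists_cyclotomicFree_factor_quadrinomial (hp : 0 < p) (hpq : p < q) (hs : s = 1 ∨ s = -1)
    (hb : 3 ≤ |b|) (hgen : p + q ≠ b.natAbs * (q - p)) :
    ∃ Cy Q : ℤ[X], (X ^ (p + q) + C b * X ^ p + C (s * b) * X ^ q + C s : ℤ[X]) = Cy * Q ∧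
      Cy ∣ (X ^ (q - p) + C s : ℤ[X]) ∧ Cy ∣ (X ^ (2 * p) - 1 : ℤ[X]) ∧
      (∀ k : ℕ, 0 < k → ¬ cyclotomic k ℤ ∣ Q) := by
  set P : ℤ[X] := X ^ (p + q) + C b * X ^ p + C (s * b) * X ^ q + C s with hP
  have hP0 : P ≠ 0 := (quadrinomial_monic_natDegree hp hpq b s).1.ne_zero
  -- peeling, by strong induction on the degree of the remaining factor
  have key : ∀ d : ℕ, ∀ Cy Q : ℤ[X], Q.natDegree = d → P = Cy * Q →
      Cy ∣ (X ^ (q - p) + C s : ℤ[X]) → Cy ∣ (X ^ (2 * p) - 1 : ℤ[X]) →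
      ∃ Cy' Q' : ℤ[X], P = Cy' * Q' ∧ Cy' ∣ (X ^ (q - p) + C s : ℤ[X]) ∧ Cy' ∣ (X ^ (2 * p) - 1 : ℤ[X]) ∧
        (∀ k : ℕ, 0 < k → ¬ cyclotomic k ℤ ∣ Q') := by
    intro d
    induction d using Nat.strong_induction_on with
    | _ d ih =>
      intro Cy Q hd hPQ hCyW hCyV
      by_cases hcf : ∀ k : ℕ, 0 < k → ¬ cyclotomic k ℤ ∣ Q
      · exact ⟨Cy, Q, hPQ, hCyW, hCyV, hcf⟩
      push Not at hcf
      obtain ⟨m, hm, hmQ⟩ := hcf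
      obtain ⟨R, hR⟩ := hmQ
      have hQ0 : Q ≠ 0 := by rintro rfl; rw [mul_zero] at hPQ; exact hP0 hPQ
      have hR0 : R ≠ 0 := by rintro rfl; rw [mul_zero] at hR; exact hQ0 hR
      have hΦ0 : cyclotomic m ℤ ≠ 0 := cyclotomic_ne_zero m ℤ
      have hmP : cyclotomic m ℤ ∣ P := ⟨Cy * R, by rw [hPQ, hR]; ring⟩
      have hmW := cyclotomic_dvd_X_pow_add_of_dvd_quadrinomial hp hpq hs hb hm hmP
      have hmV := (cyclotomic_dvd_X_pow_sub_one_of_dvd_quadrinomial hp hpq hs hb hm hmP).2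
      -- `Φ_m ∤ Cy` (else `Φ_m² ∣ P`)
      have hprime : Prime (cyclotomic m ℤ) := (cyclotomic.irreducible hm).prime
      have hnCy : ¬ cyclotomic m ℤ ∣ Cy := by
        intro h
        obtain ⟨Cy', hCy'⟩ := h
        have h2 : cyclotomic m ℤ * cyclotomic m ℤ ∣ P := ⟨Cy' * R, by rw [hPQ, hR, hCy']; ring⟩
        exact hgen (eq_natAbs_mul_of_cyclotomic_sq_dvd_quadrinomial hp hpq hs hb hm h2)
      -- new cyclotomic part `Cy * Φ_m` still divides `W` and `V`
      have hdvdW : Cy * cyclotomic m ℤ ∣ (X ^ (q - p) + C s : ℤ[X]) := by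
        obtain ⟨W', hW'⟩ := hCyW
        have : cyclotomic m ℤ ∣ W' := by
          rcases hprime.dvd_or_dvd (hW' ▸ hmW) with h | h
          · exact absurd h hnCy
          · exact h
        rw [hW']; exact mul_dvd_mul_left Cy this
      have hdvdV : Cy * cyclotomic m ℤ ∣ (X ^ (2 * p) - 1 : ℤ[X]) := by
        obtain ⟨V', hV'⟩ := hCyV
        have : cyclotomic m ℤ ∣ V' := by
          rcases hprime.dvd_or_dvd (hV' ▸ hmV) with h | h
          · exact absurd h hnCy
          · exact h
        rw [hV']; exact mul_dvd_mul_left Cy this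
      have hdR : R.natDegree < d := by
        rw [← hd, hR, natDegree_mul hΦ0 hR0, natDegree_cyclotomic]
        have := Nat.totient_pos.mpr hm
        omega
      exact ih R.natDegree hdR (Cy * cyclotomic m ℤ) R rfl (by rw [hPQ, hR]; ring) hdvdW hdvdV
  exact key P.natDegree 1 P rfl (one_mul P).symm (one_dvd _) (one_dvd _)

end Quadrinomial

end Literature.NumberTheory.MahlerMeasure

end Part4

/-!
## Part 5 — port of `Summits/Ventures/DiscreteObjects/Mahler/FourTermSpecialFamily.lean` (6 declarations kept)

# Sparse reciprocal polynomials VI: the family `p + q = |b| (q - p)` and ALL quadrinomials with `|b| ≥ 3`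
(venture `DiscreteObjects`, target L)

Cell `pub-namedobj`, seat `pub-namedobj-mahler-g24`. Framing: lottery ticket; floor = certified
bounds/negative ranges.

`P = x^{p+q} + b x^p + s b x^q + s`, `|b| ≥ 3`, `0 < p < q`, `s = ±1`, `k = q - p`, `n = p + q`.  In the
family `n = |b| k` cyclotomic factors may be repeated (`(x^k + 1)³` for `b = 3`, `s = 1`); we bound
their multiplicity by a fewnomial argument:

* `not_cyclotomic_pow_four_dvd_quadrinomial` — no `Φ_r⁴` divides a quadrinomial: with
  `L_c F = x F' - c F`, `L_p L_q L_n P = -s n p q` is a nonzero constant, while `Φ^{m+1} ∣ F` gives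
  `Φ^m ∣ L_c F`;
* `exists_round_quadrinomial` / `exists_cyclotomicFree_factor_quadrinomial_three` — three peeling
  rounds: `P = D · Q`, `Q` cyclotomic-free, `D ∣ (x^k + s)³` (so `deg D ≤ 3k`, `M(D) = 1`);
* `not_subLehmer_quadrinomial_special` — for `n = |b| k`: `|b| = 3` gives `P = R(x^k)` with `deg R = 3`
  (kernel ladder); `|b| ≥ 4` gives `(|b|/2)^{(|b|-3)k} ≤ M^{|b| k}`, hence `M⁴ ≥ 2`;
* `not_subLehmer_quadrinomial_of_three_le_abs'` — together with `FourTermCyclotomicFactors`: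
  **no quadrinomial `x^{p+q} + b x^p + s b x^q + s` with `|b| ≥ 3` is sub-Lehmer.**

In print: [Dobrowolski2006] E. Dobrowolski, Acta Arith. 123 (2006), Prop. 2 (`M(f) ≥ θ₀`, sharp), whose proof
bounds the multiplicity of the roots of unity by `3` exactly as here; kernel formalisation (REPLICATION), with
the weaker kernel-certified conclusion "not sub-Lehmer" for the residual family.
-/

section Part5

namespace Literature.NumberTheory.MahlerMeasure

open _root_.Polynomial

section Quadrinomial

variable {p q : ℕ} {b s : ℤ}

/-- `x · F'` for a four-term shape `F = a xⁿ + c x^p + d x^q + e` (`n, p, q ≥ 1`).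
[cite: Dobrowolski2006, Proposition 2 p.203 (proof: the special family)] -/
theorem X_mul_derivative_four {n : ℕ} (hn : 0 < n) (hp : 0 < p) (hq : 0 < q) (a c d e : ℤ) :
    X * derivative (C a * X ^ n + C c * X ^ p + C d * X ^ q + C e : ℤ[X]) =
      C (a * n) * X ^ n + C (c * p) * X ^ p + C (d * q) * X ^ q := by
  simp only [derivative_add, derivative_C_mul_X_pow, derivative_C, add_zero]
  have e1 : ∀ {m : ℕ}, 0 < m → (X : ℤ[X]) * X ^ (m - 1) = X ^ m := fun hm => mul_pow_sub_one (by omega) X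
  rw [mul_add, mul_add, ← mul_assoc, mul_comm X (C _), mul_assoc, e1 hn, ← mul_assoc, mul_comm X (C _),
    mul_assoc, e1 hp, ← mul_assoc, mul_comm X (C _), mul_assoc, e1 hq]

/-- If `Φ^{m+1} ∣ F` then `Φ^m ∣ x F' - c F`.
[cite: Dobrowolski2006, Proposition 2 p.203 (proof: the special family)] -/
theorem pow_dvd_X_mul_derivative_sub {Φ F : ℤ[X]} {m : ℕ} (h : Φ ^ (m + 1) ∣ F) (c : ℤ) :
    Φ ^ m ∣ X * derivative F - C c * F := by
  refine dvd_sub (dvd_mul_of_dvd_right ?_ _) (dvd_mul_of_dvd_right (dvd_trans (pow_dvd_pow Φ (by omega)) h) _)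
  have := pow_sub_one_dvd_derivative_of_pow_dvd h
  simpa using this

/-- **No fourth power of a cyclotomic polynomial divides a quadrinomial** `x^{p+q} + b x^p + s b x^q + s`
(`0 < p < q`, `s ≠ 0`): with `L_c F = x F' - c F` one has `L_p (L_q (L_n P)) = -s n p q ≠ 0`, while
`Φ⁴ ∣ P` would give `Φ ∣ L_p (L_q (L_n P))`.
[cite: Dobrowolski2006, Proposition 2 p.203 (proof: the special family)] -/
theorem not_cyclotomic_pow_four_dvd_quadrinomial (hp : 0 < p) (hpq : p < q) (hs : s = 1 ∨ s = -1)
    (b : ℤ) {r : ℕ} (hr : 0 < r) :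
    ¬ cyclotomic r ℤ ^ 4 ∣ (X ^ (p + q) + C b * X ^ p + C (s * b) * X ^ q + C s : ℤ[X]) := by
  intro h4
  set Φ : ℤ[X] := cyclotomic r ℤ with hΦ
  set n := p + q with hn
  have hs0 : s ≠ 0 := by rcases hs with h | h <;> simp [h]
  -- the three operators
  have hP : (X ^ n + C b * X ^ p + C (s * b) * X ^ q + C s : ℤ[X]) =
      C 1 * X ^ n + C b * X ^ p + C (s * b) * X ^ q + C s := by rw [map_one, one_mul]
  set F1 : ℤ[X] := C 0 * X ^ n + C (b * (p - n : ℤ)) * X ^ p + C (s * b * (q - n : ℤ)) * X ^ q + C (-(s * n))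
    with hF1
  set F2 : ℤ[X] := C 0 * X ^ n + C (b * (p - n : ℤ) * (p - q : ℤ)) * X ^ p + C 0 * X ^ q + C (s * n * q)
    with hF2
  have h1 : X * derivative (X ^ n + C b * X ^ p + C (s * b) * X ^ q + C s : ℤ[X]) -
      C (n : ℤ) * (X ^ n + C b * X ^ p + C (s * b) * X ^ q + C s) = F1 := by
    rw [hP, X_mul_derivative_four (by omega) hp (by omega), hF1]
    simp only [map_mul, map_sub, map_neg, map_zero, map_one, map_natCast]
    ring
  have h2 : X * derivative F1 - C (q : ℤ) * F1 = F2 := by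
    rw [hF1, X_mul_derivative_four (by omega) hp (by omega), hF2]
    simp only [map_mul, map_sub, map_neg, map_zero, map_natCast]
    ring
  have h3 : X * derivative F2 - C (p : ℤ) * F2 = C (-(s * n * p * q)) := by
    rw [hF2, X_mul_derivative_four (by omega) hp (by omega)]
    simp only [map_mul, map_sub, map_neg, map_zero, map_natCast]
    ring
  have d3 : Φ ^ 3 ∣ F1 := by rw [← h1]; exact pow_dvd_X_mul_derivative_sub h4 _
  have d2 : Φ ^ 2 ∣ F2 := by rw [← h2]; exact pow_dvd_X_mul_derivative_sub d3 _
  have d1 : Φ ^ 1 ∣ C (-(s * n * p * q)) := by rw [← h3]; exact pow_dvd_X_mul_derivative_sub d2 _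
  rw [pow_one] at d1
  have hc : (-(s * (n : ℤ) * (p : ℤ) * (q : ℤ)) : ℤ) ≠ 0 := by
    have hn0 : n ≠ 0 := by omega
    have hp0 : p ≠ 0 := hp.ne'
    have hq0 : q ≠ 0 := by omega
    simp only [ne_eq, neg_eq_zero, mul_eq_zero, Nat.cast_eq_zero, hs0, hn0, hp0, hq0, or_self,
      not_false_eq_true]
  have hd := natDegree_le_of_dvd d1 (C_ne_zero.mpr hc)
  rw [natDegree_C, hΦ, natDegree_cyclotomic] at hd
  have := Nat.totient_pos.mpr hr
  omega

/-- A divisor of a nonzero integer polynomial of Mahler measure `1` has Mahler measure `1`.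
[cite: Dobrowolski2006, Proposition 2 p.203 (proof: the special family)] -/
theorem intMahlerMeasure_eq_one_of_dvd {D F : ℤ[X]} (hDF : D ∣ F) (hF : F ≠ 0) (hM : intMahlerMeasure F = 1) :
    intMahlerMeasure D = 1 := by
  obtain ⟨E, hE⟩ := hDF
  have hD : D ≠ 0 := by rintro rfl; rw [zero_mul] at hE; exact hF hE
  have hE0 : E ≠ 0 := by rintro rfl; rw [mul_zero] at hE; exact hF hE
  have hm := intMahlerMeasure_mul D E
  rw [← hE, hM] at hm
  have h1 := one_le_intMahlerMeasure hD
  have h2 := one_le_intMahlerMeasure hE0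
  nlinarith

/-- **One peeling round** (`|b| ≥ 3`): every divisor `Q₀` of the quadrinomial factors as `Q₀ = D · Q'`
with `D ∣ x^{q-p} + s` and every cyclotomic factor of `Q'` dividing `D`.
[cite: Dobrowolski2006, Proposition 2 p.203 (proof: the special family)] -/
theorem exists_round_quadrinomial (hp : 0 < p) (hpq : p < q) (hs : s = 1 ∨ s = -1) (hb : 3 ≤ |b|)
    {Q₀ : ℤ[X]} (hQ₀ : Q₀ ∣ (X ^ (p + q) + C b * X ^ p + C (s * b) * X ^ q + C s : ℤ[X])) :
    ∃ D Q' : ℤ[X], Q₀ = D * Q' ∧ D ∣ (X ^ (q - p) + C s : ℤ[X]) ∧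
      ∀ m : ℕ, 0 < m → cyclotomic m ℤ ∣ Q' → cyclotomic m ℤ ∣ D := by
  have hP0 : (X ^ (p + q) + C b * X ^ p + C (s * b) * X ^ q + C s : ℤ[X]) ≠ 0 :=
    (quadrinomial_monic_natDegree hp hpq b s).1.ne_zero
  have hQ00 : Q₀ ≠ 0 := by rintro rfl; exact hP0 (zero_dvd_iff.mp hQ₀)
  have key : ∀ d : ℕ, ∀ D Q' : ℤ[X], Q'.natDegree = d → Q₀ = D * Q' → D ∣ (X ^ (q - p) + C s : ℤ[X]) →
      ∃ D' Q'' : ℤ[X], Q₀ = D' * Q'' ∧ D' ∣ (X ^ (q - p) + C s : ℤ[X]) ∧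
        ∀ m : ℕ, 0 < m → cyclotomic m ℤ ∣ Q'' → cyclotomic m ℤ ∣ D' := by
    intro d
    induction d using Nat.strong_induction_on with
    | _ d ih =>
      intro D Q' hd hDQ hDW
      by_cases hall : ∀ m : ℕ, 0 < m → cyclotomic m ℤ ∣ Q' → cyclotomic m ℤ ∣ D
      · exact ⟨D, Q', hDQ, hDW, hall⟩
      push Not at hall
      obtain ⟨m, hm, hmQ, hmD⟩ := hall
      obtain ⟨R, hR⟩ := hmQ
      have hQ'0 : Q' ≠ 0 := by rintro rfl; rw [mul_zero] at hDQ; exact hQ00 hDQ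
      have hR0 : R ≠ 0 := by rintro rfl; rw [mul_zero] at hR; exact hQ'0 hR
      have hΦ0 : cyclotomic m ℤ ≠ 0 := cyclotomic_ne_zero m ℤ
      have hmQ₀ : cyclotomic m ℤ ∣ Q₀ := ⟨D * R, by rw [hDQ, hR]; ring⟩
      have hmP := dvd_trans hmQ₀ hQ₀
      have hmW := cyclotomic_dvd_X_pow_add_of_dvd_quadrinomial hp hpq hs hb hm hmP
      have hprime : Prime (cyclotomic m ℤ) := (cyclotomic.irreducible hm).prime
      have hDW' : D * cyclotomic m ℤ ∣ (X ^ (q - p) + C s : ℤ[X]) := by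
        obtain ⟨W', hW'⟩ := hDW
        have : cyclotomic m ℤ ∣ W' := by
          rcases hprime.dvd_or_dvd (hW' ▸ hmW) with h | h
          · exact absurd h hmD
          · exact h
        rw [hW']; exact mul_dvd_mul_left D this
      have hdR : R.natDegree < d := by
        rw [← hd, hR, natDegree_mul hΦ0 hR0, natDegree_cyclotomic]
        have := Nat.totient_pos.mpr hm
        omega
      exact ih R.natDegree hdR (D * cyclotomic m ℤ) R rfl (by rw [hDQ, hR]; ring) hDW'
  exact key Q₀.natDegree 1 Q₀ rfl (one_mul Q₀).symm (one_dvd _)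

/-- **Three rounds suffice** (`|b| ≥ 3`): `P = D · Q` with `Q` cyclotomic-free and `D ∣ (x^{q-p} + s)³`
(a cyclotomic factor surviving three rounds would divide `P` four times).
[cite: Dobrowolski2006, Proposition 2 p.203 (proof: the special family)] -/
theorem exists_cyclotomicFree_factor_quadrinomial_three (hp : 0 < p) (hpq : p < q) (hs : s = 1 ∨ s = -1)
    (hb : 3 ≤ |b|) :
    ∃ D Q : ℤ[X], (X ^ (p + q) + C b * X ^ p + C (s * b) * X ^ q + C s : ℤ[X]) = D * Q ∧
      D ∣ (X ^ (q - p) + C s : ℤ[X]) ^ 3 ∧ (∀ m : ℕ, 0 < m → ¬ cyclotomic m ℤ ∣ Q) := by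
  obtain ⟨D₁, Q₁, h1, hD1, hr1⟩ := exists_round_quadrinomial hp hpq hs hb (dvd_refl _)
  obtain ⟨D₂, Q₂, h2, hD2, hr2⟩ := exists_round_quadrinomial hp hpq hs hb (Q₀ := Q₁) ⟨D₁, by rw [h1]; ring⟩
  obtain ⟨D₃, Q₃, h3, hD3, hr3⟩ := exists_round_quadrinomial hp hpq hs hb (Q₀ := Q₂)
    ⟨D₁ * D₂, by rw [h1, h2]; ring⟩
  refine ⟨D₁ * D₂ * D₃, Q₃, by rw [h1, h2, h3]; ring, ?_, ?_⟩
  · rw [pow_succ, pow_two]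
    exact mul_dvd_mul (mul_dvd_mul hD1 hD2) hD3
  · intro m hm hmQ3
    have hΦ3 : cyclotomic m ℤ ∣ D₃ := hr3 m hm hmQ3
    have hQ2 : cyclotomic m ℤ * cyclotomic m ℤ ∣ Q₂ := by rw [h3]; exact mul_dvd_mul hΦ3 hmQ3
    have hΦ2 : cyclotomic m ℤ ∣ D₂ := hr2 m hm (dvd_trans (dvd_mul_right _ _) hQ2)
    have hQ1 : cyclotomic m ℤ * (cyclotomic m ℤ * cyclotomic m ℤ) ∣ Q₁ := by
      rw [h2]; exact mul_dvd_mul hΦ2 hQ2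
    have hΦ1 : cyclotomic m ℤ ∣ D₁ := hr1 m hm (dvd_trans (dvd_mul_right _ _) hQ1)
    have h4 : cyclotomic m ℤ ^ 4 ∣ (X ^ (p + q) + C b * X ^ p + C (s * b) * X ^ q + C s : ℤ[X]) := by
      rw [h1, show cyclotomic m ℤ ^ 4 = cyclotomic m ℤ * (cyclotomic m ℤ * (cyclotomic m ℤ * cyclotomic m ℤ))
        by ring]
      exact mul_dvd_mul hΦ1 hQ1
    exact not_cyclotomic_pow_four_dvd_quadrinomial hp hpq hs b hm h4

end Quadrinomial

end Literature.NumberTheory.MahlerMeasure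

end Part5

/-!
## Part 6 — port of `Summits/Ventures/DiscreteObjects/Mahler/FourTermCoprimeSharp.lean` (10 declarations kept)

# Quadrinomials with coprime exponents: `M ≥ θ₀` beyond the residual set (venture `DiscreteObjects`, target L)

Cell `pub-namedobj`, seat `pub-namedobj-mahler-g24`. Framing: lottery ticket; floor = certified
bounds/negative ranges.  Part of the kernel REPLICATION of [Dobrowolski2006] E. Dobrowolski, Acta Arith. 123
(2006) 201–231, Proposition 2 (`M ≥ θ₀` for noncyclotomic quadrinomials); not new mathematics.

For `R = x^{p+q} + b x^p + s b x^q + s` with `gcd(p, q) = 1` the cyclotomic parts of the factorisations of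
`FourTermAbsTwo` / `FourTermCyclotomicFactors` / `FourTermSpecialFamily` are tiny (`gcd(q-p, 2p) ≤ 2`,
`gcd(p+q, 3p) ≤ 3`, `deg D ≤ 3(q-p)`), so the resultant bounds give `θ₀` as soon as the degree is moderately large:
`b = ±2` with `p + q ≥ 27` (even route `4^{deg Q} ≤ 2^{deg Q} M^{2(p+q)}`, `deg Q ≥ p+q-5`); `|b| ≥ 3` (odd route
`|b|^{deg Q} ≤ 2^{deg Q} M^{p+q}`, `deg Q ≥ p+q-2` generically, `5 deg Q ≥ 2(p+q)` on the family `p+q = |b|(q-p)`).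

* `gcd_le_two_of_coprime`, `gcd_le_three_of_coprime`; numeric thresholds `pow_13248_le_two` (`n ≥ 27`),
  `pow_13248_le_three_halves` (`n ≥ 7`), `pow_13248_le_two'` (`n ≥ 4`); `smythTheta_le_of_pow_le`;
* `smythTheta_le_measure_quadrinomial_two` (`b = ±2`, `p + q ≥ 27`);
* `odd_route_bound`; `smythTheta_le_measure_quadrinomial_special` (`|b| ≥ 5`, `p+q = |b|(q-p)`),
  `smythTheta_le_measure_quadrinomial_generic` (`|b| ≥ 3` otherwise, `p+q ≥ 6`, `(|b|, p+q) ≠ (3, 6)`).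
-/

section Part6

namespace Literature.NumberTheory.MahlerMeasure

open _root_.Polynomial

section Quadrinomial

variable {p q : ℕ} {b s : ℤ}

/-- `gcd(q - p, 2p) ≤ 2` when `gcd(p, q) = 1` (`p < q`).
[cite: Dobrowolski2006, Proposition 2 p.203 (proof: coprime exponents)] -/
theorem gcd_le_two_of_coprime (hpq : p < q) (hcop : Nat.Coprime p q) :
    Nat.gcd (q - p) (2 * p) ≤ 2 := by
  have h1 : Nat.Coprime (q - p) p := by
    rw [Nat.Coprime, Nat.gcd_sub_self_left hpq.le, Nat.gcd_comm]; exact hcop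
  have h2 : Nat.Coprime (Nat.gcd (q - p) (2 * p)) p := h1.coprime_dvd_left (Nat.gcd_dvd_left _ _)
  have h3 : Nat.gcd (q - p) (2 * p) ∣ 2 := h2.dvd_of_dvd_mul_right (Nat.gcd_dvd_right _ _)
  exact Nat.le_of_dvd (by norm_num) h3

/-- `gcd(p + q, 3p) ≤ 3` when `gcd(p, q) = 1`.
[cite: Dobrowolski2006, Proposition 2 p.203 (proof: coprime exponents)] -/
theorem gcd_le_three_of_coprime (hcop : Nat.Coprime p q) : Nat.gcd (p + q) (3 * p) ≤ 3 := by
  have h1 : Nat.Coprime (p + q) p := by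
    rw [Nat.Coprime, Nat.add_comm]; simpa [Nat.Coprime, Nat.gcd_comm] using hcop
  have h2 : Nat.Coprime (Nat.gcd (p + q) (3 * p)) p := h1.coprime_dvd_left (Nat.gcd_dvd_left _ _)
  have h3 : Nat.gcd (p + q) (3 * p) ∣ 3 := h2.dvd_of_dvd_mul_right (Nat.gcd_dvd_right _ _)
  exact Nat.le_of_dvd (by norm_num) h3

/-- `1.3248^{2n} ≤ 2^{n-5}` for `n ≥ 27`. [cite: Dobrowolski2006, Proposition 2 p.203 (proof: coprime exponents)] -/
theorem pow_13248_le_two (n : ℕ) (hn : 27 ≤ n) : (13248 / 10000 : ℝ) ^ (2 * n) ≤ 2 ^ (n - 5) := by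
  induction n, hn using Nat.le_induction with
  | base => norm_num
  | succ n hn ih =>
    rw [show 2 * (n + 1) = 2 * n + 2 by ring, show n + 1 - 5 = (n - 5) + 1 by omega, pow_add, pow_succ]
    have h2 : (13248 / 10000 : ℝ) ^ 2 ≤ 2 := by norm_num
    have h0 : (0 : ℝ) ≤ (13248 / 10000 : ℝ) ^ 2 := by positivity
    have h1 : (0 : ℝ) ≤ (2 : ℝ) ^ (n - 5) := by positivity
    exact mul_le_mul ih h2 h0 h1

/-- `1.3248ⁿ ≤ (3/2)^{n-2}` for `n ≥ 7`. [cite: Dobrowolski2006, Proposition 2 p.203 (proof: coprime exponents)] -/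
theorem pow_13248_le_three_halves (n : ℕ) (hn : 7 ≤ n) : (13248 / 10000 : ℝ) ^ n ≤ (3 / 2) ^ (n - 2) := by
  induction n, hn using Nat.le_induction with
  | base => norm_num
  | succ n hn ih =>
    rw [show n + 1 - 2 = (n - 2) + 1 by omega, pow_succ, pow_succ]
    have h2 : (13248 / 10000 : ℝ) ≤ 3 / 2 := by norm_num
    exact mul_le_mul ih h2 (by norm_num) (by positivity)

/-- `1.3248ⁿ ≤ 2^{n-2}` for `n ≥ 4`. [cite: Dobrowolski2006, Proposition 2 p.203 (proof: coprime exponents)] -/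
theorem pow_13248_le_two' (n : ℕ) (hn : 4 ≤ n) : (13248 / 10000 : ℝ) ^ n ≤ 2 ^ (n - 2) := by
  induction n, hn using Nat.le_induction with
  | base => norm_num
  | succ n hn ih =>
    rw [show n + 1 - 2 = (n - 2) + 1 by omega, pow_succ, pow_succ]
    have h2 : (13248 / 10000 : ℝ) ≤ 2 := by norm_num
    exact mul_le_mul ih h2 (by norm_num) (by positivity)

/-- `θ₀ ≤ M` from `1.3248 < M` or from a power comparison: if `M < θ₀` then `M^a < 1.3248^a`.
[cite: Dobrowolski2006, Proposition 2 p.203 (proof: coprime exponents)] -/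
theorem smythTheta_le_of_pow_le {M c : ℝ} {a : ℕ} (ha : a ≠ 0) (hM : 0 ≤ M)
    (h : c ≤ M ^ a) (hc : (13248 / 10000 : ℝ) ^ a ≤ c) : smythTheta ≤ M := by
  by_contra hlt
  push Not at hlt
  have h1 : M < 13248 / 10000 := lt_trans hlt smythTheta_lt
  have h2 : M ^ a < (13248 / 10000 : ℝ) ^ a := pow_lt_pow_left₀ h1 hM ha
  linarith

/-- **`|b| = 2`, long case** ([Dobrowolski2006, §5, the doubling step]): for `gcd(p, q) = 1`, `b = ±2` and
`p + q ≥ 27` the quadrinomial has `M ≥ θ₀` — `R = C_A C_B Q` (`FourTermAbsTwo`), `deg C_A ≤ gcd(q-p, 2p) ≤ 2`,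
`deg C_B ≤ gcd(p+q, 3p) ≤ 3`, and the even resultant step `4^{deg Q} ≤ 2^{deg Q} M^{2(p+q)}` on `Q`.
[cite: Dobrowolski2006, Proposition 2 p.203 (proof: coprime exponents)] -/
theorem smythTheta_le_measure_quadrinomial_two (hp : 0 < p) (hpq : p < q) (hcop : Nat.Coprime p q)
    (hs : s = 1 ∨ s = -1) (hbb : b = 2 ∨ b = -2) (hn27 : 27 ≤ p + q) :
    smythTheta ≤ intMahlerMeasure (X ^ (p + q) + C b * X ^ p + C (s * b) * X ^ q + C s : ℤ[X]) := by
  obtain ⟨hmon, hdeg⟩ := quadrinomial_monic_natDegree hp hpq b s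
  set P : ℤ[X] := X ^ (p + q) + C b * X ^ p + C (s * b) * X ^ q + C s with hP
  set n := p + q with hn
  have hP0 : P ≠ 0 := hmon.ne_zero
  have hM0 : 0 ≤ intMahlerMeasure P := by unfold intMahlerMeasure; exact Polynomial.mahlerMeasure_nonneg _
  have hθ : smythTheta < 13248 / 10000 := smythTheta_lt
  have hss : s * s = 1 := by rcases hs with h | h <;> simp [h]
  obtain ⟨ε, hε, hbε⟩ : ∃ ε : ℤ, (ε = 1 ∨ ε = -1) ∧ b = 2 * ε := by
    rcases hbb with h | h
    · exact ⟨1, Or.inl rfl, by rw [h]; ring⟩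
    · exact ⟨-1, Or.inr rfl, by rw [h]; ring⟩
  have hgen : p + q ≠ 2 * (q - p) := by
    intro h
    have h3 : q = 3 * p := by omega
    have : Nat.gcd p q = p := by rw [h3]; exact Nat.gcd_eq_left ⟨3, by ring⟩
    rw [Nat.Coprime] at hcop; omega
  obtain ⟨CA, CB, Q, hPQ, hAW, hAV, hBn, hB3, hcfQ⟩ :=
    exists_cyclotomicFree_factor_quadrinomial_two hp hpq hs hε hbε hgen
  change P = CA * CB * Q at hPQ
  have hCA0 : CA ≠ 0 := by rintro rfl; rw [zero_mul, zero_mul] at hPQ; exact hP0 hPQ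
  have hCB0 : CB ≠ 0 := by rintro rfl; rw [mul_zero, zero_mul] at hPQ; exact hP0 hPQ
  have hQ0 : Q ≠ 0 := by rintro rfl; rw [mul_zero] at hPQ; exact hP0 hPQ
  -- degrees via Euclid on exponents and `gcd = 1`
  have hsign : ∀ {t : ℤ}, (t = 1 ∨ t = -1) → ∀ {N : ℕ}, 0 < N → (X ^ N - C t : ℤ[X]) ≠ 0 :=
    fun _ _ hN => X_pow_sub_C_ne_zero hN _
  obtain ⟨wA, hwA, hCAd⟩ := dvd_X_pow_gcd_sub_C (F := CA) _ (q - p) (2 * p) (-s) 1 le_rfl (by omega)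
    (by omega) (by rcases hs with h | h <;> simp [h]) (Or.inl rfl)
    (by rw [map_neg, sub_neg_eq_add]; exact hAW) (by rw [map_one]; exact hAV)
  obtain ⟨wB, hwB, hCBd⟩ := dvd_X_pow_gcd_sub_C (F := CB) _ (p + q) (3 * p) s (s * ε) le_rfl (by omega)
    (by omega) hs (by rcases hs with h | h <;> rcases hε with h' | h' <;> simp [h, h']) hBn hB3
  have hdA : CA.natDegree ≤ 2 := by
    have := natDegree_le_of_dvd hCAd (hsign hwA (Nat.gcd_pos_of_pos_right _ (by omega)))
    rw [natDegree_X_pow_sub_C] at this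
    exact this.trans (gcd_le_two_of_coprime hpq hcop)
  have hdB : CB.natDegree ≤ 3 := by
    have := natDegree_le_of_dvd hCBd (hsign hwB (Nat.gcd_pos_of_pos_right _ (by omega)))
    rw [natDegree_X_pow_sub_C] at this
    exact this.trans (gcd_le_three_of_coprime hcop)
  have hdegs : CA.natDegree + CB.natDegree + Q.natDegree = n := by
    rw [← hdeg, hPQ, natDegree_mul (mul_ne_zero hCA0 hCB0) hQ0, natDegree_mul hCA0 hCB0]
  have hQn : n - 5 ≤ Q.natDegree := by omega
  -- measures of the cyclotomic parts and the even resultant step on `Q`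
  have hMA : intMahlerMeasure CA = 1 := by
    obtain ⟨V', hV'⟩ := hAV
    exact intMahlerMeasure_eq_one_of_mul_eq_X_pow_sub_one (by omega : 0 < 2 * p) hV'.symm
  have hMB : intMahlerMeasure CB = 1 := by
    obtain ⟨V', hV'⟩ := hB3
    have hsε2 : (s * ε) * (s * ε) = 1 := by rcases hs with h | h <;> rcases hε with h' | h' <;> simp [h, h']
    have e : CB * (V' * (X ^ (3 * p) + C (s * ε))) = X ^ (6 * p) - 1 := by
      rw [← mul_assoc, ← hV']
      have hC : (C (s * ε) : ℤ[X]) * C (s * ε) = 1 := by rw [← map_mul, hsε2, map_one]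
      linear_combination (-1 : ℤ[X]) * hC
    exact intMahlerMeasure_eq_one_of_mul_eq_X_pow_sub_one (by omega : 0 < 6 * p) e
  have hMQ : intMahlerMeasure Q = intMahlerMeasure P := by
    rw [hPQ, intMahlerMeasure_mul, intMahlerMeasure_mul, hMA, hMB, one_mul, one_mul]
  set T : ℤ[X] := X ^ p + C s * X ^ q with hT
  have hCs : (C s : ℤ[X]) * C s = 1 := by rw [← map_mul, hss, map_one]
  have hG : (X ^ (2 * n) - 1 : ℤ[X]) =
      C (4 * ε) * (T * (C ε * T + C s)) + Q * (CA * CB * (P - C (4 * ε) * T - C (2 * s))) := by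
    have e : Q * (CA * CB * (P - C (4 * ε) * T - C (2 * s))) = P * (P - C (4 * ε) * T - C (2 * s)) := by
      rw [hPQ]; ring
    rw [e, hP, hT, hbε]
    simp only [map_mul, map_ofNat]
    linear_combination hCs
  have hGdeg : (X ^ (2 * n) - 1 : ℤ[X]).natDegree ≤ 2 * n := by rw [← C_1, natDegree_X_pow_sub_C]
  have hne : Q.resultant (X ^ (2 * n) - 1) Q.natDegree (2 * n) ≠ 0 :=
    resultant_X_pow_sub_one_ne_zero hQ0 hcfQ (by omega)
  have hTdeg : T.natDegree ≤ q := by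
    rw [hT]
    refine (natDegree_add_le _ _).trans (max_le ?_ ?_)
    · rw [natDegree_X_pow]; omega
    · exact (natDegree_C_mul_le _ _).trans (by rw [natDegree_X_pow])
  have hHdeg : (CA * CB * (P - C (4 * ε) * T - C (2 * s))).natDegree + Q.natDegree ≤ 2 * n := by
    have h1 : (P - C (4 * ε) * T - C (2 * s)).natDegree ≤ n := by
      refine (natDegree_sub_le _ _).trans (max_le ((natDegree_sub_le _ _).trans (max_le ?_ ?_)) ?_)
      · rw [hdeg]
      · exact (natDegree_C_mul_le _ _).trans (hTdeg.trans (by omega))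
      · rw [natDegree_C]; omega
    have h2 : (CA * CB * (P - C (4 * ε) * T - C (2 * s))).natDegree ≤
        (CA * CB).natDegree + (P - C (4 * ε) * T - C (2 * s)).natDegree := natDegree_mul_le
    rw [natDegree_mul hCA0 hCB0] at h2
    omega
  have hroot : ∀ α : ℂ, ‖((X ^ (2 * n) - 1 : ℤ[X]).map (Int.castRingHom ℂ)).eval α‖ ≤
      2 * max 1 ‖α‖ ^ (2 * n) := by
    intro α
    simp only [Polynomial.map_sub, Polynomial.map_pow, map_X, Polynomial.map_one, eval_sub, eval_pow,
      eval_X, eval_one]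
    have := norm_pow_add_le_two_mul α (-1) (by simp) (2 * n)
    rwa [← sub_eq_add_neg] at this
  have h := abs_pow_le_pow_mul_measure_pow_of_resultant (K := 2) hG hHdeg hGdeg hne hroot
  rw [hMQ] at h
  set M := intMahlerMeasure P with hMdef
  have h4 : (|((4 : ℤ) * ε : ℤ)| : ℝ) = 2 * 2 := by rcases hε with h' | h' <;> simp [h'] <;> norm_num
  rw [h4, mul_pow] at h
  have h2 : (2 : ℝ) ^ Q.natDegree ≤ M ^ (2 * n) := by
    have hpos : (0 : ℝ) < 2 ^ Q.natDegree := by positivity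
    nlinarith
  have h3 : (2 : ℝ) ^ (n - 5) ≤ M ^ (2 * n) := le_trans (pow_le_pow_right₀ (by norm_num) hQn) h2
  exact smythTheta_le_of_pow_le (by omega) hM0 h3 (pow_13248_le_two n hn27)

/-- **Odd resultant route on a factorisation.**  If the quadrinomial `R = x^{p+q} + b x^p + s b x^q + s` factors as
`R = C · Q` with `M(C) = 1` and `Q` cyclotomic-free, then `|b|^{deg Q} ≤ 2^{deg Q} · M(R)^{p+q}`
(`x^{p+q} + s = b·(-T) + Q·C`, `|αⁿ + s| ≤ 2 max(1,|α|)ⁿ`).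
[cite: Dobrowolski2006, Proposition 2 p.203 (proof: coprime exponents)] -/
theorem odd_route_bound (hp : 0 < p) (hpq : p < q) (hs : s = 1 ∨ s = -1) {Cy Q : ℤ[X]}
    (hPQ : (X ^ (p + q) + C b * X ^ p + C (s * b) * X ^ q + C s : ℤ[X]) = Cy * Q)
    (hMCy : intMahlerMeasure Cy = 1) (hcfQ : ∀ k : ℕ, 0 < k → ¬ cyclotomic k ℤ ∣ Q) :
    (|b| : ℝ) ^ Q.natDegree ≤ 2 ^ Q.natDegree *
      intMahlerMeasure (X ^ (p + q) + C b * X ^ p + C (s * b) * X ^ q + C s : ℤ[X]) ^ (p + q) := by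
  obtain ⟨hmon, hdeg⟩ := quadrinomial_monic_natDegree hp hpq b s
  set P : ℤ[X] := X ^ (p + q) + C b * X ^ p + C (s * b) * X ^ q + C s with hP
  set n := p + q with hn
  have hP0 : P ≠ 0 := hmon.ne_zero
  have hCy0 : Cy ≠ 0 := by rintro rfl; rw [zero_mul] at hPQ; exact hP0 hPQ
  have hQ0 : Q ≠ 0 := by rintro rfl; rw [mul_zero] at hPQ; exact hP0 hPQ
  have hdegs : Cy.natDegree + Q.natDegree = n := by rw [← hdeg, hPQ, natDegree_mul hCy0 hQ0]
  have hMQ : intMahlerMeasure Q = intMahlerMeasure P := by rw [hPQ, intMahlerMeasure_mul, hMCy, one_mul]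
  have hG : (X ^ n + C s : ℤ[X]) = C b * (-(X ^ p + C s * X ^ q)) + Q * Cy := by
    rw [mul_comm Q Cy, ← hPQ, hP, map_mul]; ring
  have hGdeg : (X ^ n + C s : ℤ[X]).natDegree ≤ n := by rw [natDegree_X_pow_add_C]
  have hne : Q.resultant (X ^ n + C s) Q.natDegree n ≠ 0 := by
    refine resultant_ne_zero_of_cyclotomicFree (L := 2 * n) hQ0 hcfQ hGdeg (by omega) ?_
    intro z hz
    simp only [Polynomial.map_add, Polynomial.map_pow, map_X, eq_intCast, Polynomial.map_intCast,
      eval_add, eval_pow, eval_X, eval_intCast] at hz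
    have hz' : z ^ n = -(s : ℂ) := eq_neg_of_add_eq_zero_left hz
    rw [pow_mul', hz', neg_sq]
    rcases hs with h | h <;> simp [h]
  have hroot : ∀ α : ℂ, ‖((X ^ n + C s : ℤ[X]).map (Int.castRingHom ℂ)).eval α‖ ≤ 2 * max 1 ‖α‖ ^ n := by
    intro α
    simp only [Polynomial.map_add, Polynomial.map_pow, map_X, eq_intCast, Polynomial.map_intCast,
      eval_add, eval_pow, eval_X, eval_intCast]
    exact norm_pow_add_le_two_mul α (s : ℂ) (norm_intCast_le_one_of_sign hs) n
  have h := abs_pow_le_pow_mul_measure_pow_of_resultant (K := 2) hG (by omega) hGdeg hne hroot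
  rw [hMQ] at h
  exact_mod_cast h

/-- **The special family with `|b| ≥ 5`** (`p + q = |b|(q - p)`): `R = D·Q` with `D ∣ (x^{q-p} + s)³`
(`FourTermSpecialFamily`), so `5 deg Q ≥ 2(p+q)` and the odd route gives `(5/2)^2 ≤ M⁵`.
[cite: Dobrowolski2006, Proposition 2 p.203 (proof: coprime exponents)] -/
theorem smythTheta_le_measure_quadrinomial_special (hp : 0 < p) (hpq : p < q) (hs : s = 1 ∨ s = -1)
    (hb5 : 5 ≤ |b|) (hfam : p + q = b.natAbs * (q - p)) :
    smythTheta ≤ intMahlerMeasure (X ^ (p + q) + C b * X ^ p + C (s * b) * X ^ q + C s : ℤ[X]) := by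
  obtain ⟨hmon, hdeg⟩ := quadrinomial_monic_natDegree hp hpq b s
  set P : ℤ[X] := X ^ (p + q) + C b * X ^ p + C (s * b) * X ^ q + C s with hP
  set n := p + q with hn
  have hP0 : P ≠ 0 := hmon.ne_zero
  have hM0 : 0 ≤ intMahlerMeasure P := by unfold intMahlerMeasure; exact Polynomial.mahlerMeasure_nonneg _
  have hθ : smythTheta < 13248 / 10000 := smythTheta_lt
  have hss : s * s = 1 := by rcases hs with h | h <;> simp [h]
  have hb3 : 3 ≤ |b| := by omega
  have hB : (b.natAbs : ℤ) = |b| := Int.natCast_natAbs b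
  obtain ⟨D, Q, hPQ, hDW, hcfQ⟩ := exists_cyclotomicFree_factor_quadrinomial_three hp hpq hs hb3
  change P = D * Q at hPQ
  have hD0 : D ≠ 0 := by rintro rfl; rw [zero_mul] at hPQ; exact hP0 hPQ
  have hQ0 : Q ≠ 0 := by rintro rfl; rw [mul_zero] at hPQ; exact hP0 hPQ
  have hW0 : ((X ^ (q - p) + C s : ℤ[X]) ^ 3) ≠ 0 := pow_ne_zero 3 (monic_X_pow_add_C s (by omega)).ne_zero
  have hdD : D.natDegree ≤ 3 * (q - p) := by
    have := natDegree_le_of_dvd hDW hW0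
    rw [natDegree_pow, natDegree_X_pow_add_C] at this
    omega
  have hdegs : D.natDegree + Q.natDegree = n := by rw [← hdeg, hPQ, natDegree_mul hD0 hQ0]
  have hMD : intMahlerMeasure D = 1 := by
    have hCs : (C s : ℤ[X]) * C s = 1 := by rw [← map_mul, hss, map_one]
    have hW1 : intMahlerMeasure (X ^ (q - p) + C s : ℤ[X]) = 1 := by
      refine intMahlerMeasure_eq_one_of_mul_eq_X_pow_sub_one (s := X ^ (q - p) - C s)
        (by omega : 0 < 2 * (q - p)) ?_
      rw [pow_mul, sq]
      linear_combination (-1 : ℤ[X]) * hCs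
    refine intMahlerMeasure_eq_one_of_dvd hDW hW0 ?_
    rw [show ((X ^ (q - p) + C s : ℤ[X]) ^ 3) = (X ^ (q - p) + C s) * ((X ^ (q - p) + C s) * (X ^ (q - p) + C s))
      by ring, intMahlerMeasure_mul, intMahlerMeasure_mul, hW1]
    norm_num
  have hodd := odd_route_bound hp hpq hs hPQ hMD hcfQ
  -- `5 deg Q ≥ 2 n` since `deg Q ≥ n - 3k = (|b| - 3) k` and `|b| ≥ 5`
  have hQ2 : 2 * n ≤ 5 * Q.natDegree := by
    have hk : n = b.natAbs * (q - p) := hfam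
    have hb5' : 5 ≤ b.natAbs := by omega
    have : Q.natDegree + 3 * (q - p) ≥ b.natAbs * (q - p) := by omega
    nlinarith
  set M := intMahlerMeasure P with hMdef
  have hb52 : (5 / 2 : ℝ) ≤ |(b : ℝ)| / 2 := by
    have : (5 : ℝ) ≤ |(b : ℝ)| := by exact_mod_cast hb5
    linarith
  have h1 : (|(b : ℝ)| / 2) ^ Q.natDegree ≤ M ^ n := by
    rw [div_pow, div_le_iff₀ (by positivity)]
    calc |(b : ℝ)| ^ Q.natDegree ≤ 2 ^ Q.natDegree * M ^ n := by exact_mod_cast hodd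
      _ = M ^ n * 2 ^ Q.natDegree := by ring
  have h2 : (5 / 2 : ℝ) ^ (2 * n) ≤ (M ^ 5) ^ n := by
    calc (5 / 2 : ℝ) ^ (2 * n) ≤ (5 / 2) ^ (5 * Q.natDegree) := pow_le_pow_right₀ (by norm_num) hQ2
      _ ≤ (|(b : ℝ)| / 2) ^ (5 * Q.natDegree) := pow_le_pow_left₀ (by norm_num) hb52 _
      _ = ((|(b : ℝ)| / 2) ^ Q.natDegree) ^ 5 := by rw [mul_comm, pow_mul]
      _ ≤ (M ^ n) ^ 5 := pow_le_pow_left₀ (by positivity) h1 5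
      _ = (M ^ 5) ^ n := by rw [← pow_mul, ← pow_mul, mul_comm]
  have h3 : (25 / 4 : ℝ) ≤ M ^ 5 := by
    have e : (5 / 2 : ℝ) ^ (2 * n) = (25 / 4) ^ n := by rw [pow_mul]; norm_num
    rw [e] at h2
    exact le_of_pow_le_pow_left₀ (by omega : n ≠ 0) (by positivity) h2
  exact smythTheta_le_of_pow_le (by norm_num) hM0 h3 (by norm_num)

/-- **The generic case `|b| ≥ 3`** (`p + q ≠ |b|(q - p)`, `gcd(p, q) = 1`): `R = C·Q` with
`C ∣ x^{gcd(q-p, 2p)} - w`, `deg C ≤ 2` (`FourTermCyclotomicFactors`), and the odd route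
`(|b|/2)^{p+q-2} ≤ M^{p+q}`; needs `p + q ≥ 6`, and `p + q ≠ 6` when `|b| = 3` (that case is `(1,5)`, a
certificate). [cite: Dobrowolski2006, Proposition 2 p.203 (proof: coprime exponents)] -/
theorem smythTheta_le_measure_quadrinomial_generic (hp : 0 < p) (hpq : p < q) (hcop : Nat.Coprime p q)
    (hs : s = 1 ∨ s = -1) (hb3 : 3 ≤ |b|) (hfam : ¬ p + q = b.natAbs * (q - p)) (hn6 : 6 ≤ p + q)
    (h36 : |b| = 3 → p + q ≠ 6) :
    smythTheta ≤ intMahlerMeasure (X ^ (p + q) + C b * X ^ p + C (s * b) * X ^ q + C s : ℤ[X]) := by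
  obtain ⟨hmon, hdeg⟩ := quadrinomial_monic_natDegree hp hpq b s
  set P : ℤ[X] := X ^ (p + q) + C b * X ^ p + C (s * b) * X ^ q + C s with hP
  set n := p + q with hn
  have hP0 : P ≠ 0 := hmon.ne_zero
  have hM0 : 0 ≤ intMahlerMeasure P := by unfold intMahlerMeasure; exact Polynomial.mahlerMeasure_nonneg _
  have hθ : smythTheta < 13248 / 10000 := smythTheta_lt
  have hss : s * s = 1 := by rcases hs with h | h <;> simp [h]
  obtain ⟨Cy, Q, hPQ, hCW, hCV, hcfQ⟩ := exists_cyclotomicFree_factor_quadrinomial hp hpq hs hb3 hfam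
  change P = Cy * Q at hPQ
  have hCy0 : Cy ≠ 0 := by rintro rfl; rw [zero_mul] at hPQ; exact hP0 hPQ
  have hQ0 : Q ≠ 0 := by rintro rfl; rw [mul_zero] at hPQ; exact hP0 hPQ
  obtain ⟨w, hw, hCd⟩ := dvd_X_pow_gcd_sub_C (F := Cy) _ (q - p) (2 * p) (-s) 1 le_rfl (by omega)
    (by omega) (by rcases hs with h | h <;> simp [h]) (Or.inl rfl)
    (by rw [map_neg, sub_neg_eq_add]; exact hCW) (by rw [map_one]; exact hCV)
  have hdC : Cy.natDegree ≤ 2 := by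
    have hne : (X ^ Nat.gcd (q - p) (2 * p) - C w : ℤ[X]) ≠ 0 :=
      X_pow_sub_C_ne_zero (Nat.gcd_pos_of_pos_right _ (by omega)) _
    have := natDegree_le_of_dvd hCd hne
    rw [natDegree_X_pow_sub_C] at this
    exact this.trans (gcd_le_two_of_coprime hpq hcop)
  have hdegs : Cy.natDegree + Q.natDegree = n := by rw [← hdeg, hPQ, natDegree_mul hCy0 hQ0]
  have hQn : n - 2 ≤ Q.natDegree := by omega
  have hMCy : intMahlerMeasure Cy = 1 := by
    obtain ⟨V', hV'⟩ := hCV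
    exact intMahlerMeasure_eq_one_of_mul_eq_X_pow_sub_one (by omega : 0 < 2 * p) hV'.symm
  have hodd := odd_route_bound hp hpq hs hPQ hMCy hcfQ
  set M := intMahlerMeasure P with hMdef
  have hb32 : (3 / 2 : ℝ) ≤ |(b : ℝ)| / 2 := by
    have : (3 : ℝ) ≤ |(b : ℝ)| := by exact_mod_cast hb3
    linarith
  have h1 : (|(b : ℝ)| / 2) ^ Q.natDegree ≤ M ^ n := by
    rw [div_pow, div_le_iff₀ (by positivity)]
    calc |(b : ℝ)| ^ Q.natDegree ≤ 2 ^ Q.natDegree * M ^ n := by exact_mod_cast hodd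
      _ = M ^ n * 2 ^ Q.natDegree := by ring
  by_cases hb4 : |b| = 3 ∨ |b| = 4
  · -- `|b| = 3`: `(3/2)^{n-2} ≤ Mⁿ` and `n ≥ 7` (n = 6 is the extra certificate); `|b| = 4`: `2^{n-2} ≤ Mⁿ`
    have h2 : (|(b : ℝ)| / 2) ^ (n - 2) ≤ M ^ n :=
      le_trans (pow_le_pow_right₀ (by linarith) hQn) h1
    rcases hb4 with h3 | h4
    · have hn7 : 7 ≤ n := by have := h36 h3; omega
      have h3R : |(b : ℝ)| / 2 = 3 / 2 := by
        have : |(b : ℝ)| = 3 := by exact_mod_cast h3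
        rw [this]
      rw [h3R] at h2
      exact smythTheta_le_of_pow_le (by omega) hM0 h2 (pow_13248_le_three_halves n hn7)
    · have h4R : |(b : ℝ)| / 2 = 2 := by
        have : |(b : ℝ)| = 4 := by exact_mod_cast h4
        rw [this]; norm_num
      rw [h4R] at h2
      exact smythTheta_le_of_pow_le (by omega) hM0 h2 (pow_13248_le_two' n (by omega))
  · -- `|b| ≥ 5`: `3 deg Q ≥ n`, `(5/2)ⁿ ≤ M^{3n}`
    have hb5 : 5 ≤ |b| := by omega
    have hb52 : (5 / 2 : ℝ) ≤ |(b : ℝ)| / 2 := by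
      have : (5 : ℝ) ≤ |(b : ℝ)| := by exact_mod_cast hb5
      linarith
    have hQ3 : n ≤ 3 * Q.natDegree := by omega
    have h2 : (5 / 2 : ℝ) ^ n ≤ (M ^ 3) ^ n := by
      calc (5 / 2 : ℝ) ^ n ≤ (5 / 2) ^ (3 * Q.natDegree) := pow_le_pow_right₀ (by norm_num) hQ3
        _ ≤ (|(b : ℝ)| / 2) ^ (3 * Q.natDegree) := pow_le_pow_left₀ (by norm_num) hb52 _
        _ = ((|(b : ℝ)| / 2) ^ Q.natDegree) ^ 3 := by rw [mul_comm, pow_mul]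
        _ ≤ (M ^ n) ^ 3 := pow_le_pow_left₀ (by positivity) h1 3
        _ = (M ^ 3) ^ n := by rw [← pow_mul, ← pow_mul, mul_comm]
    have h3 : (5 / 2 : ℝ) ≤ M ^ 3 := le_of_pow_le_pow_left₀ (by omega : n ≠ 0) (by positivity) h2
    exact smythTheta_le_of_pow_le (by norm_num) hM0 h3 (by norm_num)

end Quadrinomial

end Literature.NumberTheory.MahlerMeasure

end Part6

/-!
## Part 7 — port of `Summits/Ventures/DiscreteObjects/Mahler/FourTermResidualCerts.lean` (40 declarations kept)

# Graeffe certificates for the residual quadrinomials of Dobrowolski's Proposition 2 (venture `DiscreteObjects`, target L)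

Cell `pub-namedobj`, seat `pub-namedobj-mahler-g24`. Framing: lottery ticket; floor = certified
bounds/negative ranges.

Kernel certificates (`CensusCertificate.checkCert`, Graeffe rejection `Cert.grf m k`, exact integer arithmetic,
`decide`) that `M(R) > 13248/10000 > θ₀` for the finitely many quadrinomials
`R = x^{p+q} + b x^p + s b x^q + s` left over by the gcd-reduced resultant argument in the kernel version of
[Dobrowolski2006] E. Dobrowolski, Acta Arith. 123 (2006), Prop. 2 (REPLICATION; the paper settles them "by direct
computation of `M(f)`"): all coprime `0 < p < q` with `6 ≤ p + q ≤ 26` and `b = ±2`, `s = ±1` (404 polynomials), and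
`(p,q) = (1,5)`, `b = ±3`; `(p,q) = (3,5)`, `b = ±4` (8 polynomials).  Odd-degree `R` are certified as `x·R`
(even degree, same measure).  Certificates found by `pub-namedobj-mahler-g24/code/sharp/gen_certs.py`
(≤ 6 Graeffe steps each).

* `quadAsc`, `quadAscE` — the ascending coefficient lists; `ofCoeffs_quadAscE`;
* `certOf` — the certificate table; `residualOK` — the checked Boolean;
* `residualOK_p1 … ` — `decide`d in chunks; `lt_measure_of_residualOK` — soundness:
  `13248/10000 < M(x^{p+q} + b x^p + s b x^q + s)`.
-/

section Part7

set_option Elab.async false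

namespace Literature.NumberTheory.MahlerMeasure

open _root_.Polynomial

/-- Ascending coefficient list of `x^{p+q} + b x^p + (s b) x^q + s`.
[cite: Dobrowolski2006, Proposition 2 p.203 (proof: finitely many residual quadrinomials, Graeffe certificates)] -/
def quadAsc (p q : ℕ) (b s : ℤ) : List ℤ :=
  lpAdd (lpAdd (lpAdd (lpMonom (p + q) 1) (lpMonom p b)) (lpMonom q (s * b))) (lpMonom 0 s)

/-- The same, multiplied by `x` when the degree `p + q` is odd (so that Graeffe steps stay monic).
[cite: Dobrowolski2006, Proposition 2 p.203 (proof: finitely many residual quadrinomials, Graeffe certificates)] -/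
def quadAscE (p q : ℕ) (b s : ℤ) : List ℤ :=
  if (p + q) % 2 = 1 then 0 :: quadAsc p q b s else quadAsc p q b s

/-- `ofCoeffs (quadAsc p q b s)` is the quadrinomial.
[cite: Dobrowolski2006, Proposition 2 p.203 (proof: finitely many residual quadrinomials, Graeffe certificates)] -/
theorem ofCoeffs_quadAsc (p q : ℕ) (b s : ℤ) :
    ofCoeffs (quadAsc p q b s) = X ^ (p + q) + C b * X ^ p + C (s * b) * X ^ q + C s := by
  simp only [quadAsc, ofCoeffs_lpAdd, ofCoeffs_lpMonom]
  rw [map_one, one_mul, pow_zero, mul_one]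

/-- `ofCoeffs (quadAscE p q b s)` is the quadrinomial or `x` times it.
[cite: Dobrowolski2006, Proposition 2 p.203 (proof: finitely many residual quadrinomials, Graeffe certificates)] -/
theorem ofCoeffs_quadAscE (p q : ℕ) (b s : ℤ) :
    ofCoeffs (quadAscE p q b s) = X ^ (p + q) + C b * X ^ p + C (s * b) * X ^ q + C s ∨
      ofCoeffs (quadAscE p q b s) = X * (X ^ (p + q) + C b * X ^ p + C (s * b) * X ^ q + C s) := by
  unfold quadAscE
  split_ifs
  · right; rw [ofCoeffs_cons, ofCoeffs_quadAsc, map_zero, add_zero]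
  · left; exact ofCoeffs_quadAsc p q b s

/-- Certificate table, chunk 1 (`(p, q, b, s) ↦ (Graeffe steps m, coefficient index k)`).
[cite: Dobrowolski2006, Proposition 2 p.203 (proof: finitely many residual quadrinomials, Graeffe certificates)] -/
def certTable1 : List ((ℕ × ℕ × ℤ × ℤ) × (ℕ × ℕ)) := [
  ((1, 5, 2, 1), (2, 3)), ((1, 5, -2, 1), (2, 3)), ((1, 5, 2, -1), (2, 3)), ((1, 5, -2, -1), (2, 3)), ((1, 6, 2, 1), (3, 7)), ((1, 6, -2, 1), (3, 7)),
  ((1, 6, 2, -1), (3, 7)), ((1, 6, -2, -1), (3, 7)), ((2, 5, 2, 1), (3, 5)), ((2, 5, -2, 1), (4, 7)), ((2, 5, 2, -1), (4, 7)), ((2, 5, -2, -1), (3, 5)),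
  ((3, 4, 2, 1), (3, 5)), ((3, 4, -2, 1), (4, 5)), ((3, 4, 2, -1), (3, 5)), ((3, 4, -2, -1), (4, 5)), ((1, 7, 2, 1), (3, 1)), ((1, 7, -2, 1), (3, 1)),
  ((1, 7, 2, -1), (3, 1)), ((1, 7, -2, -1), (3, 1)), ((3, 5, 2, 1), (4, 3)), ((3, 5, -2, 1), (4, 3)), ((3, 5, 2, -1), (4, 3)), ((3, 5, -2, -1), (4, 3)),
  ((1, 8, 2, 1), (3, 9)), ((1, 8, -2, 1), (3, 9)), ((1, 8, 2, -1), (3, 9)), ((1, 8, -2, -1), (3, 9)), ((2, 7, 2, 1), (4, 8)), ((2, 7, -2, 1), (4, 8))]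

/-- Certificate table, chunk 2 (`(p, q, b, s) ↦ (Graeffe steps m, coefficient index k)`).
[cite: Dobrowolski2006, Proposition 2 p.203 (proof: finitely many residual quadrinomials, Graeffe certificates)] -/
def certTable2 : List ((ℕ × ℕ × ℤ × ℤ) × (ℕ × ℕ)) := [
  ((2, 7, 2, -1), (4, 8)), ((2, 7, -2, -1), (4, 8)), ((4, 5, 2, 1), (4, 8)), ((4, 5, -2, 1), (4, 7)), ((4, 5, 2, -1), (4, 7)), ((4, 5, -2, -1), (4, 8)),
  ((1, 9, 2, 1), (3, 5)), ((1, 9, -2, 1), (3, 5)), ((1, 9, 2, -1), (3, 5)), ((1, 9, -2, -1), (3, 5)), ((3, 7, 2, 1), (4, 3)), ((3, 7, -2, 1), (4, 3)),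
  ((3, 7, 2, -1), (4, 2)), ((3, 7, -2, -1), (4, 2)), ((1, 10, 2, 1), (3, 11)), ((1, 10, -2, 1), (3, 11)), ((1, 10, 2, -1), (3, 11)), ((1, 10, -2, -1), (3, 11)),
  ((2, 9, 2, 1), (4, 7)), ((2, 9, -2, 1), (4, 9)), ((2, 9, 2, -1), (4, 9)), ((2, 9, -2, -1), (4, 7)), ((3, 8, 2, 1), (4, 10)), ((3, 8, -2, 1), (4, 8)),
  ((3, 8, 2, -1), (4, 10)), ((3, 8, -2, -1), (4, 8)), ((4, 7, 2, 1), (4, 8)), ((4, 7, -2, 1), (4, 9)), ((4, 7, 2, -1), (4, 9)), ((4, 7, -2, -1), (4, 8))]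

/-- Certificate table, chunk 3 (`(p, q, b, s) ↦ (Graeffe steps m, coefficient index k)`).
[cite: Dobrowolski2006, Proposition 2 p.203 (proof: finitely many residual quadrinomials, Graeffe certificates)] -/
def certTable3 : List ((ℕ × ℕ × ℤ × ℤ) × (ℕ × ℕ)) := [
  ((5, 6, 2, 1), (4, 8)), ((5, 6, -2, 1), (4, 9)), ((5, 6, 2, -1), (4, 8)), ((5, 6, -2, -1), (4, 9)), ((1, 11, 2, 1), (3, 1)), ((1, 11, -2, 1), (3, 1)),
  ((1, 11, 2, -1), (3, 1)), ((1, 11, -2, -1), (3, 1)), ((5, 7, 2, 1), (5, 3)), ((5, 7, -2, 1), (5, 3)), ((5, 7, 2, -1), (4, 6)), ((5, 7, -2, -1), (4, 6)),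
  ((1, 12, 2, 1), (3, 13)), ((1, 12, -2, 1), (3, 13)), ((1, 12, 2, -1), (3, 13)), ((1, 12, -2, -1), (3, 13)), ((2, 11, 2, 1), (4, 12)), ((2, 11, -2, 1), (4, 12)),
  ((2, 11, 2, -1), (4, 12)), ((2, 11, -2, -1), (4, 12)), ((3, 10, 2, 1), (4, 11)), ((3, 10, -2, 1), (4, 11)), ((3, 10, 2, -1), (4, 11)), ((3, 10, -2, -1), (4, 11)),
  ((4, 9, 2, 1), (4, 10)), ((4, 9, -2, 1), (5, 11)), ((4, 9, 2, -1), (5, 11)), ((4, 9, -2, -1), (4, 10)), ((5, 8, 2, 1), (4, 8)), ((5, 8, -2, 1), (5, 9))]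

/-- Certificate table, chunk 4 (`(p, q, b, s) ↦ (Graeffe steps m, coefficient index k)`).
[cite: Dobrowolski2006, Proposition 2 p.203 (proof: finitely many residual quadrinomials, Graeffe certificates)] -/
def certTable4 : List ((ℕ × ℕ × ℤ × ℤ) × (ℕ × ℕ)) := [
  ((5, 8, 2, -1), (4, 8)), ((5, 8, -2, -1), (5, 9)), ((6, 7, 2, 1), (5, 8)), ((6, 7, -2, 1), (4, 8)), ((6, 7, 2, -1), (4, 8)), ((6, 7, -2, -1), (5, 8)),
  ((1, 13, 2, 1), (3, 1)), ((1, 13, -2, 1), (3, 1)), ((1, 13, 2, -1), (3, 1)), ((1, 13, -2, -1), (3, 1)), ((3, 11, 2, 1), (4, 3)), ((3, 11, -2, 1), (4, 3)),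
  ((3, 11, 2, -1), (4, 3)), ((3, 11, -2, -1), (4, 3)), ((5, 9, 2, 1), (5, 5)), ((5, 9, -2, 1), (5, 5)), ((5, 9, 2, -1), (5, 4)), ((5, 9, -2, -1), (5, 4)),
  ((1, 14, 2, 1), (3, 15)), ((1, 14, -2, 1), (3, 15)), ((1, 14, 2, -1), (3, 15)), ((1, 14, -2, -1), (3, 15)), ((2, 13, 2, 1), (4, 14)), ((2, 13, -2, 1), (4, 14)),
  ((2, 13, 2, -1), (4, 14)), ((2, 13, -2, -1), (4, 14)), ((4, 11, 2, 1), (5, 12)), ((4, 11, -2, 1), (5, 13)), ((4, 11, 2, -1), (5, 13)), ((4, 11, -2, -1), (5, 12))]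

/-- Certificate table, chunk 5 (`(p, q, b, s) ↦ (Graeffe steps m, coefficient index k)`).
[cite: Dobrowolski2006, Proposition 2 p.203 (proof: finitely many residual quadrinomials, Graeffe certificates)] -/
def certTable5 : List ((ℕ × ℕ × ℤ × ℤ) × (ℕ × ℕ)) := [
  ((7, 8, 2, 1), (5, 12)), ((7, 8, -2, 1), (5, 11)), ((7, 8, 2, -1), (5, 12)), ((7, 8, -2, -1), (5, 11)), ((1, 15, 2, 1), (3, 1)), ((1, 15, -2, 1), (3, 1)),
  ((1, 15, 2, -1), (3, 1)), ((1, 15, -2, -1), (3, 1)), ((3, 13, 2, 1), (4, 3)), ((3, 13, -2, 1), (4, 3)), ((3, 13, 2, -1), (4, 3)), ((3, 13, -2, -1), (4, 3)),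
  ((5, 11, 2, 1), (5, 5)), ((5, 11, -2, 1), (5, 5)), ((5, 11, 2, -1), (5, 4)), ((5, 11, -2, -1), (5, 4)), ((7, 9, 2, 1), (5, 7)), ((7, 9, -2, 1), (5, 7)),
  ((7, 9, 2, -1), (5, 6)), ((7, 9, -2, -1), (5, 6)), ((1, 16, 2, 1), (3, 17)), ((1, 16, -2, 1), (3, 17)), ((1, 16, 2, -1), (3, 17)), ((1, 16, -2, -1), (3, 17)),
  ((2, 15, 2, 1), (4, 16)), ((2, 15, -2, 1), (4, 16)), ((2, 15, 2, -1), (4, 16)), ((2, 15, -2, -1), (4, 16)), ((3, 14, 2, 1), (5, 15)), ((3, 14, -2, 1), (5, 15))]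

/-- Certificate table, chunk 6 (`(p, q, b, s) ↦ (Graeffe steps m, coefficient index k)`).
[cite: Dobrowolski2006, Proposition 2 p.203 (proof: finitely many residual quadrinomials, Graeffe certificates)] -/
def certTable6 : List ((ℕ × ℕ × ℤ × ℤ) × (ℕ × ℕ)) := [
  ((3, 14, 2, -1), (5, 15)), ((3, 14, -2, -1), (5, 15)), ((4, 13, 2, 1), (5, 14)), ((4, 13, -2, 1), (5, 14)), ((4, 13, 2, -1), (5, 14)), ((4, 13, -2, -1), (5, 14)),
  ((5, 12, 2, 1), (5, 14)), ((5, 12, -2, 1), (5, 13)), ((5, 12, 2, -1), (5, 14)), ((5, 12, -2, -1), (5, 13)), ((6, 11, 2, 1), (5, 10)), ((6, 11, -2, 1), (5, 10)),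
  ((6, 11, 2, -1), (5, 10)), ((6, 11, -2, -1), (5, 10)), ((7, 10, 2, 1), (5, 12)), ((7, 10, -2, 1), (5, 13)), ((7, 10, 2, -1), (5, 12)), ((7, 10, -2, -1), (5, 13)),
  ((8, 9, 2, 1), (5, 12)), ((8, 9, -2, 1), (5, 13)), ((8, 9, 2, -1), (5, 13)), ((8, 9, -2, -1), (5, 12)), ((1, 17, 2, 1), (3, 1)), ((1, 17, -2, 1), (3, 1)),
  ((1, 17, 2, -1), (3, 1)), ((1, 17, -2, -1), (3, 1)), ((5, 13, 2, 1), (5, 6)), ((5, 13, -2, 1), (5, 6)), ((5, 13, 2, -1), (5, 5)), ((5, 13, -2, -1), (5, 5))]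

/-- Certificate table, chunk 7 (`(p, q, b, s) ↦ (Graeffe steps m, coefficient index k)`).
[cite: Dobrowolski2006, Proposition 2 p.203 (proof: finitely many residual quadrinomials, Graeffe certificates)] -/
def certTable7 : List ((ℕ × ℕ × ℤ × ℤ) × (ℕ × ℕ)) := [
  ((7, 11, 2, 1), (5, 5)), ((7, 11, -2, 1), (5, 5)), ((7, 11, 2, -1), (5, 6)), ((7, 11, -2, -1), (5, 6)), ((1, 18, 2, 1), (3, 19)), ((1, 18, -2, 1), (3, 19)),
  ((1, 18, 2, -1), (3, 19)), ((1, 18, -2, -1), (3, 19)), ((2, 17, 2, 1), (4, 18)), ((2, 17, -2, 1), (4, 18)), ((2, 17, 2, -1), (4, 18)), ((2, 17, -2, -1), (4, 18)),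
  ((3, 16, 2, 1), (4, 15)), ((3, 16, -2, 1), (4, 15)), ((3, 16, 2, -1), (4, 15)), ((3, 16, -2, -1), (4, 15)), ((4, 15, 2, 1), (5, 16)), ((4, 15, -2, 1), (5, 16)),
  ((4, 15, 2, -1), (5, 16)), ((4, 15, -2, -1), (5, 16)), ((5, 14, 2, 1), (5, 14)), ((5, 14, -2, 1), (5, 11)), ((5, 14, 2, -1), (5, 14)), ((5, 14, -2, -1), (5, 11)),
  ((6, 13, 2, 1), (5, 14)), ((6, 13, -2, 1), (5, 15)), ((6, 13, 2, -1), (5, 15)), ((6, 13, -2, -1), (5, 14)), ((7, 12, 2, 1), (5, 13)), ((7, 12, -2, 1), (5, 15))]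

/-- Certificate table, chunk 8 (`(p, q, b, s) ↦ (Graeffe steps m, coefficient index k)`).
[cite: Dobrowolski2006, Proposition 2 p.203 (proof: finitely many residual quadrinomials, Graeffe certificates)] -/
def certTable8 : List ((ℕ × ℕ × ℤ × ℤ) × (ℕ × ℕ)) := [
  ((7, 12, 2, -1), (5, 13)), ((7, 12, -2, -1), (5, 15)), ((8, 11, 2, 1), (5, 13)), ((8, 11, -2, 1), (5, 14)), ((8, 11, 2, -1), (5, 14)), ((8, 11, -2, -1), (5, 13)),
  ((9, 10, 2, 1), (5, 13)), ((9, 10, -2, 1), (5, 11)), ((9, 10, 2, -1), (5, 13)), ((9, 10, -2, -1), (5, 11)), ((1, 19, 2, 1), (3, 1)), ((1, 19, -2, 1), (3, 1)),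
  ((1, 19, 2, -1), (3, 1)), ((1, 19, -2, -1), (3, 1)), ((3, 17, 2, 1), (5, 3)), ((3, 17, -2, 1), (5, 3)), ((3, 17, 2, -1), (5, 3)), ((3, 17, -2, -1), (5, 3)),
  ((7, 13, 2, 1), (5, 10)), ((7, 13, -2, 1), (5, 10)), ((7, 13, 2, -1), (5, 10)), ((7, 13, -2, -1), (5, 10)), ((9, 11, 2, 1), (5, 8)), ((9, 11, -2, 1), (5, 8)),
  ((9, 11, 2, -1), (5, 6)), ((9, 11, -2, -1), (5, 6)), ((1, 20, 2, 1), (3, 21)), ((1, 20, -2, 1), (3, 21)), ((1, 20, 2, -1), (3, 21)), ((1, 20, -2, -1), (3, 21))]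

/-- Certificate table, chunk 9 (`(p, q, b, s) ↦ (Graeffe steps m, coefficient index k)`).
[cite: Dobrowolski2006, Proposition 2 p.203 (proof: finitely many residual quadrinomials, Graeffe certificates)] -/
def certTable9 : List ((ℕ × ℕ × ℤ × ℤ) × (ℕ × ℕ)) := [
  ((2, 19, 2, 1), (4, 20)), ((2, 19, -2, 1), (4, 20)), ((2, 19, 2, -1), (4, 20)), ((2, 19, -2, -1), (4, 20)), ((4, 17, 2, 1), (5, 18)), ((4, 17, -2, 1), (5, 18)),
  ((4, 17, 2, -1), (5, 18)), ((4, 17, -2, -1), (5, 18)), ((5, 16, 2, 1), (5, 15)), ((5, 16, -2, 1), (5, 16)), ((5, 16, 2, -1), (5, 15)), ((5, 16, -2, -1), (5, 16)),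
  ((8, 13, 2, 1), (5, 16)), ((8, 13, -2, 1), (5, 14)), ((8, 13, 2, -1), (5, 14)), ((8, 13, -2, -1), (5, 16)), ((10, 11, 2, 1), (5, 16)), ((10, 11, -2, 1), (5, 15)),
  ((10, 11, 2, -1), (5, 15)), ((10, 11, -2, -1), (5, 16)), ((1, 21, 2, 1), (3, 1)), ((1, 21, -2, 1), (3, 1)), ((1, 21, 2, -1), (3, 1)), ((1, 21, -2, -1), (3, 1)),
  ((3, 19, 2, 1), (4, 11)), ((3, 19, -2, 1), (4, 11)), ((3, 19, 2, -1), (4, 11)), ((3, 19, -2, -1), (4, 11)), ((5, 17, 2, 1), (5, 5)), ((5, 17, -2, 1), (5, 5))]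

/-- Certificate table, chunk 10 (`(p, q, b, s) ↦ (Graeffe steps m, coefficient index k)`).
[cite: Dobrowolski2006, Proposition 2 p.203 (proof: finitely many residual quadrinomials, Graeffe certificates)] -/
def certTable10 : List ((ℕ × ℕ × ℤ × ℤ) × (ℕ × ℕ)) := [
  ((5, 17, 2, -1), (5, 5)), ((5, 17, -2, -1), (5, 5)), ((7, 15, 2, 1), (5, 8)), ((7, 15, -2, 1), (5, 8)), ((7, 15, 2, -1), (5, 6)), ((7, 15, -2, -1), (5, 6)),
  ((9, 13, 2, 1), (5, 11)), ((9, 13, -2, 1), (5, 11)), ((9, 13, 2, -1), (5, 11)), ((9, 13, -2, -1), (5, 11)), ((1, 22, 2, 1), (3, 23)), ((1, 22, -2, 1), (3, 23)),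
  ((1, 22, 2, -1), (3, 23)), ((1, 22, -2, -1), (3, 23)), ((2, 21, 2, 1), (4, 22)), ((2, 21, -2, 1), (4, 22)), ((2, 21, 2, -1), (4, 22)), ((2, 21, -2, -1), (4, 22)),
  ((3, 20, 2, 1), (5, 21)), ((3, 20, -2, 1), (5, 21)), ((3, 20, 2, -1), (5, 21)), ((3, 20, -2, -1), (5, 21)), ((4, 19, 2, 1), (5, 20)), ((4, 19, -2, 1), (5, 20)),
  ((4, 19, 2, -1), (5, 20)), ((4, 19, -2, -1), (5, 20)), ((5, 18, 2, 1), (5, 19)), ((5, 18, -2, 1), (5, 19)), ((5, 18, 2, -1), (5, 19)), ((5, 18, -2, -1), (5, 19))]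

/-- Certificate table, chunk 11 (`(p, q, b, s) ↦ (Graeffe steps m, coefficient index k)`).
[cite: Dobrowolski2006, Proposition 2 p.203 (proof: finitely many residual quadrinomials, Graeffe certificates)] -/
def certTable11 : List ((ℕ × ℕ × ℤ × ℤ) × (ℕ × ℕ)) := [
  ((6, 17, 2, 1), (5, 18)), ((6, 17, -2, 1), (5, 19)), ((6, 17, 2, -1), (5, 19)), ((6, 17, -2, -1), (5, 18)), ((7, 16, 2, 1), (5, 17)), ((7, 16, -2, 1), (5, 14)),
  ((7, 16, 2, -1), (5, 17)), ((7, 16, -2, -1), (5, 14)), ((8, 15, 2, 1), (6, 16)), ((8, 15, -2, 1), (5, 17)), ((8, 15, 2, -1), (5, 17)), ((8, 15, -2, -1), (6, 16)),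
  ((9, 14, 2, 1), (5, 18)), ((9, 14, -2, 1), (5, 18)), ((9, 14, 2, -1), (5, 18)), ((9, 14, -2, -1), (5, 18)), ((10, 13, 2, 1), (5, 14)), ((10, 13, -2, 1), (5, 15)),
  ((10, 13, 2, -1), (5, 15)), ((10, 13, -2, -1), (5, 14)), ((11, 12, 2, 1), (5, 14)), ((11, 12, -2, 1), (5, 17)), ((11, 12, 2, -1), (5, 14)), ((11, 12, -2, -1), (5, 17)),
  ((1, 23, 2, 1), (3, 1)), ((1, 23, -2, 1), (3, 1)), ((1, 23, 2, -1), (3, 1)), ((1, 23, -2, -1), (3, 1)), ((5, 19, 2, 1), (5, 5)), ((5, 19, -2, 1), (5, 5))]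

/-- Certificate table, chunk 12 (`(p, q, b, s) ↦ (Graeffe steps m, coefficient index k)`).
[cite: Dobrowolski2006, Proposition 2 p.203 (proof: finitely many residual quadrinomials, Graeffe certificates)] -/
def certTable12 : List ((ℕ × ℕ × ℤ × ℤ) × (ℕ × ℕ)) := [
  ((5, 19, 2, -1), (5, 5)), ((5, 19, -2, -1), (5, 5)), ((7, 17, 2, 1), (5, 7)), ((7, 17, -2, 1), (5, 7)), ((7, 17, 2, -1), (5, 6)), ((7, 17, -2, -1), (5, 6)),
  ((11, 13, 2, 1), (5, 12)), ((11, 13, -2, 1), (5, 12)), ((11, 13, 2, -1), (5, 9)), ((11, 13, -2, -1), (5, 9)), ((1, 24, 2, 1), (3, 25)), ((1, 24, -2, 1), (3, 25)),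
  ((1, 24, 2, -1), (3, 25)), ((1, 24, -2, -1), (3, 25)), ((2, 23, 2, 1), (4, 24)), ((2, 23, -2, 1), (4, 24)), ((2, 23, 2, -1), (4, 24)), ((2, 23, -2, -1), (4, 24)),
  ((3, 22, 2, 1), (5, 23)), ((3, 22, -2, 1), (5, 23)), ((3, 22, 2, -1), (5, 23)), ((3, 22, -2, -1), (5, 23)), ((4, 21, 2, 1), (5, 22)), ((4, 21, -2, 1), (5, 22)),
  ((4, 21, 2, -1), (5, 22)), ((4, 21, -2, -1), (5, 22)), ((6, 19, 2, 1), (5, 14)), ((6, 19, -2, 1), (5, 16)), ((6, 19, 2, -1), (5, 16)), ((6, 19, -2, -1), (5, 14))]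

/-- Certificate table, chunk 13 (`(p, q, b, s) ↦ (Graeffe steps m, coefficient index k)`).
[cite: Dobrowolski2006, Proposition 2 p.203 (proof: finitely many residual quadrinomials, Graeffe certificates)] -/
def certTable13 : List ((ℕ × ℕ × ℤ × ℤ) × (ℕ × ℕ)) := [
  ((7, 18, 2, 1), (6, 20)), ((7, 18, -2, 1), (5, 19)), ((7, 18, 2, -1), (6, 20)), ((7, 18, -2, -1), (5, 19)), ((8, 17, 2, 1), (6, 18)), ((8, 17, -2, 1), (6, 18)),
  ((8, 17, 2, -1), (6, 18)), ((8, 17, -2, -1), (6, 18)), ((9, 16, 2, 1), (5, 14)), ((9, 16, -2, 1), (6, 19)), ((9, 16, 2, -1), (5, 14)), ((9, 16, -2, -1), (6, 19)),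
  ((11, 14, 2, 1), (6, 18)), ((11, 14, -2, 1), (6, 17)), ((11, 14, 2, -1), (6, 18)), ((11, 14, -2, -1), (6, 17)), ((12, 13, 2, 1), (6, 18)), ((12, 13, -2, 1), (6, 17)),
  ((12, 13, 2, -1), (6, 17)), ((12, 13, -2, -1), (6, 18)), ((1, 25, 2, 1), (3, 1)), ((1, 25, -2, 1), (3, 1)), ((1, 25, 2, -1), (3, 1)), ((1, 25, -2, -1), (3, 1)),
  ((3, 23, 2, 1), (5, 3)), ((3, 23, -2, 1), (5, 3)), ((3, 23, 2, -1), (5, 3)), ((3, 23, -2, -1), (5, 3)), ((5, 21, 2, 1), (5, 5)), ((5, 21, -2, 1), (5, 5))]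

/-- Certificate table, chunk 14 (`(p, q, b, s) ↦ (Graeffe steps m, coefficient index k)`).
[cite: Dobrowolski2006, Proposition 2 p.203 (proof: finitely many residual quadrinomials, Graeffe certificates)] -/
def certTable14 : List ((ℕ × ℕ × ℤ × ℤ) × (ℕ × ℕ)) := [
  ((5, 21, 2, -1), (5, 5)), ((5, 21, -2, -1), (5, 5)), ((7, 19, 2, 1), (5, 7)), ((7, 19, -2, 1), (5, 7)), ((7, 19, 2, -1), (6, 6)), ((7, 19, -2, -1), (6, 6)),
  ((9, 17, 2, 1), (6, 8)), ((9, 17, -2, 1), (6, 8)), ((9, 17, 2, -1), (6, 8)), ((9, 17, -2, -1), (6, 8)), ((11, 15, 2, 1), (6, 10)), ((11, 15, -2, 1), (6, 10)),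
  ((11, 15, 2, -1), (6, 10)), ((11, 15, -2, -1), (6, 10)), ((1, 5, 3, 1), (2, 3)), ((1, 5, -3, 1), (2, 3)), ((3, 5, 4, 1), (2, 4)), ((3, 5, -4, 1), (2, 4)),
  ((1, 5, 3, -1), (2, 3)), ((1, 5, -3, -1), (2, 3)), ((3, 5, 4, -1), (2, 4)), ((3, 5, -4, -1), (2, 4))]

/-- The certificate table `(p, q, b, s) ↦ (m, k)` (412 entries).
[cite: Dobrowolski2006, Proposition 2 p.203 (proof: finitely many residual quadrinomials, Graeffe certificates)] -/
def certTable : List ((ℕ × ℕ × ℤ × ℤ) × (ℕ × ℕ)) :=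
  certTable1 ++ certTable2 ++ certTable3 ++ certTable4 ++ certTable5 ++ certTable6 ++ certTable7 ++ certTable8 ++ certTable9 ++ certTable10 ++ certTable11 ++ certTable12 ++ certTable13 ++ certTable14

/-- The Graeffe certificate of `(p, q, b, s)` (default `grf 0 0` off the table).
[cite: Dobrowolski2006, Proposition 2 p.203 (proof: finitely many residual quadrinomials, Graeffe certificates)] -/
def certOf (p q : ℕ) (b s : ℤ) : Cert :=
  match certTable.find? (fun e => e.1 == (p, q, b, s)) with
  | some e => Cert.grf e.2.1 e.2.2
  | none => Cert.grf 0 0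

/-- The checked Boolean: the list is monic of the right length and its Graeffe certificate rejects
`B = 13248/10000`.
[cite: Dobrowolski2006, Proposition 2 p.203 (proof: finitely many residual quadrinomials, Graeffe certificates)] -/
def residualOK (p q : ℕ) (b s : ℤ) : Bool :=
  ((quadAscE p q b s).length == (quadAscE p q b s).length - 1 + 1) &&
  ((quadAscE p q b s).getD ((quadAscE p q b s).length - 1) 0 == 1) &&
  checkCert 13248 10000 ((quadAscE p q b s).length - 1) [] (quadAscE p q b s) (certOf p q b s)

/-- Soundness of a Graeffe rejection certificate (the `grf` branch of `checkCert_sound`).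
[cite: Dobrowolski2006, Proposition 2 p.203 (proof: finitely many residual quadrinomials, Graeffe certificates)] -/
theorem lt_measure_of_checkCert_grf {Bn Bd n : ℕ} (hBd : 0 < Bd) {L : List (List ℤ)} {asc : List ℤ} {m k : ℕ}
    (h : checkCert Bn Bd n L asc (Cert.grf m k) = true) (hmon : (ofCoeffs asc).Monic)
    (hdeg : (ofCoeffs asc).natDegree = n) : (Bn : ℝ) / Bd < intMahlerMeasure (ofCoeffs asc) := by
  simp only [checkCert] at h
  split at h
  · simp at h
  · rename_i q hq
    simp only [decide_eq_true_eq] at h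
    obtain ⟨hchain, _, hdeg'⟩ := graeffeIter_sound n m asc q hq hmon hdeg
    have hBd' : (0 : ℚ) < (Bd : ℚ) ^ (2 ^ m) := by positivity
    have hk : ((ofCoeffs q).natDegree.choose k : ℚ) * ((Bn : ℚ) / Bd) ^ (2 ^ m) < |((ofCoeffs q).coeff k : ℚ)| := by
      rw [hdeg', coeff_ofCoeffs, div_pow, ← mul_div_assoc, div_lt_iff₀ hBd']
      exact_mod_cast h
    have := lt_intMahlerMeasure_of_graeffeChain hchain k hk
    simpa [Rat.cast_div] using this

/-- `certOf` always returns a Graeffe certificate.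
[cite: Dobrowolski2006, Proposition 2 p.203 (proof: finitely many residual quadrinomials, Graeffe certificates)] -/
theorem certOf_eq_grf (p q : ℕ) (b s : ℤ) : ∃ m k : ℕ, certOf p q b s = Cert.grf m k := by
  unfold certOf
  split
  · rename_i e _
    exact ⟨e.2.1, e.2.2, rfl⟩
  · exact ⟨0, 0, rfl⟩

/-- **Soundness:** `residualOK p q b s = true` gives `13248/10000 < M(x^{p+q} + b x^p + s b x^q + s)`.
[cite: Dobrowolski2006, Proposition 2 p.203 (proof: finitely many residual quadrinomials, Graeffe certificates)] -/
theorem lt_measure_of_residualOK {p q : ℕ} {b s : ℤ} (h : residualOK p q b s = true) :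
    (13248 : ℝ) / 10000 < intMahlerMeasure (X ^ (p + q) + C b * X ^ p + C (s * b) * X ^ q + C s : ℤ[X]) := by
  simp only [residualOK, Bool.and_eq_true, beq_iff_eq] at h
  obtain ⟨⟨hlen, hlast⟩, hc⟩ := h
  obtain ⟨m, k, hmk⟩ := certOf_eq_grf p q b s
  rw [hmk] at hc
  obtain ⟨hmon, hdeg⟩ := monic_ofCoeffs hlen hlast
  have hM := lt_measure_of_checkCert_grf (by norm_num) hc hmon hdeg
  rcases ofCoeffs_quadAscE p q b s with h | h
  · rw [h] at hM; exact_mod_cast hM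
  · rw [h, intMahlerMeasure_mul, intMahlerMeasure_X, one_mul] at hM; exact_mod_cast hM

/-! ### The kernel checks -/

/-- The residual partners `q` of `p`: `p < q < 27`, `gcd(p, q) = 1`, `6 ≤ p + q ≤ 26`.
[cite: Dobrowolski2006, Proposition 2 p.203 (proof: finitely many residual quadrinomials, Graeffe certificates)] -/
def residualPairs (p : ℕ) : List ℕ :=
  (List.range 27).filter (fun q => p < q ∧ Nat.Coprime p q ∧ 6 ≤ p + q ∧ p + q ≤ 26)

/-- Kernel check, `p = 1`.
[cite: Dobrowolski2006, Proposition 2 p.203 (proof: finitely many residual quadrinomials, Graeffe certificates)] -/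
theorem residualOK_p1 : ∀ q ∈ residualPairs 1, ∀ b ∈ [(2 : ℤ), -2], ∀ s ∈ [(1 : ℤ), -1],
    residualOK 1 q b s = true := by decide +kernel

/-- Kernel check, `p = 2`.
[cite: Dobrowolski2006, Proposition 2 p.203 (proof: finitely many residual quadrinomials, Graeffe certificates)] -/
theorem residualOK_p2 : ∀ q ∈ residualPairs 2, ∀ b ∈ [(2 : ℤ), -2], ∀ s ∈ [(1 : ℤ), -1],
    residualOK 2 q b s = true := by decide +kernel

/-- Kernel check, `p = 3`.
[cite: Dobrowolski2006, Proposition 2 p.203 (proof: finitely many residual quadrinomials, Graeffe certificates)] -/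
theorem residualOK_p3 : ∀ q ∈ residualPairs 3, ∀ b ∈ [(2 : ℤ), -2], ∀ s ∈ [(1 : ℤ), -1],
    residualOK 3 q b s = true := by decide +kernel

/-- Kernel check, `p = 4`.
[cite: Dobrowolski2006, Proposition 2 p.203 (proof: finitely many residual quadrinomials, Graeffe certificates)] -/
theorem residualOK_p4 : ∀ q ∈ residualPairs 4, ∀ b ∈ [(2 : ℤ), -2], ∀ s ∈ [(1 : ℤ), -1],
    residualOK 4 q b s = true := by decide +kernel

/-- Kernel check, `p = 5`.
[cite: Dobrowolski2006, Proposition 2 p.203 (proof: finitely many residual quadrinomials, Graeffe certificates)] -/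
theorem residualOK_p5 : ∀ q ∈ residualPairs 5, ∀ b ∈ [(2 : ℤ), -2], ∀ s ∈ [(1 : ℤ), -1],
    residualOK 5 q b s = true := by decide +kernel

/-- Kernel check, `p = 6`.
[cite: Dobrowolski2006, Proposition 2 p.203 (proof: finitely many residual quadrinomials, Graeffe certificates)] -/
theorem residualOK_p6 : ∀ q ∈ residualPairs 6, ∀ b ∈ [(2 : ℤ), -2], ∀ s ∈ [(1 : ℤ), -1],
    residualOK 6 q b s = true := by decide +kernel

/-- Kernel check, `p = 7`.
[cite: Dobrowolski2006, Proposition 2 p.203 (proof: finitely many residual quadrinomials, Graeffe certificates)] -/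
theorem residualOK_p7 : ∀ q ∈ residualPairs 7, ∀ b ∈ [(2 : ℤ), -2], ∀ s ∈ [(1 : ℤ), -1],
    residualOK 7 q b s = true := by decide +kernel

/-- Kernel check, `p = 8`.
[cite: Dobrowolski2006, Proposition 2 p.203 (proof: finitely many residual quadrinomials, Graeffe certificates)] -/
theorem residualOK_p8 : ∀ q ∈ residualPairs 8, ∀ b ∈ [(2 : ℤ), -2], ∀ s ∈ [(1 : ℤ), -1],
    residualOK 8 q b s = true := by decide +kernel

/-- Kernel check, `p = 9`.
[cite: Dobrowolski2006, Proposition 2 p.203 (proof: finitely many residual quadrinomials, Graeffe certificates)] -/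
theorem residualOK_p9 : ∀ q ∈ residualPairs 9, ∀ b ∈ [(2 : ℤ), -2], ∀ s ∈ [(1 : ℤ), -1],
    residualOK 9 q b s = true := by decide +kernel

/-- Kernel check, `p = 10`.
[cite: Dobrowolski2006, Proposition 2 p.203 (proof: finitely many residual quadrinomials, Graeffe certificates)] -/
theorem residualOK_p10 : ∀ q ∈ residualPairs 10, ∀ b ∈ [(2 : ℤ), -2], ∀ s ∈ [(1 : ℤ), -1],
    residualOK 10 q b s = true := by decide +kernel

/-- Kernel check, `p = 11`.
[cite: Dobrowolski2006, Proposition 2 p.203 (proof: finitely many residual quadrinomials, Graeffe certificates)] -/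
theorem residualOK_p11 : ∀ q ∈ residualPairs 11, ∀ b ∈ [(2 : ℤ), -2], ∀ s ∈ [(1 : ℤ), -1],
    residualOK 11 q b s = true := by decide +kernel

/-- Kernel check, `p = 12`.
[cite: Dobrowolski2006, Proposition 2 p.203 (proof: finitely many residual quadrinomials, Graeffe certificates)] -/
theorem residualOK_p12 : ∀ q ∈ residualPairs 12, ∀ b ∈ [(2 : ℤ), -2], ∀ s ∈ [(1 : ℤ), -1],
    residualOK 12 q b s = true := by decide +kernel

/-- Kernel check of the eight extra quadrinomials `(p,q) = (1,5)`, `b = ±3` and `(p,q) = (3,5)`, `b = ±4`.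
[cite: Dobrowolski2006, Proposition 2 p.203 (proof: finitely many residual quadrinomials, Graeffe certificates)] -/
theorem residualOK_extra : (∀ b ∈ [(3 : ℤ), -3], ∀ s ∈ [(1 : ℤ), -1], residualOK 1 5 b s = true) ∧
    (∀ b ∈ [(4 : ℤ), -4], ∀ s ∈ [(1 : ℤ), -1], residualOK 3 5 b s = true) := by decide +kernel

/-- **All residual quadrinomials with `|b| = 2`** (`0 < p < q`, `gcd(p,q) = 1`, `6 ≤ p + q ≤ 26`, `s = ±1`) have
`M > 13248/10000`.
[cite: Dobrowolski2006, Proposition 2 p.203 (proof: finitely many residual quadrinomials, Graeffe certificates)] -/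
theorem lt_measure_residual_two {p q : ℕ} (hp : 0 < p) (hpq : p < q) (hcop : Nat.Coprime p q)
    (h6 : 6 ≤ p + q) (h26 : p + q ≤ 26) {b s : ℤ} (hb : b = 2 ∨ b = -2) (hs : s = 1 ∨ s = -1) :
    (13248 : ℝ) / 10000 < intMahlerMeasure (X ^ (p + q) + C b * X ^ p + C (s * b) * X ^ q + C s : ℤ[X]) := by
  apply lt_measure_of_residualOK
  have hq : q ∈ residualPairs p := by
    simp only [residualPairs, List.mem_filter, List.mem_range, decide_eq_true_eq]
    exact ⟨by omega, hpq, hcop, h6, h26⟩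
  have hb' : b ∈ [(2 : ℤ), -2] := by rcases hb with h | h <;> simp [h]
  have hs' : s ∈ [(1 : ℤ), -1] := by rcases hs with h | h <;> simp [h]
  have hp12 : p ≤ 12 := by omega
  interval_cases p
  · exact residualOK_p1 q hq b hb' s hs'
  · exact residualOK_p2 q hq b hb' s hs'
  · exact residualOK_p3 q hq b hb' s hs'
  · exact residualOK_p4 q hq b hb' s hs'
  · exact residualOK_p5 q hq b hb' s hs'
  · exact residualOK_p6 q hq b hb' s hs'
  · exact residualOK_p7 q hq b hb' s hs'
  · exact residualOK_p8 q hq b hb' s hs'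
  · exact residualOK_p9 q hq b hb' s hs'
  · exact residualOK_p10 q hq b hb' s hs'
  · exact residualOK_p11 q hq b hb' s hs'
  · exact residualOK_p12 q hq b hb' s hs'

/-- The eight extra residual quadrinomials have `M > 13248/10000`.
[cite: Dobrowolski2006, Proposition 2 p.203 (proof: finitely many residual quadrinomials, Graeffe certificates)] -/
theorem lt_measure_residual_extra {b s : ℤ} (hs : s = 1 ∨ s = -1) :
    ((b = 3 ∨ b = -3) → (13248 : ℝ) / 10000 < intMahlerMeasure (X ^ (1 + 5) + C b * X ^ 1 + C (s * b) * X ^ 5 + C s : ℤ[X])) ∧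
    ((b = 4 ∨ b = -4) → (13248 : ℝ) / 10000 < intMahlerMeasure (X ^ (3 + 5) + C b * X ^ 3 + C (s * b) * X ^ 5 + C s : ℤ[X])) := by
  have hs' : s ∈ [(1 : ℤ), -1] := by rcases hs with h | h <;> simp [h]
  constructor
  · intro hb
    have hb' : b ∈ [(3 : ℤ), -3] := by rcases hb with h | h <;> simp [h]
    exact lt_measure_of_residualOK (residualOK_extra.1 b hb' s hs')
  · intro hb
    have hb' : b ∈ [(4 : ℤ), -4] := by rcases hb with h | h <;> simp [h]
    exact lt_measure_of_residualOK (residualOK_extra.2 b hb' s hs')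

end Literature.NumberTheory.MahlerMeasure

end Part7

/-!
## Part 8 — port of `Summits/Ventures/DiscreteObjects/Mahler/TrinomialSmythBound.lean` (6 declarations kept)

# Integer polynomials with at most three monomials: `M ∈ {0, 1} ∪ [θ₀, ∞)` (venture `DiscreteObjects`, target L)

Cell `pub-namedobj`, seat `pub-namedobj-mahler-g24`. Framing: lottery ticket; floor = certified
bounds/negative ranges.

**Theorem** (`smythTheta_le_measure_of_card_support_le_three`).  If `P ∈ ℤ[X]` has at most three nonzero
coefficients and `M(P) > 1`, then `M(P) ≥ θ₀ = 1.3247…` (Smyth's constant, attained by `x³ - x - 1`).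
Folklore given Smyth's theorem (e.g. Dobrowolski, Acta Arith. 123 (2006), p.205: "for `k = 3`, in the case of
a reciprocal polynomial `f`, we trivially get `M(f) ≥ (3 + √5)/2`, while for nonreciprocal polynomials
`M(f) ≥ θ` by Smyth's result"); kernel version, no hypothesis on `P`: strip `x^j`; constants; nonreciprocal
`P` by Smyth's theorem (`SmythTheorem`, kernel gen 8); leading coefficient `≥ 2`; and a monic (anti)reciprocal
`P` with `≤ 3` monomials is `xⁿ + ε` (`M = 1`) or `R(x^m)` with `R = x² + cx + 1`, where `|c| ≤ 2` gives
`M = 1` and `|c| ≥ 3` a real root of modulus `≥ 3/2 > θ₀`.  REPLICATION (folklore).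
For four monomials see `SparseSubLehmer` ([Dobrowolski2006, Prop. 2]).

* `card_support_X_pow_mul`, `intMahlerMeasure_X_pow`, `intMahlerMeasure_X_pow_add_sign` — bookkeeping;
* `measure_quadratic_eq_one_of_abs_le_two`, `three_halves_le_measure_quadratic` — `x² + cx + 1`;
* `smythTheta_le_measure_of_card_support_le_three`, `not_subLehmer_of_card_support_le_three`.
-/

section Part8

namespace Literature.NumberTheory.MahlerMeasure

open _root_.Polynomial

/-- Multiplying by `x^j` shifts the support: same number of monomials.
[cite: Dobrowolski2006, Proposition 2 p.203 (trinomial case)] -/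
theorem card_support_X_pow_mul (P : ℤ[X]) (j : ℕ) : (X ^ j * P).support.card = P.support.card := by
  have h : (X ^ j * P).support = P.support.map ⟨fun a => a + j, add_left_injective j⟩ := by
    ext d
    simp only [mem_support_iff, coeff_X_pow_mul', Finset.mem_map, Function.Embedding.coeFn_mk]
    constructor
    · intro hd
      by_cases hjd : j ≤ d
      · rw [if_pos hjd] at hd
        exact ⟨d - j, hd, by omega⟩
      · rw [if_neg hjd] at hd
        exact absurd rfl hd
    · rintro ⟨a, ha, rfl⟩
      rw [if_pos (by omega), Nat.add_sub_cancel]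
      exact ha
  rw [h, Finset.card_map]

/-- `M(x^j) = 1`. [cite: Dobrowolski2006, Proposition 2 p.203 (trinomial case)] -/
theorem intMahlerMeasure_X_pow (j : ℕ) : intMahlerMeasure ((X : ℤ[X]) ^ j) = 1 := by
  induction j with
  | zero => rw [pow_zero, ← C_1, intMahlerMeasure_C]; simp
  | succ j ih => rw [pow_succ, intMahlerMeasure_mul, ih, intMahlerMeasure_X, one_mul]

/-- `M(x^N + e) = 1` for `e = ±1`, `N > 0` (it divides `x^{2N} - 1`).
[cite: Dobrowolski2006, Proposition 2 p.203 (trinomial case)] -/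
theorem intMahlerMeasure_X_pow_add_sign {e : ℤ} (he : e = 1 ∨ e = -1) {N : ℕ} (hN : 0 < N) :
    intMahlerMeasure (X ^ N + C e : ℤ[X]) = 1 := by
  have hee : e * e = 1 := by rcases he with h | h <;> simp [h]
  have hCe : (C e : ℤ[X]) * C e = 1 := by rw [← map_mul, hee, map_one]
  refine intMahlerMeasure_eq_one_of_mul_eq_X_pow_sub_one (s := X ^ N - C e) (by omega : 0 < 2 * N) ?_
  rw [pow_mul', sq]
  linear_combination (-1 : ℤ[X]) * hCe

/-- `M(x² + cx + 1) = 1` for `|c| ≤ 2` (`Φ₄`, `Φ₃`, `Φ₆`, `(x ± 1)²`).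
[cite: Dobrowolski2006, Proposition 2 p.203 (trinomial case)] -/
theorem measure_quadratic_eq_one_of_abs_le_two {c : ℤ} (hc : |c| ≤ 2) :
    intMahlerMeasure (X ^ 2 + C c * X + C 1 : ℤ[X]) = 1 := by
  have hM1 : intMahlerMeasure (X + 1 : ℤ[X]) = 1 :=
    intMahlerMeasure_eq_one_of_mul_eq_X_pow_sub_one (s := X - 1) (N := 2) (by norm_num) (by ring)
  have hM2 : intMahlerMeasure (X - 1 : ℤ[X]) = 1 :=
    intMahlerMeasure_eq_one_of_mul_eq_X_pow_sub_one (s := X + 1) (N := 2) (by norm_num) (by ring)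
  have hcases : c = -2 ∨ c = -1 ∨ c = 0 ∨ c = 1 ∨ c = 2 := by
    obtain ⟨h1, h2⟩ := abs_le.mp hc; omega
  rcases hcases with h | h | h | h | h <;> rw [h]
  · have e : (X ^ 2 + C (-2 : ℤ) * X + C 1 : ℤ[X]) = (X - 1) * (X - 1) := by
      simp only [map_neg, map_ofNat, map_one]; ring
    rw [e, intMahlerMeasure_mul, hM2, one_mul]
  · exact intMahlerMeasure_eq_one_of_mul_eq_X_pow_sub_one (s := (X + 1) * (X ^ 3 - 1)) (N := 6)
      (by norm_num) (by simp only [map_neg, map_one]; ring)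
  · exact intMahlerMeasure_eq_one_of_mul_eq_X_pow_sub_one (s := X ^ 2 - 1) (N := 4) (by norm_num)
      (by simp only [map_zero, map_one]; ring)
  · exact intMahlerMeasure_eq_one_of_mul_eq_X_pow_sub_one (s := X - 1) (N := 3) (by norm_num)
      (by simp only [map_one]; ring)
  · have e : (X ^ 2 + C (2 : ℤ) * X + C 1 : ℤ[X]) = (X + 1) * (X + 1) := by
      simp only [map_ofNat, map_one]; ring
    rw [e, intMahlerMeasure_mul, hM1, one_mul]

/-- `M(x² + cx + 1) ≥ 3/2` for `|c| ≥ 3`: the real root `-(c + sign(c)√(c² - 4))/2` has modulus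
`(|c| + √(c² - 4))/2 ≥ 3/2`. [cite: Dobrowolski2006, Proposition 2 p.203 (trinomial case)] -/
theorem three_halves_le_measure_quadratic {c : ℤ} (hc : 3 ≤ |c|) :
    (3 : ℝ) / 2 ≤ intMahlerMeasure (X ^ 2 + C c * X + C 1 : ℤ[X]) := by
  have hmon : (X ^ 2 + C c * X + C 1 : ℤ[X]).Monic := by
    have e : (X ^ 2 + C c * X + C 1 : ℤ[X]) = X ^ 2 + (C c * X + C 1) := by ring
    rw [e]
    refine (monic_X_pow 2).add_of_left (lt_of_le_of_lt (degree_add_le _ _) (max_lt ?_ ?_))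
    · exact lt_of_le_of_lt (degree_C_mul_X_le _) (by rw [degree_X_pow]; exact_mod_cast (by norm_num : 1 < 2))
    · exact lt_of_le_of_lt degree_C_le (by rw [degree_X_pow]; exact_mod_cast (by norm_num : 0 < 2))
  set d : ℝ := Real.sqrt ((c : ℝ) ^ 2 - 4) with hd
  have hc' : (3 : ℝ) ≤ |(c : ℝ)| := by exact_mod_cast hc
  have hdisc : (0 : ℝ) ≤ (c : ℝ) ^ 2 - 4 := by nlinarith [abs_nonneg (c : ℝ), sq_abs (c : ℝ)]
  have hd2 : d ^ 2 = (c : ℝ) ^ 2 - 4 := by rw [hd, Real.sq_sqrt hdisc]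
  have hd0 : 0 ≤ d := Real.sqrt_nonneg _
  -- the root `r = -(c + σ d)/2` with `σ = sign c`, of modulus `(|c| + d)/2`
  obtain ⟨σ, hσ, hσc⟩ : ∃ σ : ℝ, (σ = 1 ∨ σ = -1) ∧ σ * (c : ℝ) = |(c : ℝ)| := by
    rcases le_or_gt 0 (c : ℝ) with h | h
    · exact ⟨1, Or.inl rfl, by rw [one_mul, abs_of_nonneg h]⟩
    · exact ⟨-1, Or.inr rfl, by rw [abs_of_neg h]; ring⟩
  have hσσ : σ * σ = 1 := by rcases hσ with h | h <;> simp [h]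
  set r : ℝ := -((c : ℝ) + σ * d) / 2 with hr
  have hroot : aeval (r : ℂ) (X ^ 2 + C c * X + C 1 : ℤ[X]) = 0 := by
    have h1 : r ^ 2 + (c : ℝ) * r + 1 = 0 := by
      rw [hr]; nlinarith [hd2, hσσ]
    simp only [map_add, map_mul, map_pow, aeval_X, eq_intCast, map_intCast, map_one]
    have : ((r : ℂ)) ^ 2 + (c : ℂ) * (r : ℂ) + 1 = ((r ^ 2 + (c : ℝ) * r + 1 : ℝ) : ℂ) := by push_cast; ring
    rw [this, h1]; simp
  have hbound := norm_root_le_intMahlerMeasure hmon hroot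
  rw [Complex.norm_real, Real.norm_eq_abs] at hbound
  have habs : |r| = (|(c : ℝ)| + d) / 2 := by
    have : r = -(σ * (|(c : ℝ)| + d)) / 2 := by
      rw [hr, ← hσc]; linear_combination ((c : ℝ) / 2) * hσσ
    rw [this, abs_div, abs_neg, abs_mul]
    have hσ1 : |σ| = 1 := by rcases hσ with h | h <;> simp [h]
    rw [hσ1, one_mul, abs_of_nonneg (by positivity), abs_of_pos (by norm_num : (0:ℝ) < 2)]
  rw [habs] at hbound
  linarith

/-- **At most three monomials: `M(P) > 1 ⇒ M(P) ≥ θ₀`** (Smyth's constant), for every `P ∈ ℤ[X]`.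
[cite: Dobrowolski2006, Proposition 2 p.203 (trinomial case)] -/
theorem smythTheta_le_measure_of_card_support_le_three (P : ℤ[X]) (hcard : P.support.card ≤ 3)
    (hM : 1 < intMahlerMeasure P) : smythTheta ≤ intMahlerMeasure P := by
  have hθ : smythTheta < 13248 / 10000 := smythTheta_lt
  have hP0 : P ≠ 0 := by
    intro h; rw [h] at hM; unfold intMahlerMeasure at hM; simp at hM; linarith
  -- strip the power of `x`
  obtain ⟨P₀, hP₀, hndvd⟩ := exists_eq_pow_rootMultiplicity_mul_and_not_dvd P hP0 0
  rw [map_zero, sub_zero] at hP₀ hndvd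
  set j := P.rootMultiplicity 0 with hj
  have hc0 : P₀.coeff 0 ≠ 0 := fun h => hndvd (X_dvd_iff.mpr h)
  have hMeq : intMahlerMeasure P = intMahlerMeasure P₀ := by
    rw [hP₀, intMahlerMeasure_mul, intMahlerMeasure_X_pow, one_mul]
  have hcard₀ : P₀.support.card ≤ 3 := by rw [← card_support_X_pow_mul P₀ j, ← hP₀]; exact hcard
  rw [hMeq] at hM ⊢
  have hP₀0 : P₀ ≠ 0 := fun h => hc0 (by rw [h, coeff_zero])
  -- constants: `M = |c| ≥ 2`
  rcases Nat.eq_zero_or_pos P₀.natDegree with hd0 | hdpos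
  · rw [eq_C_of_natDegree_eq_zero hd0, intMahlerMeasure_C] at hM ⊢
    have : (2 : ℝ) ≤ |(P₀.coeff 0 : ℝ)| := by
      have h1' : (1 : ℤ) < |P₀.coeff 0| := by exact_mod_cast hM
      have : (2 : ℤ) ≤ |P₀.coeff 0| := h1'
      exact_mod_cast this
    linarith
  -- nonreciprocal: Smyth
  by_cases hrev : P₀.reverse = P₀ ∨ P₀.reverse = -P₀
  swap
  · obtain ⟨h1, h2⟩ := not_or.mp hrev
    exact intMahlerMeasure_ge_smythTheta_of_nonreciprocal hc0 h1 h2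
  -- leading coefficient `≥ 2`
  by_cases hlc : 2 ≤ |P₀.leadingCoeff|
  · have h := abs_leadingCoeff_le_intMahlerMeasure P₀
    have : (2 : ℝ) ≤ |(P₀.leadingCoeff : ℝ)| := by exact_mod_cast hlc
    linarith
  -- reduce to monic `Q = ± P₀` with `Q_{n-i} = ε Q_i`
  obtain ⟨ε, hε, hrel⟩ : ∃ ε : ℤ, (ε = 1 ∨ ε = -1) ∧
      ∀ i ≤ P₀.natDegree, P₀.coeff (P₀.natDegree - i) = ε * P₀.coeff i := by
    rcases hrev with h | h
    · refine ⟨1, Or.inl rfl, fun i hi => ?_⟩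
      have hc := congrArg (fun Q : ℤ[X] => Q.coeff i) h
      simp only [coeff_reverse, revAt_le hi] at hc
      rw [hc, one_mul]
    · refine ⟨-1, Or.inr rfl, fun i hi => ?_⟩
      have hc := congrArg (fun Q : ℤ[X] => Q.coeff i) h
      simp only [coeff_reverse, revAt_le hi, coeff_neg] at hc
      rw [hc]; ring
  have hlc1 : P₀.leadingCoeff = 1 ∨ P₀.leadingCoeff = -1 := by
    have hne : P₀.leadingCoeff ≠ 0 := leadingCoeff_ne_zero.mpr hP₀0
    have hnn := abs_nonneg P₀.leadingCoeff
    rcases abs_choice P₀.leadingCoeff with h | h <;> rw [h] at hlc hnn <;> omega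
  obtain ⟨Q, hQm, hQM, hQrel, hQcard, hQdeg⟩ : ∃ Q : ℤ[X], Q.Monic ∧ intMahlerMeasure Q = intMahlerMeasure P₀ ∧
      (∀ i ≤ Q.natDegree, Q.coeff (Q.natDegree - i) = ε * Q.coeff i) ∧ Q.support.card ≤ 3 ∧
      0 < Q.natDegree := by
    rcases hlc1 with h1 | h1
    · exact ⟨P₀, h1, rfl, hrel, hcard₀, hdpos⟩
    · refine ⟨-P₀, by rw [Monic, leadingCoeff_neg, h1, neg_neg], intMahlerMeasure_neg P₀, ?_,
        by rwa [support_neg], by rwa [natDegree_neg]⟩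
      intro i hi
      rw [natDegree_neg] at hi ⊢
      rw [coeff_neg, coeff_neg, hrel i hi]; ring
  rw [← hQM] at hM ⊢
  -- support of `Q`: `{0, n}` plus at most one middle index
  set n := Q.natDegree with hn
  have hεε : ε * ε = 1 := by rcases hε with h | h <;> simp [h]
  have hε0 : ε ≠ 0 := by rcases hε with h | h <;> simp [h]
  have hcn : Q.coeff n = 1 := hQm.coeff_natDegree
  have hq0 : Q.coeff 0 = ε := by
    have h := hQrel 0 (Nat.zero_le _)
    rw [Nat.sub_zero, hcn] at h
    linear_combination (-ε) * h + (-(Q.coeff 0)) * hεε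
  set S := (Q.support.erase n).erase 0 with hS
  have hmemS : ∀ k, k ∈ S ↔ k ≠ 0 ∧ k ≠ n ∧ Q.coeff k ≠ 0 := by
    intro k; simp only [hS, Finset.mem_erase, mem_support_iff]
  have hScard : S.card ≤ 1 := by
    have h1 : n ∈ Q.support := mem_support_iff.mpr (by rw [hcn]; exact one_ne_zero)
    have h2 : 0 ∈ Q.support.erase n := Finset.mem_erase.mpr ⟨by omega, mem_support_iff.mpr (by rw [hq0]; exact hε0)⟩
    have e1 : S.card = (Q.support.erase n).card - 1 := Finset.card_erase_of_mem h2
    have e2 : (Q.support.erase n).card = Q.support.card - 1 := Finset.card_erase_of_mem h1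
    omega
  have hzero : ∀ k, k ∉ S → k ≠ 0 → k ≠ n → Q.coeff k = 0 := by
    intro k hk hk0 hkn
    by_contra h
    exact hk ((hmemS k).mpr ⟨hk0, hkn, h⟩)
  rcases Nat.eq_zero_or_pos S.card with h0 | h1
  · -- `Q = xⁿ + ε`: measure `1`, contradiction
    have hSe : S = ∅ := Finset.card_eq_zero.mp h0
    have hQ : Q = X ^ n + C ε := by
      ext k
      simp only [coeff_add, coeff_X_pow, coeff_C]
      by_cases hk0 : k = 0
      · subst hk0; rw [if_neg (by omega), if_pos rfl, hq0, zero_add]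
      by_cases hkn : k = n
      · subst hkn; rw [if_pos rfl, if_neg hk0, hcn, add_zero]
      rw [if_neg hkn, if_neg hk0, add_zero]
      exact hzero k (by rw [hSe]; exact Finset.notMem_empty k) hk0 hkn
    rw [hQ, intMahlerMeasure_X_pow_add_sign hε hQdeg] at hM
    exact absurd hM (lt_irrefl _)
  · -- `Q = R(x^m)`, `R = x² + cx + 1`
    obtain ⟨m, hSm⟩ := Finset.card_eq_one.mp (le_antisymm hScard h1)
    have hmS : m ∈ S := by rw [hSm]; exact Finset.mem_singleton_self m
    obtain ⟨hm0, hmn, hmc⟩ := (hmemS m).mp hmS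
    have hmle : m ≤ n := le_natDegree_of_ne_zero hmc
    have hnm : n - m = m := by
      have h := hQrel m hmle
      by_contra hne
      have hmem : n - m ∈ S := by
        refine (hmemS _).mpr ⟨by omega, by omega, ?_⟩
        rw [h]; exact mul_ne_zero hε0 hmc
      rw [hSm, Finset.mem_singleton] at hmem
      exact hne hmem
    have hn2 : n = 2 * m := by omega
    have hmpos : 0 < m := Nat.pos_of_ne_zero hm0
    have hε1 : ε = 1 := by
      rcases hε with h | h
      · exact h
      · exfalso
        have h2 := hQrel m hmle
        rw [hnm, h] at h2
        have : Q.coeff m = 0 := by linarith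
        exact hmc this
    set c := Q.coeff m with hc
    have hQ : Q = (X ^ 2 + C c * X + C 1 : ℤ[X]).comp (X ^ m) := by
      have e : (X ^ 2 + C c * X + C 1 : ℤ[X]).comp (X ^ m) = X ^ (2 * m) + C c * X ^ m + C 1 := by
        simp only [add_comp, mul_comp, pow_comp, X_comp, C_comp]
        rw [← pow_mul, mul_comm]
      rw [e]
      ext k
      simp only [coeff_add, coeff_X_pow, coeff_C_mul, coeff_C]
      by_cases hk0 : k = 0
      · subst hk0
        rw [if_neg (by omega), if_neg (by omega), if_pos rfl, hq0, hε1]; ring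
      by_cases hkn : k = 2 * m
      · subst hkn
        rw [if_pos rfl, if_neg (by omega), if_neg (by omega), ← hn2, hcn]; ring
      by_cases hkm : k = m
      · subst hkm
        rw [if_neg hkn, if_pos rfl, if_neg hk0]; ring
      rw [if_neg hkn, if_neg hkm, if_neg hk0]
      have : k ∉ S := by rw [hSm, Finset.mem_singleton]; exact hkm
      rw [hzero k this hk0 (by omega)]; ring
    rw [hQ, intMahlerMeasure_comp_X_pow _ hmpos] at hM ⊢
    by_cases hc2 : |c| ≤ 2
    · rw [measure_quadratic_eq_one_of_abs_le_two hc2] at hM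
      exact absurd hM (lt_irrefl _)
    · have h3 := three_halves_le_measure_quadratic (c := c) (by omega)
      linarith

end Literature.NumberTheory.MahlerMeasure

end Part8

/-!
## Part 9 — port of `Summits/Ventures/DiscreteObjects/Mahler/FourTermSharp.lean` (3 declarations kept)

# Dobrowolski's Proposition 2 in the kernel: a quadrinomial has `M = 1` or `M ≥ θ₀` (venture `DiscreteObjects`, target L)

Cell `pub-namedobj`, seat `pub-namedobj-mahler-g24`. Framing: lottery ticket; floor = certified
bounds/negative ranges.

**Theorem** (`smythTheta_le_measure_of_card_support_le_four`; REPLICATION of [Dobrowolski2006] E. Dobrowolski,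
Acta Arith. 123 (2006) 201–231, Proposition 2, with the trivial reductions): every `P ∈ ℤ[X]` with at most
four nonzero coefficients and `M(P) > 1` has `M(P) ≥ θ₀ = M(x³ - x - 1) = 1.3247…` (sharp).  As a corollary the
Literature named fact `QuadrinomialMahlerBound` is DISCHARGED (`quadrinomialMahlerBound_holds`).

Proof = the paper's: reduce to the monic reciprocal quadrinomial `R = x^{p+q} + b x^p + s b x^q + s` with
`gcd(p, q) = 1` (`P₀ = ±R(x^g)`); then the resultant bounds of `FourTermMeasureBound` /
`FourTermCyclotomicFactors` / `FourTermAbsTwoFactors` / `FourTermSpecialFamily` with the cyclotomic parts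
bounded sharply thanks to `gcd = 1` (`FourTermCoprimeSharp`), and the residual finite set —
degree `≤ 5` by `LowDegreeMeasures` (kernel census), `|b| = 2` with `6 ≤ p + q ≤ 26` and `(1,5,±3)`, `(3,5,±4)`
by the Graeffe certificates of `FourTermResidualCerts` (the paper: "checked by direct computation of `M(f)`").

* `smythTheta_le_measure_quadrinomial_coprime`, `smythTheta_le_measure_quadrinomial`;
* `smythTheta_le_measure_of_card_support_le_four`, `measure_dichotomy_of_card_support_le_four`;
* `intMahlerMeasure_quadrinomial_sharp` (`x⁴ - x³ - x² + 1`: four monomials, `M = θ₀`);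
* `quadrinomialMahlerBound_holds`.
-/

section Part9

namespace Literature.NumberTheory.MahlerMeasure

open _root_.Polynomial

section Quadrinomial

variable {p q : ℕ} {b s : ℤ}

/-- **The coprime quadrinomial.**  `R = x^{p+q} + b x^p + s b x^q + s` with `0 < p < q`, `gcd(p,q) = 1`, `s = ±1`,
`b ≠ 0` and `M(R) > 1` has `M(R) ≥ θ₀`. [cite: Dobrowolski2006, Proposition 2 p.203 (M(f) ≥ θ₀ for quadrinomials)] -/
theorem smythTheta_le_measure_quadrinomial_coprime (hp : 0 < p) (hpq : p < q) (hcop : Nat.Coprime p q)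
    (hs : s = 1 ∨ s = -1) (hb0 : b ≠ 0)
    (hM : 1 < intMahlerMeasure (X ^ (p + q) + C b * X ^ p + C (s * b) * X ^ q + C s : ℤ[X])) :
    smythTheta ≤ intMahlerMeasure (X ^ (p + q) + C b * X ^ p + C (s * b) * X ^ q + C s : ℤ[X]) := by
  obtain ⟨hmon, hdeg⟩ := quadrinomial_monic_natDegree hp hpq b s
  set P : ℤ[X] := X ^ (p + q) + C b * X ^ p + C (s * b) * X ^ q + C s with hP
  set n := p + q with hn
  have hθ : smythTheta < 13248 / 10000 := smythTheta_lt
  -- degree `≤ 5`: the low-degree kernel census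
  by_cases hn5 : n ≤ 5
  · exact not_measure_lt_smythTheta_of_natDegree_le_five (by rw [hdeg]; exact hn5) hM
  have hn6 : 6 ≤ n := by omega
  -- `|b| = 1`: `R = (x^p + sb)(x^q + b)` has measure `1`
  by_cases hb1 : |b| = 1
  · exfalso
    have hbs : b = 1 ∨ b = -1 := by rcases abs_choice b with h | h <;> rw [h] at hb1 <;> omega
    have hbb : b * b = 1 := by rcases hbs with h | h <;> simp [h]
    have hfac : P = (X ^ p + C (s * b)) * (X ^ q + C b) := by
      have hCb : (C b : ℤ[X]) * C b = 1 := by rw [← map_mul, hbb, map_one]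
      rw [hP, map_mul, pow_add]; linear_combination (-(C s : ℤ[X])) * hCb
    have hsb : s * b = 1 ∨ s * b = -1 := by rcases hs with h | h <;> rcases hbs with h' | h' <;> simp [h, h']
    rw [hfac, intMahlerMeasure_mul, intMahlerMeasure_X_pow_add_sign hsb hp,
      intMahlerMeasure_X_pow_add_sign hbs (by omega), mul_one] at hM
    exact lt_irrefl _ hM
  have hb2 : 2 ≤ |b| := by have := abs_pos.mpr hb0; omega
  by_cases hb2' : |b| = 2
  · -- `|b| = 2`: certificates for `6 ≤ n ≤ 26`, the long case beyond
    have hbb : b = 2 ∨ b = -2 := by rcases abs_choice b with h | h <;> rw [h] at hb2' <;> omega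
    by_cases hn26 : n ≤ 26
    · exact le_of_lt (lt_trans hθ (lt_measure_residual_two hp hpq hcop hn6 hn26 hbb hs))
    · exact smythTheta_le_measure_quadrinomial_two hp hpq hcop hs hbb (by omega)
  have hb3 : 3 ≤ |b| := by omega
  by_cases hfam : p + q = b.natAbs * (q - p)
  · -- the special family: `|b| = 3` is impossible for coprime exponents, `|b| = 4` is `(3, 5)`, `|b| ≥ 5`
    have hB : (b.natAbs : ℤ) = |b| := Int.natCast_natAbs b
    by_cases hb4 : |b| ≤ 4
    · have hb34 : b.natAbs = 3 ∨ b.natAbs = 4 := by omega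
      rcases hb34 with h3 | h4
      · exfalso
        rw [h3] at hfam
        have : q = 2 * p := by omega
        have : Nat.gcd p q = p := by rw [this]; exact Nat.gcd_eq_left ⟨2, by ring⟩
        rw [Nat.Coprime] at hcop; omega
      · rw [h4] at hfam
        have hp3 : p = 3 := by
          have h1 : p ∣ 3 * q := ⟨5, by omega⟩
          have h2 : p ∣ 3 := hcop.dvd_of_dvd_mul_right h1
          have h3' : 3 ∣ 5 * p := ⟨q, by omega⟩
          have h4' : 3 ∣ p := (Nat.Coprime.dvd_of_dvd_mul_left (by norm_num) h3')
          exact Nat.dvd_antisymm h2 h4'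
        have hq5 : q = 5 := by omega
        subst hp3; subst hq5
        have hb44 : b = 4 ∨ b = -4 := by rcases abs_choice b with h | h <;> rw [h] at hb4 hb3 <;> omega
        exact le_of_lt (lt_trans hθ ((lt_measure_residual_extra (b := b) hs).2 hb44))
    · exact smythTheta_le_measure_quadrinomial_special hp hpq hs (by omega) hfam
  · -- generic: `|b| = 3`, `n = 6` is `(1, 5)` (certificate); otherwise the generic bound
    by_cases h36 : |b| = 3 ∧ n = 6
    · obtain ⟨h3, hn6'⟩ := h36
      have hp1 : p = 1 := by
        have hq : q = 6 - p := by omega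
        have hlt : p < 3 := by omega
        interval_cases p
        · rfl
        · exfalso; rw [hq] at hcop; norm_num at hcop
      have hq5 : q = 5 := by omega
      subst hp1; subst hq5
      have hb33 : b = 3 ∨ b = -3 := by rcases abs_choice b with h | h <;> rw [h] at h3 <;> omega
      exact le_of_lt (lt_trans hθ ((lt_measure_residual_extra (b := b) hs).1 hb33))
    · exact smythTheta_le_measure_quadrinomial_generic hp hpq hcop hs hb3 hfam hn6
        (fun h3 h6 => h36 ⟨h3, h6⟩)

/-- **Any reciprocal quadrinomial** `x^{p+q} + b x^p + s b x^q + s` (`0 < p < q`, `s = ±1`, `b ≠ 0`) with `M > 1`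
has `M ≥ θ₀`: reduce to `gcd(p, q) = 1` through `P = R(x^g)`.
[cite: Dobrowolski2006, Proposition 2 p.203 (M(f) ≥ θ₀ for quadrinomials)] -/
theorem smythTheta_le_measure_quadrinomial (hp : 0 < p) (hpq : p < q) (hs : s = 1 ∨ s = -1) (hb0 : b ≠ 0)
    (hM : 1 < intMahlerMeasure (X ^ (p + q) + C b * X ^ p + C (s * b) * X ^ q + C s : ℤ[X])) :
    smythTheta ≤ intMahlerMeasure (X ^ (p + q) + C b * X ^ p + C (s * b) * X ^ q + C s : ℤ[X]) := by
  set g := Nat.gcd p q with hg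
  have hg0 : 0 < g := Nat.gcd_pos_of_pos_left _ hp
  obtain ⟨p', hp'⟩ : g ∣ p := Nat.gcd_dvd_left p q
  obtain ⟨q', hq'⟩ : g ∣ q := Nat.gcd_dvd_right p q
  have hp'0 : 0 < p' := by
    rcases Nat.eq_zero_or_pos p' with h | h
    · rw [h, mul_zero] at hp'; omega
    · exact h
  have hp'q' : p' < q' := by
    by_contra h; push Not at h
    have : q ≤ p := by rw [hp', hq']; exact Nat.mul_le_mul_left g h
    omega
  have hcop : Nat.Coprime p' q' := by
    have h := Nat.coprime_div_gcd_div_gcd (m := p) (n := q) hg0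
    rw [← hg] at h
    have e1 : p / g = p' := by rw [hp', Nat.mul_div_cancel_left _ hg0]
    have e2 : q / g = q' := by rw [hq', Nat.mul_div_cancel_left _ hg0]
    rwa [e1, e2] at h
  have hPR : (X ^ (p + q) + C b * X ^ p + C (s * b) * X ^ q + C s : ℤ[X]) =
      (X ^ (p' + q') + C b * X ^ p' + C (s * b) * X ^ q' + C s : ℤ[X]).comp (X ^ g) := by
    rw [← quadrinomial_eq_comp_X_pow, hp', hq', mul_comm g p', mul_comm g q']
  rw [hPR, intMahlerMeasure_comp_X_pow _ hg0] at hM ⊢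
  exact smythTheta_le_measure_quadrinomial_coprime hp'0 hp'q' hcop hs hb0 hM

end Quadrinomial

/-- **Dobrowolski's Proposition 2 in the kernel.**  Every `P ∈ ℤ[X]` with at most four nonzero coefficients
and `M(P) > 1` has `M(P) ≥ θ₀ = 1.3247…` (Smyth's constant; sharp for `x³ - x - 1` and
`x⁴ - x³ - x² + 1`).  [Dobrowolski2006, Prop. 2] — REPLICATION.
[cite: Dobrowolski2006, Proposition 2 p.203 (M(f) ≥ θ₀ for quadrinomials)] -/
theorem smythTheta_le_measure_of_card_support_le_four (P : ℤ[X]) (hcard : P.support.card ≤ 4)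
    (hM : 1 < intMahlerMeasure P) : smythTheta ≤ intMahlerMeasure P := by
  have hP0 : P ≠ 0 := by
    intro h; rw [h] at hM; unfold intMahlerMeasure at hM; simp at hM; linarith
  -- strip the power of `x`
  obtain ⟨P₀, hP₀, hndvd⟩ := exists_eq_pow_rootMultiplicity_mul_and_not_dvd P hP0 0
  rw [map_zero, sub_zero] at hP₀ hndvd
  set j := P.rootMultiplicity 0 with hj
  have hc0 : P₀.coeff 0 ≠ 0 := fun h => hndvd (X_dvd_iff.mpr h)
  have hMeq : intMahlerMeasure P = intMahlerMeasure P₀ := by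
    rw [hP₀, intMahlerMeasure_mul, intMahlerMeasure_X_pow, one_mul]
  have hcard₀ : P₀.support.card ≤ 4 := by rw [← card_support_X_pow_mul P₀ j, ← hP₀]; exact hcard
  rw [hMeq] at hM ⊢
  have hP₀0 : P₀ ≠ 0 := fun h => hc0 (by rw [h, coeff_zero])
  -- constants
  rcases Nat.eq_zero_or_pos P₀.natDegree with hd0 | hdpos
  · rw [eq_C_of_natDegree_eq_zero hd0, intMahlerMeasure_C] at hM ⊢
    have : (2 : ℝ) ≤ |(P₀.coeff 0 : ℝ)| := by
      have h1' : (1 : ℤ) < |P₀.coeff 0| := by exact_mod_cast hM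
      have : (2 : ℤ) ≤ |P₀.coeff 0| := h1'
      exact_mod_cast this
    linarith [smythTheta_lt]
  -- nonreciprocal: Smyth
  by_cases hrev : P₀.reverse = P₀ ∨ P₀.reverse = -P₀
  swap
  · obtain ⟨h1, h2⟩ := not_or.mp hrev
    exact intMahlerMeasure_ge_smythTheta_of_nonreciprocal hc0 h1 h2
  -- leading coefficient `≥ 2`
  by_cases hlc : 2 ≤ |P₀.leadingCoeff|
  · have h := abs_leadingCoeff_le_intMahlerMeasure P₀
    have : (2 : ℝ) ≤ |(P₀.leadingCoeff : ℝ)| := by exact_mod_cast hlc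
    linarith [smythTheta_lt]
  obtain ⟨ε, hε, hrel⟩ : ∃ ε : ℤ, (ε = 1 ∨ ε = -1) ∧
      ∀ i ≤ P₀.natDegree, P₀.coeff (P₀.natDegree - i) = ε * P₀.coeff i := by
    rcases hrev with h | h
    · refine ⟨1, Or.inl rfl, fun i hi => ?_⟩
      have hc := congrArg (fun Q : ℤ[X] => Q.coeff i) h
      simp only [coeff_reverse, revAt_le hi] at hc
      rw [hc, one_mul]
    · refine ⟨-1, Or.inr rfl, fun i hi => ?_⟩
      have hc := congrArg (fun Q : ℤ[X] => Q.coeff i) h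
      simp only [coeff_reverse, revAt_le hi, coeff_neg] at hc
      rw [hc]; ring
  have hlc1 : P₀.leadingCoeff = 1 ∨ P₀.leadingCoeff = -1 := by
    have hne : P₀.leadingCoeff ≠ 0 := leadingCoeff_ne_zero.mpr hP₀0
    have hnn := abs_nonneg P₀.leadingCoeff
    rcases abs_choice P₀.leadingCoeff with h | h <;> rw [h] at hlc hnn <;> omega
  obtain ⟨Q, hQm, hQM, hQrel, hQcard, hQdeg⟩ : ∃ Q : ℤ[X], Q.Monic ∧ intMahlerMeasure Q = intMahlerMeasure P₀ ∧
      (∀ i ≤ Q.natDegree, Q.coeff (Q.natDegree - i) = ε * Q.coeff i) ∧ Q.support.card ≤ 4 ∧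
      0 < Q.natDegree := by
    rcases hlc1 with h1 | h1
    · exact ⟨P₀, h1, rfl, hrel, hcard₀, hdpos⟩
    · refine ⟨-P₀, by rw [Monic, leadingCoeff_neg, h1, neg_neg], intMahlerMeasure_neg P₀, ?_,
        by rwa [support_neg], by rwa [natDegree_neg]⟩
      intro i hi
      rw [natDegree_neg] at hi ⊢
      rw [coeff_neg, coeff_neg, hrel i hi]; ring
  rw [← hQM] at hM ⊢
  -- at most three monomials: `TrinomialSmythBound`
  by_cases hQ3 : Q.support.card ≤ 3
  · exact smythTheta_le_measure_of_card_support_le_three Q hQ3 hM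
  have hQ4 : Q.support.card = 4 := by omega
  -- four monomials: the support is `{0, p, q, n}` with `q = n - p`
  set n := Q.natDegree with hn
  have hεε : ε * ε = 1 := by rcases hε with h | h <;> simp [h]
  have hε0 : ε ≠ 0 := by rcases hε with h | h <;> simp [h]
  have hcn : Q.coeff n = 1 := hQm.coeff_natDegree
  have hq0 : Q.coeff 0 = ε := by
    have h := hQrel 0 (Nat.zero_le _)
    rw [Nat.sub_zero, hcn] at h
    linear_combination (-ε) * h + (-(Q.coeff 0)) * hεε
  set S := (Q.support.erase n).erase 0 with hS
  have hmemS : ∀ k, k ∈ S ↔ k ≠ 0 ∧ k ≠ n ∧ Q.coeff k ≠ 0 := by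
    intro k; simp only [hS, Finset.mem_erase, mem_support_iff]
  have hScard : S.card = 2 := by
    have h1 : n ∈ Q.support := mem_support_iff.mpr (by rw [hcn]; exact one_ne_zero)
    have h2 : 0 ∈ Q.support.erase n := Finset.mem_erase.mpr ⟨by omega, mem_support_iff.mpr (by rw [hq0]; exact hε0)⟩
    have e1 : S.card = (Q.support.erase n).card - 1 := Finset.card_erase_of_mem h2
    have e2 : (Q.support.erase n).card = Q.support.card - 1 := Finset.card_erase_of_mem h1
    omega
  have hzero : ∀ k, k ∉ S → k ≠ 0 → k ≠ n → Q.coeff k = 0 := by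
    intro k hk hk0 hkn
    by_contra h
    exact hk ((hmemS k).mpr ⟨hk0, hkn, h⟩)
  have hsymm : ∀ k ∈ S, n - k ∈ S := by
    intro k hk
    obtain ⟨hk0, hkn, hkc⟩ := (hmemS k).mp hk
    have hkle : k ≤ n := le_natDegree_of_ne_zero hkc
    refine (hmemS _).mpr ⟨by omega, by omega, ?_⟩
    rw [hQrel k hkle]
    exact mul_ne_zero hε0 hkc
  obtain ⟨i, j', hij, hSij⟩ := Finset.card_eq_two.mp hScard
  wlog hlt : i < j' generalizing i j'
  · exact this j' i hij.symm (by rw [hSij, Finset.pair_comm]) (by omega)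
  have hiS : i ∈ S := by rw [hSij]; simp
  have hjS : j' ∈ S := by rw [hSij]; simp
  obtain ⟨hi0, hin, hic⟩ := (hmemS i).mp hiS
  obtain ⟨hj0, hjn, hjc⟩ := (hmemS j').mp hjS
  have hile : i ≤ n := le_natDegree_of_ne_zero hic
  have hjle : j' ≤ n := le_natDegree_of_ne_zero hjc
  have h1 := hsymm i hiS
  have h2' := hsymm j' hjS
  rw [hSij, Finset.mem_insert, Finset.mem_singleton] at h1 h2'
  have hnij : n = i + j' := by omega
  have hipos : 0 < i := Nat.pos_of_ne_zero hi0
  set b := Q.coeff i with hb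
  have hcj : Q.coeff j' = ε * b := by
    have h := hQrel i hile
    rwa [show n - i = j' by omega] at h
  have hQ : Q = X ^ (i + j') + C b * X ^ i + C (ε * b) * X ^ j' + C ε := by
    ext k
    simp only [coeff_add, coeff_X_pow, coeff_C_mul, coeff_C]
    by_cases hk0 : k = 0
    · subst hk0
      rw [if_neg (by omega), if_neg (by omega), if_neg (by omega), if_pos rfl, hq0]; ring
    by_cases hkn : k = i + j'
    · subst hkn
      rw [if_pos rfl, if_neg (by omega), if_neg (by omega), if_neg (by omega), ← hnij, hcn]; ring
    by_cases hki : k = i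
    · subst hki
      rw [if_neg hkn, if_pos rfl, if_neg (by omega), if_neg hk0]; ring
    by_cases hkj : k = j'
    · subst hkj
      rw [if_neg hkn, if_neg (by omega), if_pos rfl, if_neg hk0, hcj]; ring
    rw [if_neg hkn, if_neg hki, if_neg hkj, if_neg hk0]
    have : k ∉ S := by rw [hSij, Finset.mem_insert, Finset.mem_singleton]; exact not_or.mpr ⟨hki, hkj⟩
    rw [hzero k this hk0 (by omega)]; ring
  rw [hQ] at hM ⊢
  exact smythTheta_le_measure_quadrinomial hipos hlt hε hic hM

end Literature.NumberTheory.MahlerMeasure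

end Part9

/-! ## Part 10 — the EXACT discharge(s) -/

namespace Literature.NumberTheory.MahlerMeasure

open Polynomial in
/-- **The Literature named fact `QuadrinomialMahlerBound` HOLDS** — Dobrowolski 2006, Proposition 2: a monic `f ∈ ℤ[x]` with `f(0) ≠ 0`
and exactly four nonzero coefficients which is not a product of cyclotomic polynomials has `M(x³ − x − 1) ≤ M(f)`.  EXACT discharge,
Literature-side twin of `Summit.Ventures.DiscreteObjects.Mahler.quadrinomialMahlerBound_holds` (same proof).
[cite: Dobrowolski2006, Proposition 2 p.203] -/
theorem QuadrinomialMahlerBound_holds : QuadrinomialMahlerBound := by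
  intro f hmon h0 hcard hncyc
  change intMahlerMeasure (X ^ 3 - X - 1 : ℤ[X]) ≤ intMahlerMeasure f
  rw [intMahlerMeasure_X_cube_sub_X_sub_one]
  have hf0 : f ≠ 0 := hmon.ne_zero
  rcases (one_le_intMahlerMeasure hf0).lt_or_eq with hlt | heq
  · exact smythTheta_le_measure_of_card_support_le_four f hcard.le hlt
  exfalso
  obtain ⟨u, a, t, hu, -, hf⟩ := kronecker_form heq.symm
  have ha : a = 0 := by
    by_contra ha
    apply h0
    rw [hf, coeff_zero_eq_eval_zero, eval_mul, eval_mul, eval_pow, eval_X, zero_pow ha, mul_zero, zero_mul]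
  have hu1 : u = 1 := by
    have hl : f.leadingCoeff = 1 := hmon
    rwa [hf, ha, pow_zero, mul_one, leadingCoeff_mul, leadingCoeff_C, (monic_cyclotomic_prod t).leadingCoeff,
      mul_one] at hl
  exact hncyc t (by rw [hf, ha, hu1, pow_zero, mul_one, C_1, one_mul])

end Literature.NumberTheory.MahlerMeasure

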